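import Mathlib

/-!
# `Lines/toric_sgame_charts.lean` — the FREE-DIRECTION CHART COMPUTATION behind E-S6(iv) / census counter a6 (`mult3AtEnd`), in the kernel
(res-B-lens-2 g9, G12 (b); rev 5.3 (= rev 5.2 + §9e twisted local constants at interior points of exceptional curves — kernel support of the ERRATUM dictionary rev 1.4.3 §7: the hypothesis of «tracking» is the LOCAL cube condition (C³_loc)/(C³)⁺, not the single condition (C³) on f); rev 5.2 (= rev 4.1 + §9 near points off S′: the cube dichotomy, §9c the bridge `coeff_classForm_deg3`, §9d the S′-part of the directrix `cubeF_dir_S`); rev 4.1 = rev 3 + §8 the multiplicity rows (order of the class form at a node / along a curve, ∀ units; TOP/DEEP ⟺ `isDeepW`, mult ≥ 2 / 𝒞 ⟺ `ge 2 1 0`/`isCW`, Bennett row mult ≥ 4); rev 3 = rev 2 + §7 the S′-chart bookkeeping = `applyMove`/`blowup`; rev 2 = rev 1 + §6 point blow-ups; companion of `Lines/giraud-sgame-dictionary.md` §5 and of `Lines/toric_sgame.lean` rev 10 / `Lines/toric_sgame_allchains.lean` rev 2)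

Crux `stmt-ResolutionOfSingularities-0549` (`Theses.Descent.DescentPerfectToAll`), sub-line `giraud-weak-normal-form`.
LABELS: bears_on LADDER-RESOLUTION:B · [OURS · CANDIDATE] counted 0 · de-risking scaffolding for the Giraud-normal-form sub-line,
NOT rung-B progress · nothing here proves resolution in char p · resolution in char p NOT proved · AI-written, weaker than expert
review. It is a crux WORKFILE, not a skeleton: no `sorry`, registers no stub, must never be `ledger skeleton check`ed against 0549/0550.
Axioms of the headline theorems: `propext`, `Classical.choice`, `Quot.sound` only.

## What is proved (pure commutative algebra in `R⟦x₀,x₁,x₂,x₃⟧` over an arbitrary commutative ring `R`; no schemes)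
* §0 verbatim copy of `Wt/wge/wadd/W3/Curve/dbl/mult3AtEnd` from `Lines/toric_sgame.lean` §B (Lines modules are not importable on the farm);
  §0′ the ORDER DATA `ordZ/ordA/ordG α K N : Wt` of the three kinds of free-direction points (computable; `decide` sanity checks against the
  sheet, incl. the E-S6(iv) witness of loop note §9.14 (3)(b): `ordZ = 3`, test positive).
* §1 LEMMA A (`order_sum_oterm`, `order_sum_monomial_mul`): a finite sum `Σ_i x^{e_i}·u_i` of monomials with PAIRWISE DISTINCT exponents and
  coefficients `u_i` of non-zero constant term has order EXACTLY `min_i |e_i|` — no cancellation, WHATEVER the `u_i` are («multiplicity =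
  least order, for all unit values»).
* §2 the free-direction chart normal forms of an ACCEPT (blow-up along the centre `K = V(z,y,u)`, exceptional exponent `α`) at the points
  `q_z = (1:0:0)` (`expZ`), `q_a = (a:1:0)` with `a³ = −1` (`expA`) and a generic direction (`expG`) of the fibre over an END NODE `K ∩ N`, as sums
  of optional unit·monomial terms `chartNF ex u`; under LEGALITY (`w_b + b ≥ α`, `α ≤ 3`: `Legal`, `legal_D`, `legal_A`) the present exponent
  vectors are pairwise distinct (tag `d 0 + α − d 2`), so by Lemma A the orders are `ordZ/ordA/ordG` FOR EVERY FAMILY OF UNIT FACTORS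
  (`order_chartZ/A/G`); the geometric unit factors are units: `1 + y′³`, and at `q_a` `(a+Z)³ + 1 = Z·(3a² + 3aZ + Z²)` with `3a²` a unit iff
  `3` is (`cubic_shift_eq`, `constantCoeff_qaFactor`, `isUnit_three_mul_sq`; `order_zChart`, `order_aChart`).
* §3 the BRIDGE to the census predicate: `mult3AtEnd α K N = true ↔ 3 ≤ ordZ ∨ 3 ≤ ordA` for ALL `α, K, N` (`mult3AtEnd_iff`, `mult3AtEnd_eq`),
  hence under legality and for all unit values `mult3AtEnd ↔ (order ≥ 3 at q_z) ∨ (order ≥ 3 at q_a)` (`mult3AtEnd_iff_order`).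
* §4 DOMINATION: generic directions and `(0:1:0)` are dominated by `q_a` (`ordG_le_ordA`), fibres over interior points of the centre by the
  fibres over its end nodes (`ordZ/ordA/ordG_interior_le`); so a negative test at the end nodes bounds the order by `2` on the whole
  free-direction line `{u = 0} ≅ ℙ¹` of EVERY fibre of the exceptional divisor (`freeLine_orders_lt_three`).
* §5 the chart forms ARE the blow-up transforms (`MvPowerSeries.subst`): from the CONTROLLED CLASS FORM `classForm K N c₀ c₁ c₂ U =
  Σ_b c_b y^b u^{w_b} v^{e_b} + U u^{w₃} v^{e₃} (z³ + y³)` (sheet S1) the substitution of the `z`-chart `aZ = (z, zy′, zu′, v)` resp. of the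
  recentred `y`-chart `aY a = (y(a+Z), y, yu′, v)` gives `x₀^α ·` (the §2 normal form with the substituted units) (`zChart_transform`,
  `aChart_transform`, `gChart_transform`; units stay units: `constantCoeff_subst_of_zero`), whence `∃ g, total transform = x₀^α·g ∧ ord g =
  ordZ|ordA|ordG` (`zChart/aChart/gChart_strictTransform_order`) and the GEOMETRIC form of E-S6(iv): `mult3AtEnd α K N ↔` the strict
  transform has order ≥ 3 at `q_z` or at `q_a` (`mult3AtEnd_iff_strictTransform`; hypotheses: legal accept, unit constant terms, `3 ∈ R×`).
* §6 (rev 2) the SAME COMPUTATION FOR POINT BLOW-UPS (moves `I`, `P`; centre the node `V(z,y,u,v)`, exceptional divisor `ℙ³`, free-direction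
  line `{u = v = 0} ≅ ℙ¹_{(z:y)}`): order data `pordZ/pordA/pordG` (class `b` ↦ `2b + 2o_b − α` resp. `b + 2o_b − α`, cubic ↦ `3 + 2o₃ − α` resp.
  `4 + 2o₃ − α` at `q_a`), legality `LegalPt` (`o_b + b ≥ α`; `legalPt_three` = top node, `legalPt_two`), orders for all unit values
  (`order_pchartZ/A/G`), chart maps `pZ = (z, zy′, zu′, zv′)`, `pY a = (y(a+Z), y, yu′, yv′)` and `pzChart/paChart/pgChart_transform`,
  `p?Chart_strictTransform_order`; BOUNDS from the kernel facts of the game: `α = 3` blow-ups happen at cubic-free nodes (`lemma3_gmult|uv`) ⇒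
  orders `≤ 0 / ≤ 1 / ≤ 0` (`pord_three_noCubic`: `q_z` and the generic directions are off `X′`, `q_a` is smooth or off), `α = 2` blow-ups at nodes
  with `o₀ = 2` (`F2_P`) ⇒ orders `≤ 2` (`pord_two_o0`; the double points `a³ = −1` of sheet S6 (vi)); summary `pointFreeLine_orders_le_two` and its
  geometric form `pointFreeLine_strictTransform_le_two`: NO multiplicity-3 point on the free-direction line of any point blow-up of a legal play,
  for all unit values.
* §7 (rev 3) the `S′`-CHART BOOKKEEPING of the dictionary (§4 there) in the kernel: substituting the `S′`-charts — accept `sK = (u′z′, u′y′, u′, v)`,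
  point blow-up `pU = (u z′, u y′, u, u v′)` and `pV = (v z′, v y′, v u′, v)` — into `classForm K N c₀ c₁ c₂ U` gives `exc^α ·` the class form of EXACTLY
  the pair of branches the game writes at the new node: `(accD K, N)` for `D` (`w ↦ w − (3,2,1)`), `(accA K, N)` for `A`/`AL` (`w ↦ w − (2,1,0)`,
  `w₃ ↦ w₃ + 1`), `(newborn K N α, N)` and `(K, newborn K N α)` for `I`/`P` (`w_b(Γ) = o_b + b − α`, `w₃(Γ) = o₃ + 3 − α`) — `accD`, `accA`, `newborn`
  being the verbatim bodies of `applyMove` / `blowup` of `Lines/toric_sgame.lean` §B — with substituted units of unchanged constant term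
  (`sChart_transform_D`, `sChart_transform_A`, `puChart_transform`, `pvChart_transform`, `constantCoeff_subst_sK/pU/pV`). So the class form is STABLE
  under every move with the game's weight update (kernel algebra); S1 keeps by hand only that these are the charts of the blow-ups of `W` through the
  new nodes and that good points stay good.
* §8 (rev 4) the MULTIPLICITY ROWS of the dictionary (§3 there) in the kernel: the class form is a sum of five optional terms with pairwise distinct
  exponents, so by Lemma A its order at the node is EXACTLY `nodeOrd K N = min_b (b + o_b) ⊓ (3 + o₃)` over the present classes, for ALL unit values
  (`order_classForm`); hence `3 ≤ mult ⟺ isDeepW (K.w.add N.w)` (the `𝒟`-node case of `topN`; `three_le_order_classForm_iff`) and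
  `2 ≤ mult ⟺ (K.w.add N.w).ge 2 1 0` (`two_le_order_classForm_iff`), the Bennett row `4 ≤ mult ⟺ o ≥ (4,3,2) ∧ o₃ ≥ 1`
  (`four_le_order_classForm_iff`); an interior good point of `K` is its node with the trivial partner `triv`
  (`W3.add_triv`, `classForm_triv`), so generically along `K`: DEEP ⟺ `isDeepW K.w`, class 𝒞 ⟺ `isCW K.w` (`three_le/two_le_order_interior_iff`) —
  `W3.ge`, `isDeepW`, `isSingW`, `isCW` verbatim from `toric_sgame.lean` §B. (The `Sing₂(J)` row is about the weighted coefficient ideal, not a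
  multiplicity, and stays a definition.)
BY HAND remain (dictionary note `Lines/giraud-sgame-dictionary.md`): that the controlled class form IS the local shape of the equation along
the centres of the game (sheet S1 / loop note §9.1, 9.3′) and the S-chart bookkeeping (`applyMove`); NOT covered anywhere (census / (H1⁺)
territory, loop note §9.14 (1),(4); sheet S6 (i)–(iii)): the affine points `(z₀:y₀:1) ≠ (0:0:1)` of the fibres (S-chart, off `S′`), where the
`y`-grading collapses and special unit values can conspire. With `no_mult3AtEnd_gmult|uv` of `Lines/toric_sgame_allchains.lean` §B⁷ (a6 = 0
at both end nodes of every accept of every legal play from every seed, modes `G_mult`/`uv`) and with `lemma3_*` / `F2_P`, this file gives: granted S1, NO MOVE of a legal play (accept or point blow-up) creates a point of multiplicity ≥ 3 on the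
free-direction line of any fibre of its exceptional divisor, for any unit values; what is left to the census / (H1⁺) are the affine off-`S′` points only.
-/

set_option linter.dupNamespace false
set_option linter.style.longLine false
set_option autoImplicit false

namespace Summit.ResolutionOfSingularities.ResolutionOfSingularities.Cruxes.DescentPerfectToAll.GiraudWeakNormalForm.ToricSGame.Charts

open MvPowerSeries

/-! ## §0. Verbatim copy of the data types and of the census predicate of `Lines/toric_sgame.lean` §B (Lines modules are not importable) -/

/-- One grade weight `w_b = ord_C(g_b)`; `none` = ∞ (the class part `g_b` is identically zero). -/
abbrev Wt := Option ℕ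

/-- `w ≥ t` for a grade weight (`∞ ≥ t` always). -/
def wge (w : Wt) (t : ℕ) : Bool := match w with | none => true | some n => Nat.ble t n

/-- Sum of grade weights (∞ absorbing). -/
def wadd : Wt → Wt → Wt
  | some x, some y => some (x + y)
  | _, _ => none

/-- The weight vector `(w₀, w₁, w₂)` of a curve (orders of the three class parts `g₀, g₁, g₂`). -/
structure W3 where
  w0 : Wt
  w1 : Wt
  w2 : Wt
deriving DecidableEq, Repr, Inhabited, Hashable

/-- A curve of the chain: class weights `w`, the CUBIC weight `w3 = ord_C` of the class-3 part `(z³+y³)/3`, and the flag `bd`. -/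
structure Curve where
  w : W3
  w3 : ℕ
  bd : Bool
deriving DecidableEq, Repr, Inhabited, Hashable

/-- `2·w + e` on grade weights (`∞` absorbing). -/
def dbl (w e : Wt) : Wt := wadd (w.map (2 * ·)) e

/-- MULTIPLICITY-3 TEST at the two distinguished points of the free-direction charts over an END NODE of an accept (exceptional
exponent `α`) of the curve `c` against the partner datum `nb` (verbatim from `Lines/toric_sgame.lean` §B, lines 435–452 of rev 10). -/
def mult3AtEnd (α : ℕ) (c nb : Curve) : Bool :=
  let t3 := 2 * c.w3 + nb.w3
  let d0 := dbl c.w.w0 nb.w.w0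
  let d1 := dbl c.w.w1 nb.w.w1
  let d2 := dbl c.w.w2 nb.w.w2
  (Nat.ble α t3 && wge d0 (3 + α) && wge d1 (1 + α) && wge d2 (α - 1)) ||
  (Nat.ble α (t3 + 1) && wge d0 (3 + α) && wge d1 (2 + α) && wge d2 (1 + α))

/-! ## §0′. The ORDER DATA of the three kinds of free-direction points (computable, on grade weights; `none = ∞`) -/

/-- `min` of grade weights -/
def wmin : Wt → Wt → Wt
  | none, b => b
  | some m, none => some m
  | some m, some n => some (min m n)

/-- order of a term with paired datum `d` (`= 2w_b + e_b` for class `b`, `2w₃ + e₃` for the cubic) and shift `k`: `k + d − α` (`∞` if absent) -/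
def tord (k α : ℕ) (d : Wt) : Wt := d.map fun n => k + n - α

/-- ORDER AT `q_z = (1:0:0)` (z-chart): `min (2w₀+e₀−α, 2+2w₁+e₁−α, 4+2w₂+e₂−α, 3+2w₃+e₃−α)`, absent classes omitted -/
def ordZ (α : ℕ) (K N : Curve) : Wt :=
  wmin (tord 0 α (dbl K.w.w0 N.w.w0)) (wmin (tord 2 α (dbl K.w.w1 N.w.w1)) (wmin (tord 4 α (dbl K.w.w2 N.w.w2)) (tord 3 α (some (2 * K.w3 + N.w3)))))

/-- ORDER AT `q_a = (a:1:0)`, `a³ = −1` (y-chart): `min (2w₀+e₀−α, 1+2w₁+e₁−α, 2+2w₂+e₂−α, 4+2w₃+e₃−α)` -/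
def ordA (α : ℕ) (K N : Curve) : Wt :=
  wmin (tord 0 α (dbl K.w.w0 N.w.w0)) (wmin (tord 1 α (dbl K.w.w1 N.w.w1)) (wmin (tord 2 α (dbl K.w.w2 N.w.w2)) (tord 4 α (some (2 * K.w3 + N.w3)))))

/-- ORDER AT A GENERIC free direction `(a:1:0)`, `a³ ≠ −1`, and at `(0:1:0)`: `min (2w₀+e₀−α, 1+2w₁+e₁−α, 2+2w₂+e₂−α, 3+2w₃+e₃−α)` -/
def ordG (α : ℕ) (K N : Curve) : Wt :=
  wmin (tord 0 α (dbl K.w.w0 N.w.w0)) (wmin (tord 1 α (dbl K.w.w1 N.w.w1)) (wmin (tord 2 α (dbl K.w.w2 N.w.w2)) (tord 3 α (some (2 * K.w3 + N.w3)))))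

/-- the partner datum over an INTERIOR (non-node) good point of the centre: all exponents `0`, no cubic weight -/
def interior : Curve := ⟨⟨some 0, some 0, some 0⟩, 0, true⟩

/-! ### sanity checks against the sheet (`decide`) -/

/-- E-S6(iv) WITNESS of loop note §9.14 (3)(b): the second light accept `AL` (`α = 2`) of `K = V(u)` with `w = (∞,1,0)`, `w₃ = 1`, against
the residual branch `c = (∞,1,1)` (`e₃ = 0`): order `3` at `q_z` — a multiplicity-3 point off S; the census test fires. -/
theorem tchain_witness_ordZ : ordZ 2 ⟨⟨none, some 1, some 0⟩, 1, true⟩ ⟨⟨none, some 1, some 1⟩, 0, false⟩ = some 3 := by decide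
theorem tchain_witness : mult3AtEnd 2 ⟨⟨none, some 1, some 0⟩, 1, true⟩ ⟨⟨none, some 1, some 1⟩, 0, false⟩ = true := by decide

/-- S6 (iii) node-end double point: light `K`, `w = (2,1,0)`, `w₃ = 0`, `α = 2`, partner `e = (0,1,2)`, `e₃ = 0`: order `2` at `q_a` (the
double point through which the curves `C_a` pass), order `1` at `q_z` (the cubic coefficient is a unit along `K`: `z^{3−2}·unit`); test negative. -/
theorem light_node_end : ordA 2 ⟨⟨some 2, some 1, some 0⟩, 0, true⟩ ⟨⟨some 0, some 1, some 2⟩, 0, true⟩ = some 2 ∧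
    ordZ 2 ⟨⟨some 2, some 1, some 0⟩, 0, true⟩ ⟨⟨some 0, some 1, some 2⟩, 0, true⟩ = some 1 ∧
    mult3AtEnd 2 ⟨⟨some 2, some 1, some 0⟩, 0, true⟩ ⟨⟨some 0, some 1, some 2⟩, 0, true⟩ = false := by decide

/-- S6 (ii) borderline accept (`w = (2,2,1)`, `α = 2`, 𝒟-node end with `w′₀ = 0`): order `2` at `q_a` (the double curves `C_a` pass through). -/
theorem borderline_node_end : ordA 2 ⟨⟨some 2, some 2, some 1⟩, 0, true⟩ ⟨⟨some 0, some 3, some 1⟩, 0, true⟩ = some 2 := by decide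

/-- a monic DEEP accept (`α = 3`, `w = (3,2,1)`) over an interior point: order `0` at `q_z` (the free line misses `X′` generically). -/
theorem deep_interior : ordZ 3 ⟨⟨some 3, some 2, some 1⟩, 0, true⟩ interior = some 0 := by decide

noncomputable section

/-! ## §1. Lemma A — no cancellation among unit multiples of pairwise distinct monomials -/

section LemmaA

variable {σ ι R : Type*} [CommSemiring R]

/-- comparable exponent vectors whose degrees compare the other way are equal -/
theorem eq_of_le_of_degree_le {d e : σ →₀ ℕ} (h : d ≤ e) (hdeg : e.degree ≤ d.degree) : d = e := by
  have hsplit : d + (e - d) = e := add_tsub_cancel_of_le h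
  have hdeg' : (e - d).degree = 0 := by
    have := congrArg Finsupp.degree hsplit
    rw [map_add] at this
    omega
  rw [(Finsupp.degree_eq_zero_iff _).mp hdeg', add_zero] at hsplit
  exact hsplit

theorem degree_le_of_le {d e : σ →₀ ℕ} (h : d ≤ e) : d.degree ≤ e.degree := by
  have := congrArg Finsupp.degree (add_tsub_cancel_of_le h)
  rw [map_add] at this
  omega

/-- an OPTIONAL TERM `x^e · u` (`none` = the class is absent, the term is `0`) -/
def oterm (o : Option (σ →₀ ℕ)) (u : MvPowerSeries σ R) : MvPowerSeries σ R :=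
  match o with
  | Option.none => 0
  | Option.some e => monomial e 1 * u

/-- its order datum: `|e|`, or `⊤` when absent -/
def odeg (o : Option (σ →₀ ℕ)) : ℕ∞ :=
  match o with
  | Option.none => ⊤
  | Option.some e => (e.degree : ℕ∞)

@[simp] theorem oterm_none (u : MvPowerSeries σ R) : oterm none u = 0 := rfl
@[simp] theorem oterm_some (e : σ →₀ ℕ) (u : MvPowerSeries σ R) : oterm (some e) u = monomial e 1 * u := rfl
@[simp] theorem odeg_none : (odeg (none : Option (σ →₀ ℕ))) = ⊤ := rfl
@[simp] theorem odeg_some (e : σ →₀ ℕ) : odeg (some e) = (e.degree : ℕ∞) := rfl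

theorem coeff_monomial_one_mul (e d : σ →₀ ℕ) (u : MvPowerSeries σ R) :
    coeff d (monomial e (1 : R) * u) = if e ≤ d then coeff (d - e) u else 0 := by
  rw [coeff_monomial_mul]
  split_ifs <;> simp

/-- ★ LEMMA A (optional-term form). A finite sum of optional terms `x^{e_i}·u_i` whose PRESENT exponents are pairwise distinct and whose
coefficients `u_i` have non-zero constant term has order exactly `min_i |e_i|` (`⊤` for the empty / all-absent sum) — no cancellation,
whatever the `u_i` are. -/
theorem order_sum_oterm (s : Finset ι) (e : ι → Option (σ →₀ ℕ)) (u : ι → MvPowerSeries σ R)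
    (he : ∀ i ∈ s, ∀ j ∈ s, ∀ d, e i = some d → e j = some d → i = j)
    (hu : ∀ i ∈ s, ∀ d, e i = some d → constantCoeff (u i) ≠ 0) :
    (∑ i ∈ s, oterm (e i) (u i)).order = s.inf fun i => odeg (e i) := by
  classical
  apply le_antisymm
  · rcases s.eq_empty_or_nonempty with hs | hs
    · simp [hs]
    obtain ⟨j, hj, hinf⟩ := Finset.exists_mem_eq_inf s hs fun i => odeg (e i)
    rw [hinf]
    rcases hej : e j with _ | d
    · simp
    rw [odeg_some]
    apply order_le
    rw [map_sum, Finset.sum_eq_single j]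
    · rw [hej, oterm_some, coeff_monomial_one_mul, if_pos le_rfl, tsub_self, coeff_zero_eq_constantCoeff_apply]
      exact hu j hj d hej
    · intro i hi hij
      rcases hei : e i with _ | d'
      · simp
      rw [oterm_some, coeff_monomial_one_mul]
      split_ifs with hle
      · exfalso
        have h1 : odeg (e j) ≤ odeg (e i) := by rw [← hinf]; exact Finset.inf_le hi
        rw [hei, hej, odeg_some, odeg_some, Nat.cast_le] at h1
        have hdd : d' = d := eq_of_le_of_degree_le hle h1
        subst hdd
        exact hij (he i hi j hj d' hei hej)
      · rfl
    · intro h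
      exact absurd hj h
  · refine MvPowerSeries.le_order fun d hd => ?_
    rw [map_sum]
    refine Finset.sum_eq_zero fun i hi => ?_
    rcases hei : e i with _ | d'
    · simp
    rw [oterm_some, coeff_monomial_one_mul]
    split_ifs with hle
    · exfalso
      have h1 : s.inf (fun i => odeg (e i)) ≤ (d'.degree : ℕ∞) := by
        have := Finset.inf_le (f := fun i => odeg (e i)) hi
        rwa [hei, odeg_some] at this
      have h2 : (d'.degree : ℕ∞) ≤ d.degree := by exact_mod_cast degree_le_of_le hle
      exact absurd (lt_of_le_of_lt (h1.trans h2) hd) (lt_irrefl _)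
    · rfl

/-- ★ LEMMA A (plain form): pairwise distinct exponents, coefficients with non-zero constant term ⇒ `ord (Σ_i x^{e_i} u_i) = min_i |e_i|`. -/
theorem order_sum_monomial_mul (s : Finset ι) (e : ι → σ →₀ ℕ) (u : ι → MvPowerSeries σ R)
    (he : Set.InjOn e s) (hu : ∀ i ∈ s, constantCoeff (u i) ≠ 0) :
    (∑ i ∈ s, monomial (e i) (1 : R) * u i).order = s.inf fun i => ((e i).degree : ℕ∞) := by
  have := order_sum_oterm s (fun i => some (e i)) u
    (fun i hi j hj d h1 h2 => he hi hj ((Option.some.inj h1).trans (Option.some.inj h2).symm))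
    (fun i hi _ _ => hu i hi)
  simpa using this

end LemmaA

/-! ## §2. The free-direction chart normal forms of an accept and their orders -/

/-- the `ℕ∞` value of a grade weight -/
def toE : Wt → ℕ∞
  | Option.none => ⊤
  | Option.some n => (n : ℕ∞)

@[simp] theorem toE_none : toE none = ⊤ := rfl
@[simp] theorem toE_some (n : ℕ) : toE (some n) = (n : ℕ∞) := rfl

theorem toE_wmin (a b : Wt) : toE (wmin a b) = toE a ⊓ toE b := by
  rcases a with _ | m <;> rcases b with _ | n
  · simp [wmin]
  · simp [wmin]
  · simp [wmin]
  · change ((min m n : ℕ) : ℕ∞) = (m : ℕ∞) ⊓ (n : ℕ∞)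
    rcases le_total m n with h | h
    · rw [min_eq_left h, inf_eq_left.mpr (by exact_mod_cast h)]
    · rw [min_eq_right h, inf_eq_right.mpr (by exact_mod_cast h)]

theorem le_toE_iff (t : ℕ) (d : Wt) : (t : ℕ∞) ≤ toE d ↔ wge d t = true := by
  rcases d with _ | n
  · simp [wge]
  · simp only [toE_some, Nat.cast_le, wge]
    exact ⟨fun h => Nat.ble_eq_true_of_le h, fun h => Nat.le_of_ble_eq_true h⟩

/-! ### exponent vectors on the four chart coordinates -/

/-- the exponent vector `(n₀, n₁, n₂, n₃)` on the chart coordinates `x₀, x₁, x₂, x₃` (`x₀` = the exceptional coordinate, `x₂ = u′`, `x₃ = v`;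
`z`-chart: `(z, y′, u′, v)`; `y`-charts: `(y, Z, u′, v)` with `Z = z′ − a`) -/
def ev (n₀ n₁ n₂ n₃ : ℕ) : Fin 4 →₀ ℕ := Finsupp.single 0 n₀ + Finsupp.single 1 n₁ + Finsupp.single 2 n₂ + Finsupp.single 3 n₃

theorem degree_ev (n₀ n₁ n₂ n₃ : ℕ) : (ev n₀ n₁ n₂ n₃).degree = n₀ + n₁ + n₂ + n₃ := by
  simp [ev, map_add, Finsupp.degree_single]

@[simp] theorem ev_apply_zero (n₀ n₁ n₂ n₃ : ℕ) : ev n₀ n₁ n₂ n₃ 0 = n₀ := by simp [ev]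
@[simp] theorem ev_apply_two (n₀ n₁ n₂ n₃ : ℕ) : ev n₀ n₁ n₂ n₃ 2 = n₂ := by simp [ev]

/-- the class-`b` term is PRESENT iff both the centre's weight `w_b = some m` and the partner's exponent `e_b = some n` are finite
(`g_b ≢ 0`); its exponent vector is `(b + m − α, i, m, n)`: exceptional exponent `b + w_b − α`, `x₁`-exponent `i` (`= b` in the `z`-chart,
where `x₁ = y′`; `= 0` in the `y`-charts), `u′`-exponent `w_b`, `v`-exponent `e_b`. -/
def clsExp (α b i : ℕ) (w e : Wt) : Option (Fin 4 →₀ ℕ) :=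
  match w, e with
  | Option.some m, Option.some n => some (ev (b + m - α) i m n)
  | _, _ => none

/-- exponent vector of the CUBIC term: `(3 + w₃ − α, i, w₃, e₃)` with `i = 0` where its residual factor is a unit (`q_z`: `1 + y′³`;
generic direction: `(a+Z)³ + 1`, `a³ ≠ −1`) and `i = 1` at `q_a` (`(a+Z)³ + 1 = Z·unit`, `a³ = −1`). -/
def cubExp (α i : ℕ) (K N : Curve) : Fin 4 →₀ ℕ := ev (3 + K.w3 - α) i K.w3 N.w3

/-- `z`-CHART of the accept of `K` with exponent `α` (exc `= z`; `y = zy′`, `u = zu′`) at `q_z = (1:0:0)` over the end node with partner `N`: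
class `b` ↦ `c_b · z^{b+w_b−α} y′^b u′^{w_b} v^{e_b}`, cubic ↦ `(U(1 + y′³)/3) · z^{3+w₃−α} u′^{w₃} v^{e₃}`. -/
def expZ (α : ℕ) (K N : Curve) : Fin 4 → Option (Fin 4 →₀ ℕ)
  | 0 => clsExp α 0 0 K.w.w0 N.w.w0
  | 1 => clsExp α 1 1 K.w.w1 N.w.w1
  | 2 => clsExp α 2 2 K.w.w2 N.w.w2
  | 3 => some (cubExp α 0 K N)

/-- `y`-CHART of the same accept (exc `= y`; `z = yz′`, `u = yu′`) at `q_a = (a:1:0)`, `a³ = −1`, coordinates `(y, Z = z′ − a, u′, v)`: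
class `b` ↦ `c_b · y^{b+w_b−α} u′^{w_b} v^{e_b}`, cubic ↦ `(U(3a² + 3aZ + Z²)/3) · y^{3+w₃−α} Z u′^{w₃} v^{e₃}`. -/
def expA (α : ℕ) (K N : Curve) : Fin 4 → Option (Fin 4 →₀ ℕ)
  | 0 => clsExp α 0 0 K.w.w0 N.w.w0
  | 1 => clsExp α 1 0 K.w.w1 N.w.w1
  | 2 => clsExp α 2 0 K.w.w2 N.w.w2
  | 3 => some (cubExp α 1 K N)

/-- `y`-chart at a GENERIC free direction `(a:1:0)`, `a³ ≠ −1`, or at `(0:1:0)`: as `expA`, but the cubic factor `(a+Z)³ + 1` is a unit. -/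
def expG (α : ℕ) (K N : Curve) : Fin 4 → Option (Fin 4 →₀ ℕ)
  | 0 => clsExp α 0 0 K.w.w0 N.w.w0
  | 1 => clsExp α 1 0 K.w.w1 N.w.w1
  | 2 => clsExp α 2 0 K.w.w2 N.w.w2
  | 3 => some (cubExp α 0 K N)

section NF
variable {R : Type*} [CommSemiring R]

/-- a chart normal form with UNIT FACTORS `u = (c₀, c₁, c₂, U·(residual cubic factor)/3)`: `Σ_i oterm (ex i) (u i)` -/
def chartNF (ex : Fin 4 → Option (Fin 4 →₀ ℕ)) (u : Fin 4 → MvPowerSeries (Fin 4) R) : MvPowerSeries (Fin 4) R :=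
  ∑ i, oterm (ex i) (u i)

theorem chartNF_eq (ex : Fin 4 → Option (Fin 4 →₀ ℕ)) (u : Fin 4 → MvPowerSeries (Fin 4) R) :
    chartNF ex u = oterm (ex 0) (u 0) + oterm (ex 1) (u 1) + oterm (ex 2) (u 2) + oterm (ex 3) (u 3) := by
  simp [chartNF, Fin.sum_univ_four]

end NF

/-- LEGALITY of the accept (`D`: `α = 3`, `w ≥ (3,2,1)`; `A/AL`: `α = 2`, `w ≥ (2,1,0)`): `w_b + b ≥ α` for the present classes and `α ≤ 3`
(so that no exceptional exponent above is a truncated subtraction). -/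
structure Legal (α : ℕ) (K : Curve) : Prop where
  h0 : ∀ m, K.w.w0 = some m → α ≤ 0 + m
  h1 : ∀ m, K.w.w1 = some m → α ≤ 1 + m
  h2 : ∀ m, K.w.w2 = some m → α ≤ 2 + m
  h3 : α ≤ 3

theorem le_of_wge {w : Wt} {t m : ℕ} (h : wge w t = true) (hm : w = some m) : t ≤ m := by
  subst hm
  exact Nat.le_of_ble_eq_true h

/-- the game's accepts are legal in this sense: `D` (`α = 3`) needs `w ≥ (3,2,1)` … -/
theorem legal_D (K : Curve) (h0 : wge K.w.w0 3 = true) (h1 : wge K.w.w1 2 = true) (h2 : wge K.w.w2 1 = true) : Legal 3 K :=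
  ⟨fun m hm => by have := le_of_wge h0 hm; omega, fun m hm => by have := le_of_wge h1 hm; omega,
    fun m hm => by have := le_of_wge h2 hm; omega, le_rfl⟩

/-- … and `A/AL` (`α = 2`) needs `w ≥ (2,1,0)`. -/
theorem legal_A (K : Curve) (h0 : wge K.w.w0 2 = true) (h1 : wge K.w.w1 1 = true) (h2 : wge K.w.w2 0 = true) : Legal 2 K :=
  ⟨fun m hm => by have := le_of_wge h0 hm; omega, fun m hm => by have := le_of_wge h1 hm; omega,
    fun m hm => by have := le_of_wge h2 hm; omega, by omega⟩

theorem inf_univ_fin4 (f : Fin 4 → ℕ∞) : (Finset.univ : Finset (Fin 4)).inf f = f 0 ⊓ (f 1 ⊓ (f 2 ⊓ f 3)) := by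
  have : (Finset.univ : Finset (Fin 4)) = {0, 1, 2, 3} := by decide
  rw [this]
  simp only [Finset.inf_insert, Finset.inf_singleton]

/-- degree of a present class-`b` exponent: `(b + i) + (2m + n) − α` under legality -/
theorem odeg_clsExp (α b i : ℕ) (w e : Wt) (hleg : ∀ m, w = some m → α ≤ b + m) :
    odeg (clsExp α b i w e) = toE (tord (b + i) α (dbl w e)) := by
  rcases w with _ | m <;> rcases e with _ | n
  · rfl
  · rfl
  · rfl
  · have := hleg m rfl
    simp only [clsExp, odeg_some, degree_ev, dbl, wadd, Option.map_some, tord, toE_some, Nat.cast_inj]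
    omega

theorem odeg_cubExp (α i : ℕ) (K N : Curve) (h3 : α ≤ 3) :
    odeg (some (cubExp α i K N)) = toE (tord (3 + i) α (some (2 * K.w3 + N.w3))) := by
  simp only [cubExp, odeg_some, degree_ev, Option.map_some, tord, toE_some, Nat.cast_inj]
  omega

/-- the TAG `d 0 + α − d 2` recovers the index of a present term (classes: `b`; cubic: `3`) — whence pairwise distinctness -/
theorem clsExp_tag {α b i : ℕ} {w e : Wt} (hleg : ∀ m, w = some m → α ≤ b + m) {d : Fin 4 →₀ ℕ} (h : clsExp α b i w e = some d) :
    d 0 + α = b + d 2 := by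
  rcases w with _ | m <;> rcases e with _ | n
  · exact absurd h (by simp [clsExp])
  · exact absurd h (by simp [clsExp])
  · exact absurd h (by simp [clsExp])
  · have hd : d = ev (b + m - α) i m n := by simpa [clsExp] using h.symm
    subst hd
    have := hleg m rfl
    simp only [ev_apply_zero, ev_apply_two]
    omega

theorem cubExp_tag {α i : ℕ} {K N : Curve} (h3 : α ≤ 3) {d : Fin 4 →₀ ℕ} (h : some (cubExp α i K N) = some d) : d 0 + α = 3 + d 2 := by
  have hd : d = cubExp α i K N := (Option.some.inj h).symm
  subst hd
  simp only [cubExp, ev_apply_zero, ev_apply_two]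
  omega

theorem expZ_tag {α : ℕ} {K N : Curve} (hL : Legal α K) (i : Fin 4) (d : Fin 4 →₀ ℕ) (h : expZ α K N i = some d) :
    d 0 + α = (i : ℕ) + d 2 := by
  fin_cases i
  · simpa using clsExp_tag hL.h0 h
  · simpa using clsExp_tag hL.h1 h
  · simpa using clsExp_tag hL.h2 h
  · simpa using cubExp_tag (K := K) (N := N) hL.h3 h

theorem expA_tag {α : ℕ} {K N : Curve} (hL : Legal α K) (i : Fin 4) (d : Fin 4 →₀ ℕ) (h : expA α K N i = some d) :
    d 0 + α = (i : ℕ) + d 2 := by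
  fin_cases i
  · simpa using clsExp_tag hL.h0 h
  · simpa using clsExp_tag hL.h1 h
  · simpa using clsExp_tag hL.h2 h
  · simpa using cubExp_tag (K := K) (N := N) hL.h3 h

theorem expG_tag {α : ℕ} {K N : Curve} (hL : Legal α K) (i : Fin 4) (d : Fin 4 →₀ ℕ) (h : expG α K N i = some d) :
    d 0 + α = (i : ℕ) + d 2 := by
  fin_cases i
  · simpa using clsExp_tag hL.h0 h
  · simpa using clsExp_tag hL.h1 h
  · simpa using clsExp_tag hL.h2 h
  · simpa using cubExp_tag (K := K) (N := N) hL.h3 h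

theorem inj_of_tag {α : ℕ} (ex : Fin 4 → Option (Fin 4 →₀ ℕ)) (htag : ∀ i d, ex i = some d → d 0 + α = (i : ℕ) + d 2) :
    ∀ i ∈ (Finset.univ : Finset (Fin 4)), ∀ j ∈ (Finset.univ : Finset (Fin 4)), ∀ d, ex i = some d → ex j = some d → i = j := by
  intro i _ j _ d hi hj
  have h1 := htag i d hi
  have h2 := htag j d hj
  exact Fin.ext (by omega)

section Orders
variable {R : Type*} [CommSemiring R]

/-- ★ ORDER AT `q_z`, ALL UNIT VALUES: under legality the `z`-chart form has order `ordZ` for EVERY family of unit factors. -/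
theorem order_chartZ {α : ℕ} {K N : Curve} (hL : Legal α K) (u : Fin 4 → MvPowerSeries (Fin 4) R)
    (hu : ∀ i, constantCoeff (u i) ≠ 0) : (chartNF (expZ α K N) u).order = toE (ordZ α K N) := by
  unfold chartNF
  rw [order_sum_oterm _ _ _ (inj_of_tag _ (expZ_tag hL)) fun i _ _ _ => hu i, inf_univ_fin4]
  simp only [expZ, ordZ, toE_wmin]
  rw [odeg_clsExp _ _ _ _ _ hL.h0, odeg_clsExp _ _ _ _ _ hL.h1, odeg_clsExp _ _ _ _ _ hL.h2, odeg_cubExp _ _ _ _ hL.h3]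

/-- ★ ORDER AT `q_a`, ALL UNIT VALUES. -/
theorem order_chartA {α : ℕ} {K N : Curve} (hL : Legal α K) (u : Fin 4 → MvPowerSeries (Fin 4) R)
    (hu : ∀ i, constantCoeff (u i) ≠ 0) : (chartNF (expA α K N) u).order = toE (ordA α K N) := by
  unfold chartNF
  rw [order_sum_oterm _ _ _ (inj_of_tag _ (expA_tag hL)) fun i _ _ _ => hu i, inf_univ_fin4]
  simp only [expA, ordA, toE_wmin]
  rw [odeg_clsExp _ _ _ _ _ hL.h0, odeg_clsExp _ _ _ _ _ hL.h1, odeg_clsExp _ _ _ _ _ hL.h2, odeg_cubExp _ _ _ _ hL.h3]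

/-- ★ ORDER AT A GENERIC FREE DIRECTION, ALL UNIT VALUES. -/
theorem order_chartG {α : ℕ} {K N : Curve} (hL : Legal α K) (u : Fin 4 → MvPowerSeries (Fin 4) R)
    (hu : ∀ i, constantCoeff (u i) ≠ 0) : (chartNF (expG α K N) u).order = toE (ordG α K N) := by
  unfold chartNF
  rw [order_sum_oterm _ _ _ (inj_of_tag _ (expG_tag hL)) fun i _ _ _ => hu i, inf_univ_fin4]
  simp only [expG, ordG, toE_wmin]
  rw [odeg_clsExp _ _ _ _ _ hL.h0, odeg_clsExp _ _ _ _ _ hL.h1, odeg_clsExp _ _ _ _ _ hL.h2, odeg_cubExp _ _ _ _ hL.h3]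

end Orders

/-! ### the unit factors met geometrically ARE units -/

section Units
variable {R : Type*} [CommRing R]

/-- `z`-chart: the residual cubic factor `1 + y′³` at `y′ = 0` -/
theorem constantCoeff_qzFactor (U : MvPowerSeries (Fin 4) R) : constantCoeff (U * (1 + X 1 ^ 3)) = constantCoeff U := by
  simp [map_add, map_pow, constantCoeff_X]

/-- `y`-chart at `q_a`: after the shift `z′ = a + Z` with `a³ = −1`, `z′³ + 1 = Z · (3a² + 3aZ + Z²)` -/
theorem cubic_shift_eq (a : R) (ha : a ^ 3 = -1) :
    ((C a : MvPowerSeries (Fin 4) R) + X 1) ^ 3 + 1 = X 1 * (3 * C a ^ 2 + 3 * C a * X 1 + X 1 ^ 2) := by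
  have h1 : (C a : MvPowerSeries (Fin 4) R) ^ 3 = -1 := by rw [← map_pow, ha, map_neg, map_one]
  linear_combination h1

theorem constantCoeff_qaFactor (a : R) (U : MvPowerSeries (Fin 4) R) :
    constantCoeff (U * (3 * C a ^ 2 + 3 * C a * X 1 + X 1 ^ 2)) = constantCoeff U * (3 * a ^ 2) := by
  simp [map_add, map_mul, map_pow, map_ofNat, constantCoeff_X, constantCoeff_C]

/-- `3a²` is a unit as soon as `3` is (`a` is a unit since `a³ = −1`); the class lives in characteristic `p > 3` or `0`. -/
theorem isUnit_three_mul_sq (a : R) (ha : a ^ 3 = -1) (h3 : IsUnit (3 : R)) : IsUnit (3 * a ^ 2) := by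
  have hu : IsUnit a := by
    refine isUnit_iff_exists_inv.mpr ⟨-a ^ 2, ?_⟩
    linear_combination (-1 : R) * ha
  exact h3.mul (hu.pow 2)

/-- the honest cubic term at `q_a` IS the `expA` encoding:
`(y^{3+w₃−α} u′^{w₃} v^{e₃}) · U · ((a+Z)³ + 1) = (y^{3+w₃−α} Z u′^{w₃} v^{e₃}) · (U · (3a² + 3aZ + Z²))`. -/
theorem qa_cubic_term_eq (α : ℕ) (K N : Curve) (a : R) (ha : a ^ 3 = -1) (U : MvPowerSeries (Fin 4) R) :
    monomial (cubExp α 0 K N) (1 : R) * (U * (((C a : MvPowerSeries (Fin 4) R) + X 1) ^ 3 + 1)) =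
      monomial (cubExp α 1 K N) (1 : R) * (U * (3 * C a ^ 2 + 3 * C a * X 1 + X 1 ^ 2)) := by
  rw [cubic_shift_eq a ha]
  have hsplit : cubExp α 1 K N = cubExp α 0 K N + Finsupp.single 1 1 := by
    simp only [cubExp, ev, Finsupp.single_zero, add_zero]
    abel
  have hmon : monomial (cubExp α 1 K N) (1 : R) = monomial (cubExp α 0 K N) (1 : R) * X 1 := by
    rw [hsplit, X_def, monomial_mul_monomial, mul_one]
  rw [hmon]
  ring

/-- ★ `q_z` with the GEOMETRIC unit factors: for all `c₀, c₁, c₂, U` with non-zero constant terms the `z`-chart form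
`U(1+y′³)·z^{3+w₃−α}u′^{w₃}v^{e₃} + Σ_b c_b z^{b+w_b−α} y′^b u′^{w_b} v^{e_b}` has order `ordZ`. -/
theorem order_zChart {α : ℕ} {K N : Curve} (hL : Legal α K) (c₀ c₁ c₂ U : MvPowerSeries (Fin 4) R)
    (h₀ : constantCoeff c₀ ≠ 0) (h₁ : constantCoeff c₁ ≠ 0) (h₂ : constantCoeff c₂ ≠ 0) (hU : constantCoeff U ≠ 0) :
    (chartNF (expZ α K N) ![c₀, c₁, c₂, U * (1 + X 1 ^ 3)]).order = toE (ordZ α K N) := by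
  refine order_chartZ hL _ fun i => ?_
  fin_cases i
  · simpa using h₀
  · simpa using h₁
  · simpa using h₂
  · have := constantCoeff_qzFactor U
    simp only [Fin.reduceFinMk, Matrix.cons_val, ne_eq]
    rw [this]
    exact hU

/-- ★ `q_a` with the GEOMETRIC unit factors (`a³ = −1`, `3 ∈ R×`, unit constant terms): the `y`-chart form has order `ordA`. -/
theorem order_aChart [Nontrivial R] {α : ℕ} {K N : Curve} (hL : Legal α K) (a : R) (ha : a ^ 3 = -1) (h3 : IsUnit (3 : R))
    (c₀ c₁ c₂ U : MvPowerSeries (Fin 4) R) (h₀ : IsUnit (constantCoeff c₀)) (h₁ : IsUnit (constantCoeff c₁))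
    (h₂ : IsUnit (constantCoeff c₂)) (hU : IsUnit (constantCoeff U)) :
    (chartNF (expA α K N) ![c₀, c₁, c₂, U * (3 * C a ^ 2 + 3 * C a * X 1 + X 1 ^ 2)]).order = toE (ordA α K N) := by
  refine order_chartA hL _ fun i => ?_
  fin_cases i
  · simpa using h₀.ne_zero
  · simpa using h₁.ne_zero
  · simpa using h₂.ne_zero
  · have hne := (hU.mul (isUnit_three_mul_sq a ha h3)).ne_zero
    have := constantCoeff_qaFactor a U
    simp only [Fin.reduceFinMk, Matrix.cons_val, ne_eq]
    rw [this]
    exact hne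

end Units

/-! ## §3. Bridge to the census predicate `mult3AtEnd` (E-S6(iv), counter a6) -/

/-- ★ the census test decoded, for ALL `α, K, N`: `mult3AtEnd α K N` ⟺ (order at `q_z` ≥ 3) ∨ (order at `q_a` ≥ 3). -/
theorem mult3AtEnd_iff (α : ℕ) (K N : Curve) : mult3AtEnd α K N = true ↔ 3 ≤ toE (ordZ α K N) ∨ 3 ≤ toE (ordA α K N) := by
  simp only [mult3AtEnd, ordZ, ordA, toE_wmin, le_inf_iff, Bool.or_eq_true, Bool.and_eq_true]
  generalize dbl K.w.w0 N.w.w0 = d0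
  generalize dbl K.w.w1 N.w.w1 = d1
  generalize dbl K.w.w2 N.w.w2 = d2
  generalize 2 * K.w3 + N.w3 = t3
  have e3 : ((3 : ℕ) : ℕ∞) = 3 := rfl
  simp only [← e3, le_toE_iff]
  rcases d0 with _ | d0 <;> rcases d1 with _ | d1 <;> rcases d2 with _ | d2 <;>
    simp only [wge, tord, Option.map_some, Option.map_none, Nat.ble_eq, true_and, and_true] <;> omega

/-- the same as a Boolean identity -/
theorem mult3AtEnd_eq (α : ℕ) (K N : Curve) : mult3AtEnd α K N = (wge (ordZ α K N) 3 || wge (ordA α K N) 3) := by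
  rw [Bool.eq_iff_iff, mult3AtEnd_iff, Bool.or_eq_true, ← le_toE_iff, ← le_toE_iff]
  rfl

section Bridge
variable {R : Type*} [CommSemiring R]

/-- ★★ E-S6(iv) IN THE KERNEL: under legality and for EVERY choice of unit factors, the census counter's test `mult3AtEnd α K N` holds iff the
strict transform has order ≥ 3 at `q_z` or at `q_a` over the end node `K ∩ N` (the multiplicity of the hypersurface at a point is the order
of its local equation in centred coordinates). -/
theorem mult3AtEnd_iff_order {α : ℕ} {K N : Curve} (hL : Legal α K) (u u' : Fin 4 → MvPowerSeries (Fin 4) R)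
    (hu : ∀ i, constantCoeff (u i) ≠ 0) (hu' : ∀ i, constantCoeff (u' i) ≠ 0) :
    mult3AtEnd α K N = true ↔ 3 ≤ (chartNF (expZ α K N) u).order ∨ 3 ≤ (chartNF (expA α K N) u').order := by
  rw [order_chartZ hL u hu, order_chartA hL u' hu', mult3AtEnd_iff]

end Bridge

/-! ## §4. Domination: the two distinguished points over the END NODES bound the whole free-direction line of every fibre -/

theorem toE_tord_mono_shift (k k' α : ℕ) (hk : k ≤ k') (d : Wt) : toE (tord k α d) ≤ toE (tord k' α d) := by
  rcases d with _ | n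
  · simp [tord]
  · simp only [tord, Option.map_some, toE_some, Nat.cast_le]
    omega

theorem toE_tord_dbl_interior_le (k α : ℕ) (w e : Wt) : toE (tord k α (dbl w (some 0))) ≤ toE (tord k α (dbl w e)) := by
  rcases w with _ | m <;> rcases e with _ | n
  · simp [tord, dbl, wadd]
  · simp [tord, dbl, wadd]
  · simp [tord, dbl, wadd]
  · simp only [tord, dbl, wadd, Option.map_some, toE_some, Nat.cast_le]
    omega

/-- generic free directions `(a:1:0)`, `a³ ≠ −1`, and `(0:1:0)` are dominated by `q_a` (same fibre) -/
theorem ordG_le_ordA (α : ℕ) (K N : Curve) : toE (ordG α K N) ≤ toE (ordA α K N) := by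
  simp only [ordG, ordA, toE_wmin]
  exact inf_le_inf le_rfl (inf_le_inf le_rfl (inf_le_inf le_rfl (toE_tord_mono_shift 3 4 α (by omega) _)))

/-- the fibres over INTERIOR points of the centre are dominated by the fibres over its end nodes: at `q_z` … -/
theorem ordZ_interior_le (α : ℕ) (K N : Curve) : toE (ordZ α K interior) ≤ toE (ordZ α K N) := by
  simp only [ordZ, toE_wmin]
  refine inf_le_inf (toE_tord_dbl_interior_le _ _ _ _) (inf_le_inf (toE_tord_dbl_interior_le _ _ _ _)
    (inf_le_inf (toE_tord_dbl_interior_le _ _ _ _) ?_))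
  simp only [interior, tord, Option.map_some, toE_some, Nat.cast_le]
  omega

/-- … at `q_a` … -/
theorem ordA_interior_le (α : ℕ) (K N : Curve) : toE (ordA α K interior) ≤ toE (ordA α K N) := by
  simp only [ordA, toE_wmin]
  refine inf_le_inf (toE_tord_dbl_interior_le _ _ _ _) (inf_le_inf (toE_tord_dbl_interior_le _ _ _ _)
    (inf_le_inf (toE_tord_dbl_interior_le _ _ _ _) ?_))
  simp only [interior, tord, Option.map_some, toE_some, Nat.cast_le]
  omega

/-- … and at generic directions. -/
theorem ordG_interior_le (α : ℕ) (K N : Curve) : toE (ordG α K interior) ≤ toE (ordG α K N) := by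
  simp only [ordG, toE_wmin]
  refine inf_le_inf (toE_tord_dbl_interior_le _ _ _ _) (inf_le_inf (toE_tord_dbl_interior_le _ _ _ _)
    (inf_le_inf (toE_tord_dbl_interior_le _ _ _ _) ?_))
  simp only [interior, tord, Option.map_some, toE_some, Nat.cast_le]
  omega

/-- ★ SUMMARY on the order data: if the census test is negative at an end node `N` of the centre, then the order is `≤ 2` at `q_z`, at `q_a`
and at every generic free direction of the fibre over that node, and also at every free-direction point of the fibres over the interior
points of the centre. Combine with `order_chartZ/A/G` (the forms, all unit values) and with `no_mult3AtEnd_gmult|uv` of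
`Lines/toric_sgame_allchains.lean` §B⁷ (the test is negative at both end nodes of every accept of every legal play from every seed). -/
theorem freeLine_orders_lt_three {α : ℕ} {K N : Curve} (h : mult3AtEnd α K N = false) :
    toE (ordZ α K N) < 3 ∧ toE (ordA α K N) < 3 ∧ toE (ordG α K N) < 3 ∧
      toE (ordZ α K interior) < 3 ∧ toE (ordA α K interior) < 3 ∧ toE (ordG α K interior) < 3 := by
  have h' : ¬ (3 ≤ toE (ordZ α K N) ∨ 3 ≤ toE (ordA α K N)) := by rw [← mult3AtEnd_iff, h]; decide
  simp only [not_or, not_le] at h'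
  obtain ⟨hz, ha⟩ := h'
  exact ⟨hz, ha, lt_of_le_of_lt (ordG_le_ordA α K N) ha, lt_of_le_of_lt (ordZ_interior_le α K N) hz,
    lt_of_le_of_lt (ordA_interior_le α K N) ha, lt_of_le_of_lt ((ordG_le_ordA α K interior).trans (ordA_interior_le α K N)) ha⟩

/-! ## §5. The chart forms ARE the blow-up transforms of the controlled class form (substitution in `R⟦x₀,…,x₃⟧`)

Upstairs coordinates `(z, y, u, v) = (x₀, x₁, x₂, x₃)`; the centre is `K = V(z, y, u)`, its end node `K ∩ N` is the origin. The blow-up of `K`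
has the `z`-chart `(z, y, u, v) = (z, z·y′, z·u′, v)` and the `y`-chart `(z, y, u, v) = (y·z′, y, y·u′, v)`; a free-direction point `(a:1:0)` of
the fibre `ℙ²` over the origin is the origin of the `y`-chart recentred by `z′ = a + Z`. Substituting the chart map into the class form and
factoring out the exceptional monomial `x₀^α` gives EXACTLY the normal forms `chartNF (expZ|expA|expG …)` of §2, with unit factors the
substituted units (substitution along a map with zero constant terms preserves constant terms). -/

section BlowUp
variable {R : Type*} [CommRing R]

theorem monomial_ev (n₀ n₁ n₂ n₃ : ℕ) :
    (monomial (ev n₀ n₁ n₂ n₃) (1 : R) : MvPowerSeries (Fin 4) R) = X 0 ^ n₀ * X 1 ^ n₁ * X 2 ^ n₂ * X 3 ^ n₃ := by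
  simp only [ev, X_pow_eq, monomial_mul_monomial, mul_one]

/-- upstairs exponent of the class-`b` term `y^b u^{w_b} v^{e_b}` (present iff both weights are finite) -/
def clsUp (b : ℕ) (w e : Wt) : Option (Fin 4 →₀ ℕ) :=
  match w, e with
  | Option.some m, Option.some n => some (ev 0 b m n)
  | _, _ => none

/-- ★ the CONTROLLED CLASS FORM (sheet S1) of `f` along the centre `K = V(z,y,u)` at its end node `K ∩ N = 0`:
`f = Σ_{b=0,1,2} c_b · y^b u^{w_b} v^{e_b} + U · u^{w₃} v^{e₃} · (z³ + y³)`, `c_b, U` units (`w = K.w`, `w₃ = K.w3`; `e = N.w`, `e₃ = N.w3`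
are the orders along `K` resp. the exponents of the node coordinate `v` contributed by the partner branch `N`). -/
def classForm (K N : Curve) (c₀ c₁ c₂ U : MvPowerSeries (Fin 4) R) : MvPowerSeries (Fin 4) R :=
  oterm (clsUp 0 K.w.w0 N.w.w0) c₀ + oterm (clsUp 1 K.w.w1 N.w.w1) c₁ + oterm (clsUp 2 K.w.w2 N.w.w2) c₂ +
    monomial (ev 0 0 K.w3 N.w3) 1 * (U * (X 0 ^ 3 + X 1 ^ 3))

/-- the `z`-chart of the blow-up of `K`: `(z, y, u, v) ↦ (z, z·y′, z·u′, v)`, new coordinates `(z, y′, u′, v) = (x₀, x₁, x₂, x₃)` -/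
def aZ (R : Type*) [CommRing R] : Fin 4 → MvPowerSeries (Fin 4) R := ![X 0, X 0 * X 1, X 0 * X 2, X 3]

/-- the `y`-chart of the blow-up of `K` recentred at the free direction `(a:1:0)`: `(z, y, u, v) ↦ (y·(a + Z), y, y·u′, v)`, new coordinates
`(y, Z, u′, v) = (x₀, x₁, x₂, x₃)` -/
def aY (a : R) : Fin 4 → MvPowerSeries (Fin 4) R := ![X 0 * (C a + X 1), X 0, X 0 * X 2, X 3]

@[simp] theorem aZ_0 : aZ R 0 = X 0 := rfl
@[simp] theorem aZ_1 : aZ R 1 = X 0 * X 1 := rfl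
@[simp] theorem aZ_2 : aZ R 2 = X 0 * X 2 := rfl
@[simp] theorem aZ_3 : aZ R 3 = X 3 := rfl
@[simp] theorem aY_0 (a : R) : aY a 0 = X 0 * (C a + X 1) := rfl
@[simp] theorem aY_1 (a : R) : aY a 1 = X 0 := rfl
@[simp] theorem aY_2 (a : R) : aY a 2 = X 0 * X 2 := rfl
@[simp] theorem aY_3 (a : R) : aY a 3 = X 3 := rfl

theorem aZ_const (s : Fin 4) : constantCoeff (aZ R s) = 0 := by
  fin_cases s <;> simp [constantCoeff_X]

theorem aY_const (a : R) (s : Fin 4) : constantCoeff (aY a s) = 0 := by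
  fin_cases s <;> simp [constantCoeff_X, constantCoeff_C]

theorem hasSubst_aZ : HasSubst (aZ R) := hasSubst_of_constantCoeff_zero aZ_const
theorem hasSubst_aY (a : R) : HasSubst (aY a) := hasSubst_of_constantCoeff_zero (aY_const a)

/-- substitution along a map with ZERO CONSTANT TERMS preserves constant terms — units stay units -/
theorem constantCoeff_subst_of_zero {a : Fin 4 → MvPowerSeries (Fin 4) R} (ha0 : ∀ s, constantCoeff (a s) = 0)
    (f : MvPowerSeries (Fin 4) R) : constantCoeff (subst a f) = constantCoeff f := by
  classical
  rw [constantCoeff_subst (hasSubst_of_constantCoeff_zero ha0), finsum_eq_single _ 0]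
  · simp
  · intro d hd
    obtain ⟨i, hi⟩ : d.support.Nonempty := d.support_nonempty_iff.mpr hd
    simp [Finsupp.prod, Finset.prod_eq_zero hi, ha0, zero_pow <| d.mem_support_iff.mp hi]

theorem subst_zero_of_hasSubst {a : Fin 4 → MvPowerSeries (Fin 4) R} (ha : HasSubst a) :
    subst a (0 : MvPowerSeries (Fin 4) R) = 0 := by
  rw [← coe_substAlgHom ha, map_zero]

theorem subst_monomial_ev {a : Fin 4 → MvPowerSeries (Fin 4) R} (ha : HasSubst a) (n₀ n₁ n₂ n₃ : ℕ) :
    subst a (monomial (ev n₀ n₁ n₂ n₃) (1 : R)) = a 0 ^ n₀ * a 1 ^ n₁ * a 2 ^ n₂ * a 3 ^ n₃ := by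
  rw [subst_monomial ha, map_one, one_mul, Finsupp.prod_pow, Fin.prod_univ_four]
  simp [ev]

theorem X0_pow_split {k α : ℕ} (h : α ≤ k) : (X 0 : MvPowerSeries (Fin 4) R) ^ k = X 0 ^ α * X 0 ^ (k - α) := by
  rw [← pow_add]; congr 1; omega

/-- `z`-chart, class-`b` term: `c_b y^b u^m v^n ↦ z^{b+m} y′^b u′^m v^n · c_b′ = z^α · (z^{b+m−α} y′^b u′^m v^n · c_b′)` -/
theorem aZ_clsTerm {α b : ℕ} {w e : Wt} (hleg : ∀ m, w = some m → α ≤ b + m) (c : MvPowerSeries (Fin 4) R) :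
    subst (aZ R) (oterm (clsUp b w e) c) = X 0 ^ α * oterm (clsExp α b b w e) (subst (aZ R) c : MvPowerSeries (Fin 4) R) := by
  rcases w with _ | m <;> rcases e with _ | n
  · simp [clsUp, clsExp, subst_zero_of_hasSubst hasSubst_aZ]
  · simp [clsUp, clsExp, subst_zero_of_hasSubst hasSubst_aZ]
  · simp [clsUp, clsExp, subst_zero_of_hasSubst hasSubst_aZ]
  · have hα := hleg m rfl
    simp only [clsUp, clsExp, oterm_some]
    rw [subst_mul hasSubst_aZ, subst_monomial_ev hasSubst_aZ, monomial_ev]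
    simp only [aZ_0, aZ_1, aZ_2, aZ_3]
    calc _ = (X 0 : MvPowerSeries (Fin 4) R) ^ (b + m) * (X 1 ^ b * X 2 ^ m * X 3 ^ n * subst (aZ R) c) := by ring
      _ = _ := by rw [X0_pow_split hα]; ring

/-- `z`-chart, cubic term: `U u^{w₃} v^{e₃} (z³ + y³) ↦ z^{3+w₃} u′^{w₃} v^{e₃} · U′ · (1 + y′³) = z^α · (…)` -/
theorem aZ_cubic {α : ℕ} (K N : Curve) (h3 : α ≤ 3) (U : MvPowerSeries (Fin 4) R) :
    subst (aZ R) (monomial (ev 0 0 K.w3 N.w3) (1 : R) * (U * (X 0 ^ 3 + X 1 ^ 3))) =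
      X 0 ^ α * (monomial (cubExp α 0 K N) (1 : R) * (subst (aZ R) U * (1 + X 1 ^ 3))) := by
  rw [subst_mul hasSubst_aZ, subst_mul hasSubst_aZ, subst_add hasSubst_aZ, subst_pow hasSubst_aZ, subst_pow hasSubst_aZ,
    subst_X hasSubst_aZ, subst_X hasSubst_aZ, subst_monomial_ev hasSubst_aZ, cubExp, monomial_ev]
  simp only [aZ_0, aZ_1, aZ_2, aZ_3]
  calc _ = (X 0 : MvPowerSeries (Fin 4) R) ^ (3 + K.w3) * (X 2 ^ K.w3 * X 3 ^ N.w3 * (subst (aZ R) U * (1 + X 1 ^ 3))) := by ring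
    _ = _ := by rw [X0_pow_split (show α ≤ 3 + K.w3 by omega)]; ring

/-- `y`-chart (any `a`), class-`b` term: `c_b y^b u^m v^n ↦ y^{b+m} u′^m v^n · c_b′ = y^α · (y^{b+m−α} u′^m v^n · c_b′)` -/
theorem aY_clsTerm (a : R) {α b : ℕ} {w e : Wt} (hleg : ∀ m, w = some m → α ≤ b + m) (c : MvPowerSeries (Fin 4) R) :
    subst (aY a) (oterm (clsUp b w e) c) = X 0 ^ α * oterm (clsExp α b 0 w e) (subst (aY a) c : MvPowerSeries (Fin 4) R) := by
  rcases w with _ | m <;> rcases e with _ | n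
  · simp [clsUp, clsExp, subst_zero_of_hasSubst (hasSubst_aY a)]
  · simp [clsUp, clsExp, subst_zero_of_hasSubst (hasSubst_aY a)]
  · simp [clsUp, clsExp, subst_zero_of_hasSubst (hasSubst_aY a)]
  · have hα := hleg m rfl
    simp only [clsUp, clsExp, oterm_some]
    rw [subst_mul (hasSubst_aY a), subst_monomial_ev (hasSubst_aY a), monomial_ev]
    simp only [aY_0, aY_1, aY_2, aY_3]
    calc _ = (X 0 : MvPowerSeries (Fin 4) R) ^ (b + m) * (X 2 ^ m * X 3 ^ n * subst (aY a) c) := by ring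
      _ = _ := by rw [X0_pow_split hα]; ring

/-- `y`-chart at `q_a` (`a³ = −1`), cubic term: `U u^{w₃} v^{e₃} (z³ + y³) ↦ y^{3+w₃} u′^{w₃} v^{e₃} U′ ((a+Z)³ + 1) = y^α · (y^{3+w₃−α} Z u′^{w₃}
v^{e₃}) · (U′ (3a² + 3aZ + Z²))` -/
theorem aY_cubic_qa (a : R) (ha : a ^ 3 = -1) {α : ℕ} (K N : Curve) (h3 : α ≤ 3) (U : MvPowerSeries (Fin 4) R) :
    subst (aY a) (monomial (ev 0 0 K.w3 N.w3) (1 : R) * (U * (X 0 ^ 3 + X 1 ^ 3))) =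
      X 0 ^ α * (monomial (cubExp α 1 K N) (1 : R) * (subst (aY a) U * (3 * C a ^ 2 + 3 * C a * X 1 + X 1 ^ 2))) := by
  rw [subst_mul (hasSubst_aY a), subst_mul (hasSubst_aY a), subst_add (hasSubst_aY a), subst_pow (hasSubst_aY a),
    subst_pow (hasSubst_aY a), subst_X (hasSubst_aY a), subst_X (hasSubst_aY a), subst_monomial_ev (hasSubst_aY a), cubExp, monomial_ev]
  simp only [aY_0, aY_1, aY_2, aY_3]
  calc _ = (X 0 : MvPowerSeries (Fin 4) R) ^ (3 + K.w3) * (X 2 ^ K.w3 * X 3 ^ N.w3 * subst (aY a) U *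
        (((C a : MvPowerSeries (Fin 4) R) + X 1) ^ 3 + 1)) := by ring
    _ = _ := by rw [cubic_shift_eq a ha, X0_pow_split (show α ≤ 3 + K.w3 by omega)]; ring

/-- `y`-chart at a generic free direction (`a³ + 1` a unit, e.g. `a = 0`), cubic term: the residual cubic factor `(a+Z)³ + 1` stays a unit -/
theorem aY_cubic_generic (a : R) {α : ℕ} (K N : Curve) (h3 : α ≤ 3) (U : MvPowerSeries (Fin 4) R) :
    subst (aY a) (monomial (ev 0 0 K.w3 N.w3) (1 : R) * (U * (X 0 ^ 3 + X 1 ^ 3))) =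
      X 0 ^ α * (monomial (cubExp α 0 K N) (1 : R) * (subst (aY a) U * (((C a : MvPowerSeries (Fin 4) R) + X 1) ^ 3 + 1))) := by
  rw [subst_mul (hasSubst_aY a), subst_mul (hasSubst_aY a), subst_add (hasSubst_aY a), subst_pow (hasSubst_aY a),
    subst_pow (hasSubst_aY a), subst_X (hasSubst_aY a), subst_X (hasSubst_aY a), subst_monomial_ev (hasSubst_aY a), cubExp, monomial_ev]
  simp only [aY_0, aY_1, aY_2, aY_3]
  calc _ = (X 0 : MvPowerSeries (Fin 4) R) ^ (3 + K.w3) * (X 2 ^ K.w3 * X 3 ^ N.w3 * subst (aY a) U *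
        (((C a : MvPowerSeries (Fin 4) R) + X 1) ^ 3 + 1)) := by ring
    _ = _ := by rw [X0_pow_split (show α ≤ 3 + K.w3 by omega)]; ring

theorem constantCoeff_genericFactor (a : R) (U : MvPowerSeries (Fin 4) R) :
    constantCoeff (U * (((C a : MvPowerSeries (Fin 4) R) + X 1) ^ 3 + 1)) = constantCoeff U * (a ^ 3 + 1) := by
  simp [map_add, map_mul, map_pow, constantCoeff_X, constantCoeff_C]

/-- ★★ `z`-CHART: the total transform of the class form is `z^α ·` (the `z`-chart normal form with the substituted units). -/
theorem zChart_transform {α : ℕ} {K N : Curve} (hL : Legal α K) (c₀ c₁ c₂ U : MvPowerSeries (Fin 4) R) :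
    (subst (aZ R) (classForm K N c₀ c₁ c₂ U) : MvPowerSeries (Fin 4) R) =
      X 0 ^ α * chartNF (expZ α K N) ![subst (aZ R) c₀, subst (aZ R) c₁, subst (aZ R) c₂, subst (aZ R) U * (1 + X 1 ^ 3)] := by
  rw [classForm, subst_add hasSubst_aZ, subst_add hasSubst_aZ, subst_add hasSubst_aZ, aZ_clsTerm hL.h0, aZ_clsTerm hL.h1,
    aZ_clsTerm hL.h2, aZ_cubic K N hL.h3, chartNF_eq]
  simp only [expZ, oterm_some, Matrix.cons_val_zero, Matrix.cons_val_one, Matrix.cons_val]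
  ring

/-- ★★ `y`-CHART AT `q_a` (`a³ = −1`): the total transform is `y^α ·` (the `q_a` normal form with the substituted units). -/
theorem aChart_transform {α : ℕ} {K N : Curve} (hL : Legal α K) (a : R) (ha : a ^ 3 = -1) (c₀ c₁ c₂ U : MvPowerSeries (Fin 4) R) :
    (subst (aY a) (classForm K N c₀ c₁ c₂ U) : MvPowerSeries (Fin 4) R) = X 0 ^ α * chartNF (expA α K N)
      ![subst (aY a) c₀, subst (aY a) c₁, subst (aY a) c₂, subst (aY a) U * (3 * C a ^ 2 + 3 * C a * X 1 + X 1 ^ 2)] := by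
  rw [classForm, subst_add (hasSubst_aY a), subst_add (hasSubst_aY a), subst_add (hasSubst_aY a), aY_clsTerm a hL.h0,
    aY_clsTerm a hL.h1, aY_clsTerm a hL.h2, aY_cubic_qa a ha K N hL.h3, chartNF_eq]
  simp only [expA, oterm_some, Matrix.cons_val_zero, Matrix.cons_val_one, Matrix.cons_val]
  ring

/-- ★★ `y`-CHART AT A GENERIC FREE DIRECTION `(a:1:0)` (incl. `(0:1:0)`): `y^α ·` (the generic normal form). -/
theorem gChart_transform {α : ℕ} {K N : Curve} (hL : Legal α K) (a : R) (c₀ c₁ c₂ U : MvPowerSeries (Fin 4) R) :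
    (subst (aY a) (classForm K N c₀ c₁ c₂ U) : MvPowerSeries (Fin 4) R) = X 0 ^ α * chartNF (expG α K N)
      ![subst (aY a) c₀, subst (aY a) c₁, subst (aY a) c₂, subst (aY a) U * (((C a : MvPowerSeries (Fin 4) R) + X 1) ^ 3 + 1)] := by
  rw [classForm, subst_add (hasSubst_aY a), subst_add (hasSubst_aY a), subst_add (hasSubst_aY a), aY_clsTerm a hL.h0,
    aY_clsTerm a hL.h1, aY_clsTerm a hL.h2, aY_cubic_generic a K N hL.h3, chartNF_eq]
  simp only [expG, oterm_some, Matrix.cons_val_zero, Matrix.cons_val_one, Matrix.cons_val]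
  ring

/-- ★★★ THE CHART COMPUTATION BEHIND `mult3AtEnd`, END TO END (`q_z`): for every legal accept and all unit factors, the total transform of
the class form in the `z`-chart is `z^α · g` with `ord g = ordZ α K N` — `g` is the strict (= controlled) transform at `q_z`. -/
theorem zChart_strictTransform_order {α : ℕ} {K N : Curve} (hL : Legal α K) (c₀ c₁ c₂ U : MvPowerSeries (Fin 4) R)
    (h₀ : constantCoeff c₀ ≠ 0) (h₁ : constantCoeff c₁ ≠ 0) (h₂ : constantCoeff c₂ ≠ 0) (hU : constantCoeff U ≠ 0) :
    ∃ g : MvPowerSeries (Fin 4) R, subst (aZ R) (classForm K N c₀ c₁ c₂ U) = X 0 ^ α * g ∧ g.order = toE (ordZ α K N) :=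
  ⟨_, zChart_transform hL c₀ c₁ c₂ U, order_zChart hL _ _ _ _ (by rwa [constantCoeff_subst_of_zero aZ_const])
    (by rwa [constantCoeff_subst_of_zero aZ_const]) (by rwa [constantCoeff_subst_of_zero aZ_const])
    (by rwa [constantCoeff_subst_of_zero aZ_const])⟩

/-- ★★★ … (`q_a`, `a³ = −1`, `3 ∈ R×`): the total transform in the recentred `y`-chart is `y^α · g` with `ord g = ordA α K N`. -/
theorem aChart_strictTransform_order [Nontrivial R] {α : ℕ} {K N : Curve} (hL : Legal α K) (a : R) (ha : a ^ 3 = -1)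
    (h3 : IsUnit (3 : R)) (c₀ c₁ c₂ U : MvPowerSeries (Fin 4) R) (h₀ : IsUnit (constantCoeff c₀)) (h₁ : IsUnit (constantCoeff c₁))
    (h₂ : IsUnit (constantCoeff c₂)) (hU : IsUnit (constantCoeff U)) :
    ∃ g : MvPowerSeries (Fin 4) R, subst (aY a) (classForm K N c₀ c₁ c₂ U) = X 0 ^ α * g ∧ g.order = toE (ordA α K N) :=
  ⟨_, aChart_transform hL a ha c₀ c₁ c₂ U, order_aChart hL a ha h3 _ _ _ _ (by rwa [constantCoeff_subst_of_zero (aY_const a)])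
    (by rwa [constantCoeff_subst_of_zero (aY_const a)]) (by rwa [constantCoeff_subst_of_zero (aY_const a)])
    (by rwa [constantCoeff_subst_of_zero (aY_const a)])⟩

/-- ★★★ … (generic free direction, `U(0)·(a³ + 1) ≠ 0`): `y^α · g` with `ord g = ordG α K N`. -/
theorem gChart_strictTransform_order {α : ℕ} {K N : Curve} (hL : Legal α K) (a : R) (c₀ c₁ c₂ U : MvPowerSeries (Fin 4) R)
    (h₀ : constantCoeff c₀ ≠ 0) (h₁ : constantCoeff c₁ ≠ 0) (h₂ : constantCoeff c₂ ≠ 0) (hUa : constantCoeff U * (a ^ 3 + 1) ≠ 0) :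
    ∃ g : MvPowerSeries (Fin 4) R, subst (aY a) (classForm K N c₀ c₁ c₂ U) = X 0 ^ α * g ∧ g.order = toE (ordG α K N) := by
  refine ⟨_, gChart_transform hL a c₀ c₁ c₂ U, order_chartG hL _ fun i => ?_⟩
  fin_cases i
  · simpa [constantCoeff_subst_of_zero (aY_const a)] using h₀
  · simpa [constantCoeff_subst_of_zero (aY_const a)] using h₁
  · simpa [constantCoeff_subst_of_zero (aY_const a)] using h₂
  · have := constantCoeff_genericFactor a (subst (aY a) U)
    rw [constantCoeff_subst_of_zero (aY_const a)] at this
    simp only [Fin.reduceFinMk, Matrix.cons_val, ne_eq]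
    rw [this]
    exact hUa

/-- ★★★ E-S6(iv), GEOMETRIC FORM: for a legal accept with class form `f` (unit factors with unit constant terms, `3 ∈ R×`, `a³ = −1`), the
census test `mult3AtEnd α K N` holds iff the strict transform has order `≥ 3` at `q_z` or at `q_a`. -/
theorem mult3AtEnd_iff_strictTransform [Nontrivial R] {α : ℕ} {K N : Curve} (hL : Legal α K) (a : R) (ha : a ^ 3 = -1)
    (h3 : IsUnit (3 : R)) (c₀ c₁ c₂ U : MvPowerSeries (Fin 4) R) (h₀ : IsUnit (constantCoeff c₀)) (h₁ : IsUnit (constantCoeff c₁))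
    (h₂ : IsUnit (constantCoeff c₂)) (hU : IsUnit (constantCoeff U)) :
    ∃ gz ga : MvPowerSeries (Fin 4) R, subst (aZ R) (classForm K N c₀ c₁ c₂ U) = X 0 ^ α * gz ∧ subst (aY a) (classForm K N c₀ c₁ c₂ U) = X 0 ^ α * ga ∧
      (mult3AtEnd α K N = true ↔ 3 ≤ gz.order ∨ 3 ≤ ga.order) := by
  obtain ⟨gz, hz, hoz⟩ := zChart_strictTransform_order hL c₀ c₁ c₂ U h₀.ne_zero h₁.ne_zero h₂.ne_zero hU.ne_zero
  obtain ⟨ga, ha', hoa⟩ := aChart_strictTransform_order hL a ha h3 c₀ c₁ c₂ U h₀ h₁ h₂ hU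
  exact ⟨gz, ga, hz, ha', by rw [hoz, hoa, mult3AtEnd_iff]⟩

end BlowUp

/-! ## §6. The free-direction line of a POINT blow-up (moves `I`, `P`) — the same computation

Centre = the node `x₀ = K ∩ N = V(z, y, u, v)` itself, exponent `α` (`α = 3` at a top point: move `I` and top `P`; `α = 2` at a non-top
Sing₂ node: move `P`). The exceptional divisor is `ℙ³` with coordinates `(z : y : u : v)`; the strict transform `S′` meets it in the newborn
curve `Γ = {z = y = 0} ≅ ℙ¹_{(u:v)}` (weights `blowup`: `w_b(Γ) = o_b + b − α`, `w₃(Γ) = o₃ + 3 − α`), the `S′`-charts are `{u ≠ 0} ∪ {v ≠ 0}`,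
and the FREE-DIRECTION LINE is `{u = v = 0} ≅ ℙ¹_{(z:y)}`, covered by `q_z = (1:0:0:0)` (`z`-chart `(z, y, u, v) = (z, z·y′, z·u′, z·v′)`)
and the points `(a:1:0:0)` (`y`-chart `(y·(a+Z), y, y·u′, y·v′)`). Node orders `o_b = w_b(K) + w_b(N)`, `o₃ = w₃(K) + w₃(N)`; the local
equation at the node is the same `classForm K N c₀ c₁ c₂ U`. Term orders: class `b` ↦ `2b + 2o_b − α` at `q_z`, `b + 2o_b − α` on the
`y`-charts; cubic ↦ `3 + 2o₃ − α` (`q_z`, generic), `4 + 2o₃ − α` (`q_a`, `a³ = −1`). BOUNDS (all unit values): at `α = 3` blow-ups both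
branches are cubic-free (`lemma3_gmult|uv` of `Lines/toric_sgame_allchains.lean`), so the cubic term alone gives order `0 / 1 / 0` — `q_z` and the
generic directions are NOT on `X′`, `q_a` is a smooth point of `X′` or off it; at `α = 2` blow-ups `o₀ = 2` (`F2_P` of `Lines/toric_sgame.lean`
§B′), so the class-`0` term gives order `≤ 2` everywhere on the line (the double points `a³ = −1` of sheet S6 (vi)). Hence NO MULTIPLICITY-3
POINT on the free-direction line of any point blow-up of a legal play, for all unit values — the by-hand formulas of the dictionary note §5 (ii). -/

/-- twice the node order, `2·o_b = 2·(w_b(K) + w_b(N))` (`none = ∞`: class absent) -/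
def dsum (w e : Wt) : Wt := (wadd w e).map (2 * ·)

/-- ORDER AT `q_z = (1:0:0:0)` of a point blow-up: `min_b (2b + 2o_b − α) ⊓ (3 + 2o₃ − α)` -/
def pordZ (α : ℕ) (K N : Curve) : Wt :=
  wmin (tord 0 α (dsum K.w.w0 N.w.w0)) (wmin (tord 2 α (dsum K.w.w1 N.w.w1)) (wmin (tord 4 α (dsum K.w.w2 N.w.w2))
    (tord 3 α (some (2 * (K.w3 + N.w3))))))

/-- ORDER AT `q_a = (a:1:0:0)`, `a³ = −1`: `min_b (b + 2o_b − α) ⊓ (4 + 2o₃ − α)` -/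
def pordA (α : ℕ) (K N : Curve) : Wt :=
  wmin (tord 0 α (dsum K.w.w0 N.w.w0)) (wmin (tord 1 α (dsum K.w.w1 N.w.w1)) (wmin (tord 2 α (dsum K.w.w2 N.w.w2))
    (tord 4 α (some (2 * (K.w3 + N.w3))))))

/-- ORDER AT A GENERIC direction `(a:1:0:0)`, `a³ ≠ −1`, and at `(0:1:0:0)`: `min_b (b + 2o_b − α) ⊓ (3 + 2o₃ − α)` -/
def pordG (α : ℕ) (K N : Curve) : Wt :=
  wmin (tord 0 α (dsum K.w.w0 N.w.w0)) (wmin (tord 1 α (dsum K.w.w1 N.w.w1)) (wmin (tord 2 α (dsum K.w.w2 N.w.w2))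
    (tord 3 α (some (2 * (K.w3 + N.w3))))))

/-! ### sanity checks (`decide`) -/

/-- top node `o = (3,2,1)`, `o₃ = 0`, `α = 3` (move `I` / top `P`): `q_z` is off `X′` (order 0), `q_a` is a smooth point (order 1). -/
theorem top_point_blowup : pordZ 3 ⟨⟨some 3, some 2, some 1⟩, 0, true⟩ ⟨⟨some 0, some 0, some 0⟩, 0, true⟩ = some 0 ∧
    pordA 3 ⟨⟨some 3, some 2, some 1⟩, 0, true⟩ ⟨⟨some 0, some 0, some 0⟩, 0, true⟩ = some 1 := by decide

/-- non-top Sing₂ node `o = (2,2,1)`, `o₃ = 0`, `α = 2` (move `P`): order 1 at `q_z`, the DOUBLE POINTS `q_a` of sheet S6 (vi) (order 2). -/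
theorem sing2_point_blowup : pordZ 2 ⟨⟨some 2, some 2, some 1⟩, 0, true⟩ ⟨⟨some 0, some 0, some 0⟩, 0, true⟩ = some 1 ∧
    pordA 2 ⟨⟨some 2, some 2, some 1⟩, 0, true⟩ ⟨⟨some 0, some 0, some 0⟩, 0, true⟩ = some 2 := by decide

/-- the same with cubic weight `o₃ = 1` on one branch (census flag b3, birth of a `(Q₂)`-line): still order 2 at `q_a` (class `0` decides). -/
theorem q2birth_point_blowup : pordA 2 ⟨⟨some 2, some 2, some 1⟩, 0, true⟩ ⟨⟨some 0, some 0, some 0⟩, 1, true⟩ = some 2 := by decide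

/-- point-blow-up exponent of the class-`b` term: `(b + o_b − α, i, w_b(K), w_b(N))` (`i = b` at `q_z`, `0` on the `y`-charts) -/
def pclsExp (α b i : ℕ) (w e : Wt) : Option (Fin 4 →₀ ℕ) :=
  match w, e with
  | Option.some m, Option.some n => some (ev (b + m + n - α) i m n)
  | _, _ => none

/-- point-blow-up exponent of the cubic term: `(3 + o₃ − α, i, w₃(K), w₃(N))` -/
def pcubExp (α i : ℕ) (K N : Curve) : Fin 4 →₀ ℕ := ev (3 + K.w3 + N.w3 - α) i K.w3 N.w3

/-- `z`-chart of the point blow-up at `q_z`: class `b` ↦ `c_b z^{b+o_b−α} y′^b u′^{w_b} v′^{e_b}`, cubic ↦ `U(1+y′³) z^{3+o₃−α} u′^{w₃} v′^{e₃}` -/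
def pexpZ (α : ℕ) (K N : Curve) : Fin 4 → Option (Fin 4 →₀ ℕ)
  | 0 => pclsExp α 0 0 K.w.w0 N.w.w0
  | 1 => pclsExp α 1 1 K.w.w1 N.w.w1
  | 2 => pclsExp α 2 2 K.w.w2 N.w.w2
  | 3 => some (pcubExp α 0 K N)

/-- `y`-chart of the point blow-up at `q_a = (a:1:0:0)`, `a³ = −1` -/
def pexpA (α : ℕ) (K N : Curve) : Fin 4 → Option (Fin 4 →₀ ℕ)
  | 0 => pclsExp α 0 0 K.w.w0 N.w.w0
  | 1 => pclsExp α 1 0 K.w.w1 N.w.w1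
  | 2 => pclsExp α 2 0 K.w.w2 N.w.w2
  | 3 => some (pcubExp α 1 K N)

/-- `y`-chart of the point blow-up at a generic direction -/
def pexpG (α : ℕ) (K N : Curve) : Fin 4 → Option (Fin 4 →₀ ℕ)
  | 0 => pclsExp α 0 0 K.w.w0 N.w.w0
  | 1 => pclsExp α 1 0 K.w.w1 N.w.w1
  | 2 => pclsExp α 2 0 K.w.w2 N.w.w2
  | 3 => some (pcubExp α 0 K N)

/-- LEGALITY of the point blow-up: `o_b + b ≥ α` for the present classes, `α ≤ 3` (`α = 3`: top node `o ≥ (3,2,1)`; `α = 2`: `o ≥ (2,1,0)`,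
in particular every Sing₂ node). -/
structure LegalPt (α : ℕ) (K N : Curve) : Prop where
  h0 : ∀ m n, K.w.w0 = some m → N.w.w0 = some n → α ≤ 0 + m + n
  h1 : ∀ m n, K.w.w1 = some m → N.w.w1 = some n → α ≤ 1 + m + n
  h2 : ∀ m n, K.w.w2 = some m → N.w.w2 = some n → α ≤ 2 + m + n
  h3 : α ≤ 3

theorem le_add_of_wge_wadd {w e : Wt} {t m n : ℕ} (h : wge (wadd w e) t = true) (hm : w = some m) (hn : e = some n) : t ≤ m + n := by
  subst hm hn
  exact le_of_wge h rfl

theorem legalPt_three (K N : Curve) (h0 : wge (wadd K.w.w0 N.w.w0) 3 = true) (h1 : wge (wadd K.w.w1 N.w.w1) 2 = true)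
    (h2 : wge (wadd K.w.w2 N.w.w2) 1 = true) : LegalPt 3 K N :=
  ⟨fun _ _ hm hn => by have := le_add_of_wge_wadd h0 hm hn; omega, fun _ _ hm hn => by have := le_add_of_wge_wadd h1 hm hn; omega,
    fun _ _ hm hn => by have := le_add_of_wge_wadd h2 hm hn; omega, le_rfl⟩

theorem legalPt_two (K N : Curve) (h0 : wge (wadd K.w.w0 N.w.w0) 2 = true) (h1 : wge (wadd K.w.w1 N.w.w1) 1 = true)
    (h2 : wge (wadd K.w.w2 N.w.w2) 0 = true) : LegalPt 2 K N :=
  ⟨fun _ _ hm hn => by have := le_add_of_wge_wadd h0 hm hn; omega, fun _ _ hm hn => by have := le_add_of_wge_wadd h1 hm hn; omega,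
    fun _ _ hm hn => by have := le_add_of_wge_wadd h2 hm hn; omega, by omega⟩

theorem odeg_pclsExp (α b i : ℕ) (w e : Wt) (hleg : ∀ m n, w = some m → e = some n → α ≤ b + m + n) :
    odeg (pclsExp α b i w e) = toE (tord (b + i) α (dsum w e)) := by
  rcases w with _ | m <;> rcases e with _ | n
  · rfl
  · rfl
  · rfl
  · have := hleg m n rfl rfl
    simp only [pclsExp, odeg_some, degree_ev, dsum, wadd, Option.map_some, tord, toE_some, Nat.cast_inj]
    omega

theorem odeg_pcubExp (α i : ℕ) (K N : Curve) (h3 : α ≤ 3) :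
    odeg (some (pcubExp α i K N)) = toE (tord (3 + i) α (some (2 * (K.w3 + N.w3)))) := by
  simp only [pcubExp, odeg_some, degree_ev, Option.map_some, tord, toE_some, Nat.cast_inj]
  omega

@[simp] theorem ev_apply_three (n₀ n₁ n₂ n₃ : ℕ) : ev n₀ n₁ n₂ n₃ 3 = n₃ := by simp [ev]

/-- the TAG `d 0 + α − d 2 − d 3` recovers the index of a present term (classes: `b`; cubic: `3`) -/
theorem pclsExp_tag {α b i : ℕ} {w e : Wt} (hleg : ∀ m n, w = some m → e = some n → α ≤ b + m + n) {d : Fin 4 →₀ ℕ}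
    (h : pclsExp α b i w e = some d) : d 0 + α = b + d 2 + d 3 := by
  rcases w with _ | m <;> rcases e with _ | n
  · exact absurd h (by simp [pclsExp])
  · exact absurd h (by simp [pclsExp])
  · exact absurd h (by simp [pclsExp])
  · have hd : d = ev (b + m + n - α) i m n := by simpa [pclsExp] using h.symm
    subst hd
    have := hleg m n rfl rfl
    simp only [ev_apply_zero, ev_apply_two, ev_apply_three]
    omega

theorem pcubExp_tag {α i : ℕ} {K N : Curve} (h3 : α ≤ 3) {d : Fin 4 →₀ ℕ} (h : some (pcubExp α i K N) = some d) :
    d 0 + α = 3 + d 2 + d 3 := by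
  have hd : d = pcubExp α i K N := (Option.some.inj h).symm
  subst hd
  simp only [pcubExp, ev_apply_zero, ev_apply_two, ev_apply_three]
  omega

theorem pexpZ_tag {α : ℕ} {K N : Curve} (hL : LegalPt α K N) (i : Fin 4) (d : Fin 4 →₀ ℕ) (h : pexpZ α K N i = some d) :
    d 0 + α = (i : ℕ) + d 2 + d 3 := by
  fin_cases i
  · simpa using pclsExp_tag hL.h0 h
  · simpa using pclsExp_tag hL.h1 h
  · simpa using pclsExp_tag hL.h2 h
  · simpa using pcubExp_tag (K := K) (N := N) hL.h3 h

theorem pexpA_tag {α : ℕ} {K N : Curve} (hL : LegalPt α K N) (i : Fin 4) (d : Fin 4 →₀ ℕ) (h : pexpA α K N i = some d) :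
    d 0 + α = (i : ℕ) + d 2 + d 3 := by
  fin_cases i
  · simpa using pclsExp_tag hL.h0 h
  · simpa using pclsExp_tag hL.h1 h
  · simpa using pclsExp_tag hL.h2 h
  · simpa using pcubExp_tag (K := K) (N := N) hL.h3 h

theorem pexpG_tag {α : ℕ} {K N : Curve} (hL : LegalPt α K N) (i : Fin 4) (d : Fin 4 →₀ ℕ) (h : pexpG α K N i = some d) :
    d 0 + α = (i : ℕ) + d 2 + d 3 := by
  fin_cases i
  · simpa using pclsExp_tag hL.h0 h
  · simpa using pclsExp_tag hL.h1 h
  · simpa using pclsExp_tag hL.h2 h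
  · simpa using pcubExp_tag (K := K) (N := N) hL.h3 h

theorem inj_of_tag3 {α : ℕ} (ex : Fin 4 → Option (Fin 4 →₀ ℕ)) (htag : ∀ i d, ex i = some d → d 0 + α = (i : ℕ) + d 2 + d 3) :
    ∀ i ∈ (Finset.univ : Finset (Fin 4)), ∀ j ∈ (Finset.univ : Finset (Fin 4)), ∀ d, ex i = some d → ex j = some d → i = j := by
  intro i _ j _ d hi hj
  have h1 := htag i d hi
  have h2 := htag j d hj
  exact Fin.ext (by omega)

section POrders
variable {R : Type*} [CommSemiring R]

/-- ★ ORDER AT `q_z` OF A POINT BLOW-UP, ALL UNIT VALUES -/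
theorem order_pchartZ {α : ℕ} {K N : Curve} (hL : LegalPt α K N) (u : Fin 4 → MvPowerSeries (Fin 4) R)
    (hu : ∀ i, constantCoeff (u i) ≠ 0) : (chartNF (pexpZ α K N) u).order = toE (pordZ α K N) := by
  unfold chartNF
  rw [order_sum_oterm _ _ _ (inj_of_tag3 _ (pexpZ_tag hL)) fun i _ _ _ => hu i, inf_univ_fin4]
  simp only [pexpZ, pordZ, toE_wmin]
  rw [odeg_pclsExp _ _ _ _ _ hL.h0, odeg_pclsExp _ _ _ _ _ hL.h1, odeg_pclsExp _ _ _ _ _ hL.h2, odeg_pcubExp _ _ _ _ hL.h3]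

/-- ★ ORDER AT `q_a` OF A POINT BLOW-UP, ALL UNIT VALUES -/
theorem order_pchartA {α : ℕ} {K N : Curve} (hL : LegalPt α K N) (u : Fin 4 → MvPowerSeries (Fin 4) R)
    (hu : ∀ i, constantCoeff (u i) ≠ 0) : (chartNF (pexpA α K N) u).order = toE (pordA α K N) := by
  unfold chartNF
  rw [order_sum_oterm _ _ _ (inj_of_tag3 _ (pexpA_tag hL)) fun i _ _ _ => hu i, inf_univ_fin4]
  simp only [pexpA, pordA, toE_wmin]
  rw [odeg_pclsExp _ _ _ _ _ hL.h0, odeg_pclsExp _ _ _ _ _ hL.h1, odeg_pclsExp _ _ _ _ _ hL.h2, odeg_pcubExp _ _ _ _ hL.h3]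

/-- ★ ORDER AT A GENERIC DIRECTION OF A POINT BLOW-UP, ALL UNIT VALUES -/
theorem order_pchartG {α : ℕ} {K N : Curve} (hL : LegalPt α K N) (u : Fin 4 → MvPowerSeries (Fin 4) R)
    (hu : ∀ i, constantCoeff (u i) ≠ 0) : (chartNF (pexpG α K N) u).order = toE (pordG α K N) := by
  unfold chartNF
  rw [order_sum_oterm _ _ _ (inj_of_tag3 _ (pexpG_tag hL)) fun i _ _ _ => hu i, inf_univ_fin4]
  simp only [pexpG, pordG, toE_wmin]
  rw [odeg_pclsExp _ _ _ _ _ hL.h0, odeg_pclsExp _ _ _ _ _ hL.h1, odeg_pclsExp _ _ _ _ _ hL.h2, odeg_pcubExp _ _ _ _ hL.h3]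

end POrders

/-! ### bounds on the order data from the kernel facts `lemma3_*` (α = 3 ⇒ o₃ = 0) and `F2_P` (α = 2 ⇒ o₀ = 2) -/

theorem toE_wmin4_le_first (a b c d : Wt) : toE (wmin a (wmin b (wmin c d))) ≤ toE a := by
  simp only [toE_wmin]
  exact inf_le_left

theorem toE_wmin4_le_last (a b c d : Wt) : toE (wmin a (wmin b (wmin c d))) ≤ toE d := by
  simp only [toE_wmin]
  exact inf_le_right.trans (inf_le_right.trans inf_le_right)

/-- generic directions are dominated by `q_a` -/
theorem pordG_le_pordA (α : ℕ) (K N : Curve) : toE (pordG α K N) ≤ toE (pordA α K N) := by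
  simp only [pordG, pordA, toE_wmin]
  exact inf_le_inf le_rfl (inf_le_inf le_rfl (inf_le_inf le_rfl (toE_tord_mono_shift 3 4 α (by omega) _)))

/-- ★ `α = 3` point blow-ups at CUBIC-FREE nodes (`lemma3_gmult|uv`): orders `≤ 0 / ≤ 1 / ≤ 0` at `q_z` / `q_a` / generic — the free line
carries no singular point of `X′` at all. -/
theorem pord_three_noCubic (K N : Curve) (hK : K.w3 = 0) (hN : N.w3 = 0) :
    toE (pordZ 3 K N) ≤ 0 ∧ toE (pordA 3 K N) ≤ 1 ∧ toE (pordG 3 K N) ≤ 0 := by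
  refine ⟨(toE_wmin4_le_last _ _ _ _).trans ?_, (toE_wmin4_le_last _ _ _ _).trans ?_, (toE_wmin4_le_last _ _ _ _).trans ?_⟩ <;>
    simp [hK, hN, tord]

/-- ★ `α = 2` point blow-ups at nodes with `o₀ = 2` (`F2_P`): order `≤ 2` at every point of the free line (class `0` alone). -/
theorem pord_two_o0 (K N : Curve) (h0 : wadd K.w.w0 N.w.w0 = some 2) :
    toE (pordZ 2 K N) ≤ 2 ∧ toE (pordA 2 K N) ≤ 2 ∧ toE (pordG 2 K N) ≤ 2 := by
  refine ⟨(toE_wmin4_le_first _ _ _ _).trans ?_, (toE_wmin4_le_first _ _ _ _).trans ?_, (toE_wmin4_le_first _ _ _ _).trans ?_⟩ <;>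
    simp [dsum, h0, tord]

/-- ★★ SUMMARY (point blow-ups): in either legal situation of the game — `α = 3` at a cubic-free node, or `α = 2` at a node with `o₀ = 2` —
the order data is `≤ 2` at `q_z`, at `q_a` and at every generic direction: NO multiplicity-3 point on the free-direction line `ℙ¹_{(z:y)}`. -/
theorem pointFreeLine_orders_le_two {α : ℕ} {K N : Curve}
    (h : (α = 3 ∧ K.w3 = 0 ∧ N.w3 = 0) ∨ (α = 2 ∧ wadd K.w.w0 N.w.w0 = some 2)) :
    toE (pordZ α K N) ≤ 2 ∧ toE (pordA α K N) ≤ 2 ∧ toE (pordG α K N) ≤ 2 := by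
  rcases h with ⟨rfl, hK, hN⟩ | ⟨rfl, h0⟩
  · obtain ⟨hz, ha, hg⟩ := pord_three_noCubic K N hK hN
    exact ⟨hz.trans (by norm_num), ha.trans (by norm_num), hg.trans (by norm_num)⟩
  · exact pord_two_o0 K N h0

section PBlowUp
variable {R : Type*} [CommRing R]

/-- the `z`-chart of the point blow-up: `(z, y, u, v) ↦ (z, z·y′, z·u′, z·v′)` -/
def pZ (R : Type*) [CommRing R] : Fin 4 → MvPowerSeries (Fin 4) R := ![X 0, X 0 * X 1, X 0 * X 2, X 0 * X 3]

/-- the `y`-chart of the point blow-up recentred at `(a:1:0:0)`: `(z, y, u, v) ↦ (y·(a + Z), y, y·u′, y·v′)` -/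
def pY (a : R) : Fin 4 → MvPowerSeries (Fin 4) R := ![X 0 * (C a + X 1), X 0, X 0 * X 2, X 0 * X 3]

@[simp] theorem pZ_0 : pZ R 0 = X 0 := rfl
@[simp] theorem pZ_1 : pZ R 1 = X 0 * X 1 := rfl
@[simp] theorem pZ_2 : pZ R 2 = X 0 * X 2 := rfl
@[simp] theorem pZ_3 : pZ R 3 = X 0 * X 3 := rfl
@[simp] theorem pY_0 (a : R) : pY a 0 = X 0 * (C a + X 1) := rfl
@[simp] theorem pY_1 (a : R) : pY a 1 = X 0 := rfl
@[simp] theorem pY_2 (a : R) : pY a 2 = X 0 * X 2 := rfl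
@[simp] theorem pY_3 (a : R) : pY a 3 = X 0 * X 3 := rfl

theorem pZ_const (s : Fin 4) : constantCoeff (pZ R s) = 0 := by
  fin_cases s <;> simp [constantCoeff_X]

theorem pY_const (a : R) (s : Fin 4) : constantCoeff (pY a s) = 0 := by
  fin_cases s <;> simp [constantCoeff_X, constantCoeff_C]

theorem hasSubst_pZ : HasSubst (pZ R) := hasSubst_of_constantCoeff_zero pZ_const
theorem hasSubst_pY (a : R) : HasSubst (pY a) := hasSubst_of_constantCoeff_zero (pY_const a)

/-- `z`-chart, class-`b` term: `c_b y^b u^m v^n ↦ z^{b+m+n} y′^b u′^m v′^n c_b′ = z^α · (z^{b+m+n−α} y′^b u′^m v′^n c_b′)` -/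
theorem pZ_clsTerm {α b : ℕ} {w e : Wt} (hleg : ∀ m n, w = some m → e = some n → α ≤ b + m + n) (c : MvPowerSeries (Fin 4) R) :
    subst (pZ R) (oterm (clsUp b w e) c) = X 0 ^ α * oterm (pclsExp α b b w e) (subst (pZ R) c : MvPowerSeries (Fin 4) R) := by
  rcases w with _ | m <;> rcases e with _ | n
  · simp [clsUp, pclsExp, subst_zero_of_hasSubst hasSubst_pZ]
  · simp [clsUp, pclsExp, subst_zero_of_hasSubst hasSubst_pZ]
  · simp [clsUp, pclsExp, subst_zero_of_hasSubst hasSubst_pZ]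
  · have hα := hleg m n rfl rfl
    simp only [clsUp, pclsExp, oterm_some]
    rw [subst_mul hasSubst_pZ, subst_monomial_ev hasSubst_pZ, monomial_ev]
    simp only [pZ_0, pZ_1, pZ_2, pZ_3]
    calc _ = (X 0 : MvPowerSeries (Fin 4) R) ^ (b + m + n) * (X 1 ^ b * X 2 ^ m * X 3 ^ n * subst (pZ R) c) := by ring
      _ = _ := by rw [X0_pow_split hα]; ring

/-- `z`-chart, cubic term: `U u^{w₃} v^{e₃} (z³ + y³) ↦ z^{3+o₃} u′^{w₃} v′^{e₃} U′ (1 + y′³) = z^α · (…)` -/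
theorem pZ_cubic {α : ℕ} (K N : Curve) (h3 : α ≤ 3) (U : MvPowerSeries (Fin 4) R) :
    subst (pZ R) (monomial (ev 0 0 K.w3 N.w3) (1 : R) * (U * (X 0 ^ 3 + X 1 ^ 3))) =
      X 0 ^ α * (monomial (pcubExp α 0 K N) (1 : R) * (subst (pZ R) U * (1 + X 1 ^ 3))) := by
  rw [subst_mul hasSubst_pZ, subst_mul hasSubst_pZ, subst_add hasSubst_pZ, subst_pow hasSubst_pZ, subst_pow hasSubst_pZ,
    subst_X hasSubst_pZ, subst_X hasSubst_pZ, subst_monomial_ev hasSubst_pZ, pcubExp, monomial_ev]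
  simp only [pZ_0, pZ_1, pZ_2, pZ_3]
  calc _ = (X 0 : MvPowerSeries (Fin 4) R) ^ (3 + K.w3 + N.w3) * (X 2 ^ K.w3 * X 3 ^ N.w3 * (subst (pZ R) U * (1 + X 1 ^ 3))) := by ring
    _ = _ := by rw [X0_pow_split (show α ≤ 3 + K.w3 + N.w3 by omega)]; ring

/-- `y`-chart (any `a`), class-`b` term: `c_b y^b u^m v^n ↦ y^{b+m+n} u′^m v′^n c_b′ = y^α · (y^{b+m+n−α} u′^m v′^n c_b′)` -/
theorem pY_clsTerm (a : R) {α b : ℕ} {w e : Wt} (hleg : ∀ m n, w = some m → e = some n → α ≤ b + m + n) (c : MvPowerSeries (Fin 4) R) :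
    subst (pY a) (oterm (clsUp b w e) c) = X 0 ^ α * oterm (pclsExp α b 0 w e) (subst (pY a) c : MvPowerSeries (Fin 4) R) := by
  rcases w with _ | m <;> rcases e with _ | n
  · simp [clsUp, pclsExp, subst_zero_of_hasSubst (hasSubst_pY a)]
  · simp [clsUp, pclsExp, subst_zero_of_hasSubst (hasSubst_pY a)]
  · simp [clsUp, pclsExp, subst_zero_of_hasSubst (hasSubst_pY a)]
  · have hα := hleg m n rfl rfl
    simp only [clsUp, pclsExp, oterm_some]
    rw [subst_mul (hasSubst_pY a), subst_monomial_ev (hasSubst_pY a), monomial_ev]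
    simp only [pY_0, pY_1, pY_2, pY_3]
    calc _ = (X 0 : MvPowerSeries (Fin 4) R) ^ (b + m + n) * (X 2 ^ m * X 3 ^ n * subst (pY a) c) := by ring
      _ = _ := by rw [X0_pow_split hα]; ring

/-- `y`-chart at `q_a` (`a³ = −1`), cubic term: `↦ y^{3+o₃} u′^{w₃} v′^{e₃} U′ ((a+Z)³ + 1) = y^α · (y^{3+o₃−α} Z u′^{w₃} v′^{e₃}) · U′(3a² + 3aZ + Z²)` -/
theorem pY_cubic_qa (a : R) (ha : a ^ 3 = -1) {α : ℕ} (K N : Curve) (h3 : α ≤ 3) (U : MvPowerSeries (Fin 4) R) :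
    subst (pY a) (monomial (ev 0 0 K.w3 N.w3) (1 : R) * (U * (X 0 ^ 3 + X 1 ^ 3))) =
      X 0 ^ α * (monomial (pcubExp α 1 K N) (1 : R) * (subst (pY a) U * (3 * C a ^ 2 + 3 * C a * X 1 + X 1 ^ 2))) := by
  rw [subst_mul (hasSubst_pY a), subst_mul (hasSubst_pY a), subst_add (hasSubst_pY a), subst_pow (hasSubst_pY a),
    subst_pow (hasSubst_pY a), subst_X (hasSubst_pY a), subst_X (hasSubst_pY a), subst_monomial_ev (hasSubst_pY a), pcubExp, monomial_ev]
  simp only [pY_0, pY_1, pY_2, pY_3]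
  calc _ = (X 0 : MvPowerSeries (Fin 4) R) ^ (3 + K.w3 + N.w3) * (X 2 ^ K.w3 * X 3 ^ N.w3 * subst (pY a) U *
        (((C a : MvPowerSeries (Fin 4) R) + X 1) ^ 3 + 1)) := by ring
    _ = _ := by rw [cubic_shift_eq a ha, X0_pow_split (show α ≤ 3 + K.w3 + N.w3 by omega)]; ring

/-- `y`-chart at a generic direction, cubic term: the residual cubic factor `(a+Z)³ + 1` stays a unit -/
theorem pY_cubic_generic (a : R) {α : ℕ} (K N : Curve) (h3 : α ≤ 3) (U : MvPowerSeries (Fin 4) R) :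
    subst (pY a) (monomial (ev 0 0 K.w3 N.w3) (1 : R) * (U * (X 0 ^ 3 + X 1 ^ 3))) =
      X 0 ^ α * (monomial (pcubExp α 0 K N) (1 : R) * (subst (pY a) U * (((C a : MvPowerSeries (Fin 4) R) + X 1) ^ 3 + 1))) := by
  rw [subst_mul (hasSubst_pY a), subst_mul (hasSubst_pY a), subst_add (hasSubst_pY a), subst_pow (hasSubst_pY a),
    subst_pow (hasSubst_pY a), subst_X (hasSubst_pY a), subst_X (hasSubst_pY a), subst_monomial_ev (hasSubst_pY a), pcubExp, monomial_ev]
  simp only [pY_0, pY_1, pY_2, pY_3]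
  calc _ = (X 0 : MvPowerSeries (Fin 4) R) ^ (3 + K.w3 + N.w3) * (X 2 ^ K.w3 * X 3 ^ N.w3 * subst (pY a) U *
        (((C a : MvPowerSeries (Fin 4) R) + X 1) ^ 3 + 1)) := by ring
    _ = _ := by rw [X0_pow_split (show α ≤ 3 + K.w3 + N.w3 by omega)]; ring

/-- ★★ `z`-CHART of the point blow-up: total transform `= z^α ·` normal form. -/
theorem pzChart_transform {α : ℕ} {K N : Curve} (hL : LegalPt α K N) (c₀ c₁ c₂ U : MvPowerSeries (Fin 4) R) :
    (subst (pZ R) (classForm K N c₀ c₁ c₂ U) : MvPowerSeries (Fin 4) R) =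
      X 0 ^ α * chartNF (pexpZ α K N) ![subst (pZ R) c₀, subst (pZ R) c₁, subst (pZ R) c₂, subst (pZ R) U * (1 + X 1 ^ 3)] := by
  rw [classForm, subst_add hasSubst_pZ, subst_add hasSubst_pZ, subst_add hasSubst_pZ, pZ_clsTerm hL.h0, pZ_clsTerm hL.h1,
    pZ_clsTerm hL.h2, pZ_cubic K N hL.h3, chartNF_eq]
  simp only [pexpZ, oterm_some, Matrix.cons_val_zero, Matrix.cons_val_one, Matrix.cons_val]
  ring

/-- ★★ `y`-CHART of the point blow-up at `q_a` (`a³ = −1`). -/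
theorem paChart_transform {α : ℕ} {K N : Curve} (hL : LegalPt α K N) (a : R) (ha : a ^ 3 = -1) (c₀ c₁ c₂ U : MvPowerSeries (Fin 4) R) :
    (subst (pY a) (classForm K N c₀ c₁ c₂ U) : MvPowerSeries (Fin 4) R) = X 0 ^ α * chartNF (pexpA α K N)
      ![subst (pY a) c₀, subst (pY a) c₁, subst (pY a) c₂, subst (pY a) U * (3 * C a ^ 2 + 3 * C a * X 1 + X 1 ^ 2)] := by
  rw [classForm, subst_add (hasSubst_pY a), subst_add (hasSubst_pY a), subst_add (hasSubst_pY a), pY_clsTerm a hL.h0,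
    pY_clsTerm a hL.h1, pY_clsTerm a hL.h2, pY_cubic_qa a ha K N hL.h3, chartNF_eq]
  simp only [pexpA, oterm_some, Matrix.cons_val_zero, Matrix.cons_val_one, Matrix.cons_val]
  ring

/-- ★★ `y`-CHART of the point blow-up at a generic direction `(a:1:0:0)` (incl. `(0:1:0:0)`). -/
theorem pgChart_transform {α : ℕ} {K N : Curve} (hL : LegalPt α K N) (a : R) (c₀ c₁ c₂ U : MvPowerSeries (Fin 4) R) :
    (subst (pY a) (classForm K N c₀ c₁ c₂ U) : MvPowerSeries (Fin 4) R) = X 0 ^ α * chartNF (pexpG α K N)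
      ![subst (pY a) c₀, subst (pY a) c₁, subst (pY a) c₂, subst (pY a) U * (((C a : MvPowerSeries (Fin 4) R) + X 1) ^ 3 + 1)] := by
  rw [classForm, subst_add (hasSubst_pY a), subst_add (hasSubst_pY a), subst_add (hasSubst_pY a), pY_clsTerm a hL.h0,
    pY_clsTerm a hL.h1, pY_clsTerm a hL.h2, pY_cubic_generic a K N hL.h3, chartNF_eq]
  simp only [pexpG, oterm_some, Matrix.cons_val_zero, Matrix.cons_val_one, Matrix.cons_val]
  ring

/-- ★★★ point blow-up, `q_z`: total transform `= z^α · g`, `ord g = pordZ α K N`, all unit values -/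
theorem pzChart_strictTransform_order {α : ℕ} {K N : Curve} (hL : LegalPt α K N) (c₀ c₁ c₂ U : MvPowerSeries (Fin 4) R)
    (h₀ : constantCoeff c₀ ≠ 0) (h₁ : constantCoeff c₁ ≠ 0) (h₂ : constantCoeff c₂ ≠ 0) (hU : constantCoeff U ≠ 0) :
    ∃ g : MvPowerSeries (Fin 4) R, subst (pZ R) (classForm K N c₀ c₁ c₂ U) = X 0 ^ α * g ∧ g.order = toE (pordZ α K N) := by
  refine ⟨_, pzChart_transform hL c₀ c₁ c₂ U, order_pchartZ hL _ fun i => ?_⟩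
  fin_cases i
  · simpa [constantCoeff_subst_of_zero pZ_const] using h₀
  · simpa [constantCoeff_subst_of_zero pZ_const] using h₁
  · simpa [constantCoeff_subst_of_zero pZ_const] using h₂
  · have := constantCoeff_qzFactor (subst (pZ R) U)
    rw [constantCoeff_subst_of_zero pZ_const] at this
    simp only [Fin.reduceFinMk, Matrix.cons_val, ne_eq]
    rw [this]
    exact hU

/-- ★★★ point blow-up, `q_a` (`a³ = −1`, `3 ∈ R×`, unit constant terms): `y^α · g`, `ord g = pordA α K N` -/
theorem paChart_strictTransform_order [Nontrivial R] {α : ℕ} {K N : Curve} (hL : LegalPt α K N) (a : R) (ha : a ^ 3 = -1)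
    (h3 : IsUnit (3 : R)) (c₀ c₁ c₂ U : MvPowerSeries (Fin 4) R) (h₀ : IsUnit (constantCoeff c₀)) (h₁ : IsUnit (constantCoeff c₁))
    (h₂ : IsUnit (constantCoeff c₂)) (hU : IsUnit (constantCoeff U)) :
    ∃ g : MvPowerSeries (Fin 4) R, subst (pY a) (classForm K N c₀ c₁ c₂ U) = X 0 ^ α * g ∧ g.order = toE (pordA α K N) := by
  refine ⟨_, paChart_transform hL a ha c₀ c₁ c₂ U, order_pchartA hL _ fun i => ?_⟩
  fin_cases i
  · simpa [constantCoeff_subst_of_zero (pY_const a)] using h₀.ne_zero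
  · simpa [constantCoeff_subst_of_zero (pY_const a)] using h₁.ne_zero
  · simpa [constantCoeff_subst_of_zero (pY_const a)] using h₂.ne_zero
  · have hU' : IsUnit (constantCoeff (subst (pY a) U)) := by rwa [constantCoeff_subst_of_zero (pY_const a)]
    have hne := (hU'.mul (isUnit_three_mul_sq a ha h3)).ne_zero
    have := constantCoeff_qaFactor a (subst (pY a) U)
    simp only [Fin.reduceFinMk, Matrix.cons_val, ne_eq]
    rw [this]
    exact hne

/-- ★★★ point blow-up, generic direction (`U(0)·(a³ + 1) ≠ 0`): `y^α · g`, `ord g = pordG α K N` -/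
theorem pgChart_strictTransform_order {α : ℕ} {K N : Curve} (hL : LegalPt α K N) (a : R) (c₀ c₁ c₂ U : MvPowerSeries (Fin 4) R)
    (h₀ : constantCoeff c₀ ≠ 0) (h₁ : constantCoeff c₁ ≠ 0) (h₂ : constantCoeff c₂ ≠ 0) (hUa : constantCoeff U * (a ^ 3 + 1) ≠ 0) :
    ∃ g : MvPowerSeries (Fin 4) R, subst (pY a) (classForm K N c₀ c₁ c₂ U) = X 0 ^ α * g ∧ g.order = toE (pordG α K N) := by
  refine ⟨_, pgChart_transform hL a c₀ c₁ c₂ U, order_pchartG hL _ fun i => ?_⟩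
  fin_cases i
  · simpa [constantCoeff_subst_of_zero (pY_const a)] using h₀
  · simpa [constantCoeff_subst_of_zero (pY_const a)] using h₁
  · simpa [constantCoeff_subst_of_zero (pY_const a)] using h₂
  · have := constantCoeff_genericFactor a (subst (pY a) U)
    rw [constantCoeff_subst_of_zero (pY_const a)] at this
    simp only [Fin.reduceFinMk, Matrix.cons_val, ne_eq]
    rw [this]
    exact hUa

/-- ★★★ GEOMETRIC SUMMARY for point blow-ups: under the kernel facts of the game (`α = 3` only at cubic-free nodes; `α = 2` only at nodes
with `o₀ = 2`) and legality, for all unit factors with unit constant terms (`3 ∈ R×`, `a³ = −1`), the strict transforms at `q_z` and `q_a` have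
order `≤ 2` (and the generic directions are dominated by `q_a`): no multiplicity-3 point on the free-direction line. -/
theorem pointFreeLine_strictTransform_le_two [Nontrivial R] {α : ℕ} {K N : Curve} (hL : LegalPt α K N)
    (h : (α = 3 ∧ K.w3 = 0 ∧ N.w3 = 0) ∨ (α = 2 ∧ wadd K.w.w0 N.w.w0 = some 2)) (a : R) (ha : a ^ 3 = -1) (h3 : IsUnit (3 : R))
    (c₀ c₁ c₂ U : MvPowerSeries (Fin 4) R) (h₀ : IsUnit (constantCoeff c₀)) (h₁ : IsUnit (constantCoeff c₁))
    (h₂ : IsUnit (constantCoeff c₂)) (hU : IsUnit (constantCoeff U)) :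
    ∃ gz ga : MvPowerSeries (Fin 4) R, subst (pZ R) (classForm K N c₀ c₁ c₂ U) = X 0 ^ α * gz ∧
      subst (pY a) (classForm K N c₀ c₁ c₂ U) = X 0 ^ α * ga ∧ gz.order ≤ 2 ∧ ga.order ≤ 2 := by
  obtain ⟨gz, hz, hoz⟩ := pzChart_strictTransform_order hL c₀ c₁ c₂ U h₀.ne_zero h₁.ne_zero h₂.ne_zero hU.ne_zero
  obtain ⟨ga, ha', hoa⟩ := paChart_strictTransform_order hL a ha h3 c₀ c₁ c₂ U h₀ h₁ h₂ hU
  obtain ⟨bz, ba, _⟩ := pointFreeLine_orders_le_two (K := K) (N := N) h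
  exact ⟨gz, ga, hz, ha', hoz ▸ bz, hoa ▸ ba⟩

end PBlowUp

/-! ## §7. The S-CHART bookkeeping (dictionary §4): the class form is STABLE under the `S′`-charts of every move, with exactly the game's
weight updates (`applyMove` / `blowup` of `Lines/toric_sgame.lean` §B)

The `S′`-charts are the charts of the blow-up containing the strict transform `S′` of `S = V(z, y)`: for the ACCEPT of `K = V(z,y,u)` the
`u`-chart `(z, y, u, v) = (u′z′, u′y′, u′, v)` (origin = the new node `K′ ∩ N`, `K′ = exc ∩ S′ = {u′ = 0}`); for the POINT blow-up of the node the
`u`-chart `(u z′, u y′, u, u v′)` (origin = the node `Γ ∩ N′` of the newborn curve `Γ = {u = 0} ⊂ S′` with the strict transform `N′ = {v′ = 0}` of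
`N`) and the `v`-chart `(v z′, v y′, v u′, v)` (origin = `K′ ∩ Γ`). THEOREMS (`sChart_transform_D`, `sChart_transform_A`, `puChart_transform`,
`pvChart_transform`): substituting these maps into `classForm K N c₀ c₁ c₂ U` gives `exc^α · classForm K* N* c′ U′` where `(K*, N*)` is EXACTLY
the pair of branches the game writes at that node — `accD K` / `accA K` (the bodies of `applyMove (.D k)` / `(.A k)`, `(.AL k)` on one curve) with
`N` unchanged, resp. `(newborn K N α, N)` and `(K, newborn K N α)` (the curve inserted by `blowup ch i α`) — and `c′, U′` are the substituted
units (constant terms unchanged). So the S-chart rows of the dictionary are kernel algebra; what S1 keeps by hand is only that these ARE the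
relevant charts of the blow-ups of `W` and that good points stay good (monomial × unit). -/

namespace W3
/-- verbatim `W3.add` of `Lines/toric_sgame.lean` §B: node order `o = w′ + w″` -/
def add (a b : W3) : W3 := ⟨wadd a.w0 b.w0, wadd a.w1 b.w1, wadd a.w2 b.w2⟩
/-- verbatim `W3.sub`: accept `w ↦ w − (d₀,d₁,d₂)` -/
def sub (w : W3) (d0 d1 d2 : ℕ) : W3 := ⟨w.w0.map (· - d0), w.w1.map (· - d1), w.w2.map (· - d2)⟩
end W3

/-- the body of `applyMove (.D k)` on the accepted curve: `w ↦ w − (3,2,1)`, `w₃` unchanged -/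
def accD (c : Curve) : Curve := { c with w := c.w.sub 3 2 1 }

/-- the body of `applyMove (.A k)` = `(.AL k)` on the accepted curve: `w ↦ w − (2,1,0)`, `w₃ ↦ w₃ + 1` -/
def accA (c : Curve) : Curve := { c with w := c.w.sub 2 1 0, w3 := c.w3 + 1 }

/-- the curve inserted by `blowup ch i α` at the node `(a, b)`: `w_b = o_b + b − α`, `w₃ = o₃ + 3 − α`, `bd = true` (verbatim body) -/
def newborn (a b : Curve) (α : ℕ) : Curve :=
  let o := a.w.add b.w
  ⟨⟨o.w0.map (· - α), o.w1.map (· + 1 - α), o.w2.map (· + 2 - α)⟩, a.w3 + b.w3 + 3 - α, true⟩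

/-! ### sanity (`decide`) -/
theorem accD_example : accD ⟨⟨some 3, some 2, some 1⟩, 0, true⟩ = ⟨⟨some 0, some 0, some 0⟩, 0, true⟩ := by decide
theorem accA_example : accA ⟨⟨some 2, some 1, some 0⟩, 0, true⟩ = ⟨⟨some 0, some 0, some 0⟩, 1, true⟩ := by decide
theorem newborn_top_example : newborn ⟨⟨some 3, some 2, some 1⟩, 0, true⟩ ⟨⟨some 0, some 0, some 0⟩, 0, true⟩ 3 =
    ⟨⟨some 0, some 0, some 0⟩, 0, true⟩ := by decide
theorem newborn_q2_example : newborn ⟨⟨some 2, some 2, some 1⟩, 0, true⟩ ⟨⟨some 0, some 0, some 0⟩, 1, true⟩ 2 =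
    ⟨⟨some 0, some 1, some 1⟩, 2, true⟩ := by decide

section SCharts
variable {R : Type*} [CommRing R]

/-- `S′`-chart of the accept of `K = V(z,y,u)`: `(z, y, u, v) ↦ (u′z′, u′y′, u′, v)`, coordinates `(z′, y′, u′, v) = (x₀, x₁, x₂, x₃)` -/
def sK (R : Type*) [CommRing R] : Fin 4 → MvPowerSeries (Fin 4) R := ![X 2 * X 0, X 2 * X 1, X 2, X 3]

/-- `u`-chart of the point blow-up of the node: `(z, y, u, v) ↦ (u z′, u y′, u, u v′)` -/
def pU (R : Type*) [CommRing R] : Fin 4 → MvPowerSeries (Fin 4) R := ![X 2 * X 0, X 2 * X 1, X 2, X 2 * X 3]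

/-- `v`-chart of the point blow-up of the node: `(z, y, u, v) ↦ (v z′, v y′, v u′, v)` -/
def pV (R : Type*) [CommRing R] : Fin 4 → MvPowerSeries (Fin 4) R := ![X 3 * X 0, X 3 * X 1, X 3 * X 2, X 3]

@[simp] theorem sK_0 : sK R 0 = X 2 * X 0 := rfl
@[simp] theorem sK_1 : sK R 1 = X 2 * X 1 := rfl
@[simp] theorem sK_2 : sK R 2 = X 2 := rfl
@[simp] theorem sK_3 : sK R 3 = X 3 := rfl
@[simp] theorem pU_0 : pU R 0 = X 2 * X 0 := rfl
@[simp] theorem pU_1 : pU R 1 = X 2 * X 1 := rfl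
@[simp] theorem pU_2 : pU R 2 = X 2 := rfl
@[simp] theorem pU_3 : pU R 3 = X 2 * X 3 := rfl
@[simp] theorem pV_0 : pV R 0 = X 3 * X 0 := rfl
@[simp] theorem pV_1 : pV R 1 = X 3 * X 1 := rfl
@[simp] theorem pV_2 : pV R 2 = X 3 * X 2 := rfl
@[simp] theorem pV_3 : pV R 3 = X 3 := rfl

theorem sK_const (s : Fin 4) : constantCoeff (sK R s) = 0 := by
  fin_cases s <;> simp [constantCoeff_X]

theorem pU_const (s : Fin 4) : constantCoeff (pU R s) = 0 := by
  fin_cases s <;> simp [constantCoeff_X]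

theorem pV_const (s : Fin 4) : constantCoeff (pV R s) = 0 := by
  fin_cases s <;> simp [constantCoeff_X]

theorem hasSubst_sK : HasSubst (sK R) := hasSubst_of_constantCoeff_zero sK_const
theorem hasSubst_pU : HasSubst (pU R) := hasSubst_of_constantCoeff_zero pU_const
theorem hasSubst_pV : HasSubst (pV R) := hasSubst_of_constantCoeff_zero pV_const

theorem Xpow_split' (i : Fin 4) {k α r : ℕ} (h : k = α + r) : (X i : MvPowerSeries (Fin 4) R) ^ k = X i ^ α * X i ^ r := by
  rw [h, pow_add]

/-- accept chart, class-`b` term: `c_b y^b u^m v^n ↦ u′^{b+m} y′^b v^n c_b′ = u′^α · (y′^b u′^{f m} v^n c_b′)` whenever `f m + α = b + m` -/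
theorem sK_clsTerm {α b : ℕ} {w e : Wt} {f : ℕ → ℕ} (hf : ∀ m, w = some m → f m + α = b + m) (c : MvPowerSeries (Fin 4) R) :
    subst (sK R) (oterm (clsUp b w e) c) = X 2 ^ α * oterm (clsUp b (w.map f) e) (subst (sK R) c : MvPowerSeries (Fin 4) R) := by
  rcases w with _ | m <;> rcases e with _ | n
  · simp [clsUp, subst_zero_of_hasSubst hasSubst_sK]
  · simp [clsUp, subst_zero_of_hasSubst hasSubst_sK]
  · simp [clsUp, subst_zero_of_hasSubst hasSubst_sK]
  · have hα := hf m rfl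
    simp only [clsUp, Option.map_some, oterm_some]
    rw [subst_mul hasSubst_sK, subst_monomial_ev hasSubst_sK, monomial_ev]
    simp only [sK_0, sK_1, sK_2, sK_3]
    calc _ = (X 2 : MvPowerSeries (Fin 4) R) ^ (b + m) * (X 1 ^ b * X 3 ^ n * subst (sK R) c) := by ring
      _ = _ := by rw [Xpow_split' 2 (show b + m = α + f m by omega)]; ring

/-- accept chart, cubic term: `U u^{w₃} v^{e₃}(z³ + y³) ↦ u′^{w₃+3} v^{e₃} U′ (z′³ + y′³) = u′^α · u′^{k} v^{e₃} U′ (z′³ + y′³)`, `k + α = w₃ + 3` -/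
theorem sK_cubic {α : ℕ} (K N : Curve) (k : ℕ) (hk : k + α = K.w3 + 3) (U : MvPowerSeries (Fin 4) R) :
    subst (sK R) (monomial (ev 0 0 K.w3 N.w3) (1 : R) * (U * (X 0 ^ 3 + X 1 ^ 3))) =
      X 2 ^ α * (monomial (ev 0 0 k N.w3) (1 : R) * (subst (sK R) U * (X 0 ^ 3 + X 1 ^ 3))) := by
  rw [subst_mul hasSubst_sK, subst_mul hasSubst_sK, subst_add hasSubst_sK, subst_pow hasSubst_sK, subst_pow hasSubst_sK,
    subst_X hasSubst_sK, subst_X hasSubst_sK, subst_monomial_ev hasSubst_sK, monomial_ev]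
  simp only [sK_0, sK_1, sK_2, sK_3]
  calc _ = (X 2 : MvPowerSeries (Fin 4) R) ^ (K.w3 + 3) * (X 3 ^ N.w3 * (subst (sK R) U * (X 0 ^ 3 + X 1 ^ 3))) := by ring
    _ = _ := by rw [Xpow_split' 2 (show K.w3 + 3 = α + k by omega)]; ring

/-- point `u`-chart, class-`b` term: `c_b y^b u^m v^n ↦ u^{b+m+n} y′^b v′^n c_b′ = u^α · (y′^b u^{g (m+n)} v′^n c_b′)`, `g (m+n) + α = b + m + n` -/
theorem pU_clsTerm {α b : ℕ} {w e : Wt} {g : ℕ → ℕ} (hg : ∀ m n, w = some m → e = some n → g (m + n) + α = b + m + n)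
    (c : MvPowerSeries (Fin 4) R) :
    subst (pU R) (oterm (clsUp b w e) c) = X 2 ^ α * oterm (clsUp b ((wadd w e).map g) e) (subst (pU R) c : MvPowerSeries (Fin 4) R) := by
  rcases w with _ | m <;> rcases e with _ | n
  · simp [clsUp, wadd, subst_zero_of_hasSubst hasSubst_pU]
  · simp [clsUp, wadd, subst_zero_of_hasSubst hasSubst_pU]
  · simp [clsUp, wadd, subst_zero_of_hasSubst hasSubst_pU]
  · have hα := hg m n rfl rfl
    simp only [clsUp, wadd, Option.map_some, oterm_some]
    rw [subst_mul hasSubst_pU, subst_monomial_ev hasSubst_pU, monomial_ev]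
    simp only [pU_0, pU_1, pU_2, pU_3]
    calc _ = (X 2 : MvPowerSeries (Fin 4) R) ^ (b + m + n) * (X 1 ^ b * X 3 ^ n * subst (pU R) c) := by ring
      _ = _ := by rw [Xpow_split' 2 (show b + m + n = α + g (m + n) by omega)]; ring

/-- point `u`-chart, cubic term: `↦ u^{o₃+3} v′^{e₃} U′ (z′³ + y′³) = u^α · u^{k} v′^{e₃} …`, `k + α = o₃ + 3` -/
theorem pU_cubic {α : ℕ} (K N : Curve) (k : ℕ) (hk : k + α = K.w3 + N.w3 + 3) (U : MvPowerSeries (Fin 4) R) :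
    subst (pU R) (monomial (ev 0 0 K.w3 N.w3) (1 : R) * (U * (X 0 ^ 3 + X 1 ^ 3))) =
      X 2 ^ α * (monomial (ev 0 0 k N.w3) (1 : R) * (subst (pU R) U * (X 0 ^ 3 + X 1 ^ 3))) := by
  rw [subst_mul hasSubst_pU, subst_mul hasSubst_pU, subst_add hasSubst_pU, subst_pow hasSubst_pU, subst_pow hasSubst_pU,
    subst_X hasSubst_pU, subst_X hasSubst_pU, subst_monomial_ev hasSubst_pU, monomial_ev]
  simp only [pU_0, pU_1, pU_2, pU_3]
  calc _ = (X 2 : MvPowerSeries (Fin 4) R) ^ (K.w3 + N.w3 + 3) * (X 3 ^ N.w3 * (subst (pU R) U * (X 0 ^ 3 + X 1 ^ 3))) := by ring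
    _ = _ := by rw [Xpow_split' 2 (show K.w3 + N.w3 + 3 = α + k by omega)]; ring

/-- point `v`-chart, class-`b` term: `c_b y^b u^m v^n ↦ v^{b+m+n} y′^b u′^m c_b′ = v^α · (y′^b u′^m v^{g (m+n)} c_b′)` -/
theorem pV_clsTerm {α b : ℕ} {w e : Wt} {g : ℕ → ℕ} (hg : ∀ m n, w = some m → e = some n → g (m + n) + α = b + m + n)
    (c : MvPowerSeries (Fin 4) R) :
    subst (pV R) (oterm (clsUp b w e) c) = X 3 ^ α * oterm (clsUp b w ((wadd w e).map g)) (subst (pV R) c : MvPowerSeries (Fin 4) R) := by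
  rcases w with _ | m <;> rcases e with _ | n
  · simp [clsUp, subst_zero_of_hasSubst hasSubst_pV]
  · simp [clsUp, subst_zero_of_hasSubst hasSubst_pV]
  · simp [clsUp, wadd, subst_zero_of_hasSubst hasSubst_pV]
  · have hα := hg m n rfl rfl
    simp only [clsUp, wadd, Option.map_some, oterm_some]
    rw [subst_mul hasSubst_pV, subst_monomial_ev hasSubst_pV, monomial_ev]
    simp only [pV_0, pV_1, pV_2, pV_3]
    calc _ = (X 3 : MvPowerSeries (Fin 4) R) ^ (b + m + n) * (X 1 ^ b * X 2 ^ m * subst (pV R) c) := by ring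
      _ = _ := by rw [Xpow_split' 3 (show b + m + n = α + g (m + n) by omega)]; ring

/-- point `v`-chart, cubic term -/
theorem pV_cubic {α : ℕ} (K N : Curve) (k : ℕ) (hk : k + α = K.w3 + N.w3 + 3) (U : MvPowerSeries (Fin 4) R) :
    subst (pV R) (monomial (ev 0 0 K.w3 N.w3) (1 : R) * (U * (X 0 ^ 3 + X 1 ^ 3))) =
      X 3 ^ α * (monomial (ev 0 0 K.w3 k) (1 : R) * (subst (pV R) U * (X 0 ^ 3 + X 1 ^ 3))) := by
  rw [subst_mul hasSubst_pV, subst_mul hasSubst_pV, subst_add hasSubst_pV, subst_pow hasSubst_pV, subst_pow hasSubst_pV,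
    subst_X hasSubst_pV, subst_X hasSubst_pV, subst_monomial_ev hasSubst_pV, monomial_ev]
  simp only [pV_0, pV_1, pV_2, pV_3]
  calc _ = (X 3 : MvPowerSeries (Fin 4) R) ^ (K.w3 + N.w3 + 3) * (X 2 ^ K.w3 * (subst (pV R) U * (X 0 ^ 3 + X 1 ^ 3))) := by ring
    _ = _ := by rw [Xpow_split' 3 (show K.w3 + N.w3 + 3 = α + k by omega)]; ring

/-- ★★ DEEP ACCEPT (`D`, `α = 3`) in the `S′`-chart: the total transform of the class form of `(K, N)` is `u′³ ·` the class form of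
`(accD K, N)` with the substituted units — the row «`w ↦ w − (3,2,1)`, `w₃` fixed» of the dictionary. -/
theorem sChart_transform_D {K N : Curve} (hL : Legal 3 K) (c₀ c₁ c₂ U : MvPowerSeries (Fin 4) R) :
    (subst (sK R) (classForm K N c₀ c₁ c₂ U) : MvPowerSeries (Fin 4) R) =
      X 2 ^ 3 * classForm (accD K) N (subst (sK R) c₀) (subst (sK R) c₁) (subst (sK R) c₂) (subst (sK R) U) := by
  simp only [classForm, accD, W3.sub]
  rw [subst_add hasSubst_sK, subst_add hasSubst_sK, subst_add hasSubst_sK,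
    sK_clsTerm (α := 3) (f := fun m => m - 3) (fun m hm => by have := hL.h0 m hm; omega) c₀,
    sK_clsTerm (α := 3) (f := fun m => m - 2) (fun m hm => by have := hL.h1 m hm; omega) c₁,
    sK_clsTerm (α := 3) (f := fun m => m - 1) (fun m hm => by have := hL.h2 m hm; omega) c₂,
    sK_cubic (α := 3) K N K.w3 (by omega) U]
  ring

/-- ★★ BORDERLINE / LIGHT ACCEPT (`A`, `AL`, `α = 2`) in the `S′`-chart: `u′² ·` the class form of `(accA K, N)` — the row «`w ↦ w − (2,1,0)`,
`w₃ ↦ w₃ + 1`». -/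
theorem sChart_transform_A {K N : Curve} (hL : Legal 2 K) (c₀ c₁ c₂ U : MvPowerSeries (Fin 4) R) :
    (subst (sK R) (classForm K N c₀ c₁ c₂ U) : MvPowerSeries (Fin 4) R) =
      X 2 ^ 2 * classForm (accA K) N (subst (sK R) c₀) (subst (sK R) c₁) (subst (sK R) c₂) (subst (sK R) U) := by
  simp only [classForm, accA, W3.sub]
  rw [subst_add hasSubst_sK, subst_add hasSubst_sK, subst_add hasSubst_sK,
    sK_clsTerm (α := 2) (f := fun m => m - 2) (fun m hm => by have := hL.h0 m hm; omega) c₀,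
    sK_clsTerm (α := 2) (f := fun m => m - 1) (fun m hm => by have := hL.h1 m hm; omega) c₁,
    sK_clsTerm (α := 2) (f := fun m => m - 0) (fun m hm => by have := hL.h2 m hm; omega) c₂,
    sK_cubic (α := 2) K N (K.w3 + 1) (by omega) U]
  ring

/-- ★★ POINT BLOW-UP (exponent `α`) in the `u`-chart: `u^α ·` the class form of `(newborn K N α, N)` — the `blowup` row «`w_b(Γ) = o_b + b − α`,
`w₃(Γ) = o₃ + 3 − α`», the partner `N` keeping its weights. -/
theorem puChart_transform {α : ℕ} {K N : Curve} (hL : LegalPt α K N) (c₀ c₁ c₂ U : MvPowerSeries (Fin 4) R) :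
    (subst (pU R) (classForm K N c₀ c₁ c₂ U) : MvPowerSeries (Fin 4) R) =
      X 2 ^ α * classForm (newborn K N α) N (subst (pU R) c₀) (subst (pU R) c₁) (subst (pU R) c₂) (subst (pU R) U) := by
  have h3 := hL.h3
  simp only [classForm, newborn, W3.add]
  rw [subst_add hasSubst_pU, subst_add hasSubst_pU, subst_add hasSubst_pU,
    pU_clsTerm (α := α) (g := fun x => x - α) (fun m n hm hn => by have := hL.h0 m n hm hn; omega) c₀,
    pU_clsTerm (α := α) (g := fun x => x + 1 - α) (fun m n hm hn => by have := hL.h1 m n hm hn; omega) c₁,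
    pU_clsTerm (α := α) (g := fun x => x + 2 - α) (fun m n hm hn => by have := hL.h2 m n hm hn; omega) c₂,
    pU_cubic (α := α) K N (K.w3 + N.w3 + 3 - α) (by omega) U]
  ring

/-- ★★ POINT BLOW-UP in the `v`-chart: `v^α ·` the class form of `(K, newborn K N α)`. -/
theorem pvChart_transform {α : ℕ} {K N : Curve} (hL : LegalPt α K N) (c₀ c₁ c₂ U : MvPowerSeries (Fin 4) R) :
    (subst (pV R) (classForm K N c₀ c₁ c₂ U) : MvPowerSeries (Fin 4) R) =
      X 3 ^ α * classForm K (newborn K N α) (subst (pV R) c₀) (subst (pV R) c₁) (subst (pV R) c₂) (subst (pV R) U) := by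
  have h3 := hL.h3
  simp only [classForm, newborn, W3.add]
  rw [subst_add hasSubst_pV, subst_add hasSubst_pV, subst_add hasSubst_pV,
    pV_clsTerm (α := α) (g := fun x => x - α) (fun m n hm hn => by have := hL.h0 m n hm hn; omega) c₀,
    pV_clsTerm (α := α) (g := fun x => x + 1 - α) (fun m n hm hn => by have := hL.h1 m n hm hn; omega) c₁,
    pV_clsTerm (α := α) (g := fun x => x + 2 - α) (fun m n hm hn => by have := hL.h2 m n hm hn; omega) c₂,
    pV_cubic (α := α) K N (K.w3 + N.w3 + 3 - α) (by omega) U]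
  ring

/-- units stay units in the `S′`-charts as well -/
theorem constantCoeff_subst_sK (f : MvPowerSeries (Fin 4) R) : constantCoeff (subst (sK R) f) = constantCoeff f :=
  constantCoeff_subst_of_zero sK_const f
theorem constantCoeff_subst_pU (f : MvPowerSeries (Fin 4) R) : constantCoeff (subst (pU R) f) = constantCoeff f :=
  constantCoeff_subst_of_zero pU_const f
theorem constantCoeff_subst_pV (f : MvPowerSeries (Fin 4) R) : constantCoeff (subst (pV R) f) = constantCoeff f :=
  constantCoeff_subst_of_zero pV_const f

end SCharts

/-! ## §8. The MULTIPLICITY ROWS of the dictionary (§3 there): the order of the controlled class form at the node `K ∩ N` — and, with the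
TRIVIAL PARTNER `triv`, at an interior good point of `K` — for ALL unit values; `TOP` / `DEEP` ⟺ `o ≥ (3,2,1)` (`isDeepW`), multiplicity
`≥ 2` / class `𝒞` ⟺ `o ≥ (2,1,0)` (`isCW`)

The class form `Σ_b c_b y^b u^{m_b} v^{n_b} + U u^{m₃} v^{n₃} (z³ + y³)` is a sum of FIVE optional terms with pairwise distinct exponents
(`(z,y)`-exponents `(0,b)`, `(3,0)`, `(0,3)`), so Lemma A gives its order EXACTLY, whatever the units: `min_b (b + o_b) ⊓ (3 + o₃)` over the
present classes, `o = w(K) + w(N)` (`nodeOrd`, `order_classForm`). Consequences: `3 ≤ mult ⟺ isDeepW (K.w.add N.w)` (= the `𝒟`-node case of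
`topN`; `three_le_order_classForm_iff`), `2 ≤ mult ⟺ (K.w.add N.w).ge 2 1 0` (`two_le_order_classForm_iff`); and since an interior good
point of `K` is the node of `K` with the trivial partner (`W3.add_triv`), the generic multiplicity along `K` is `nodeOrd K triv` with
`DEEP ⟺ isDeepW K.w`, class `𝒞 ⟺ isCW K.w` (`three_le_order_interior_iff`, `two_le_order_interior_iff`) — the rows «deep ↔ `isDeepW`»,
«𝒞 ↔ `isCW`», «TOP ↔ `topN` at `𝒟`-nodes» of the dictionary, for all unit values. (The `Sing₂(J) ↔ isSingW/sing2N` row is a statement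
about the weighted coefficient ideal `J`, not a multiplicity, and stays a definition.) -/

namespace W3
/-- verbatim `W3.ge` of `Lines/toric_sgame.lean` §B: componentwise `w ≥ (t₀,t₁,t₂)` -/
def ge (w : W3) (t0 t1 t2 : ℕ) : Bool := wge w.w0 t0 && wge w.w1 t1 && wge w.w2 t2
end W3

/-- verbatim: thresholds `θ = (3,2,1)` (TOP / DEEP), `(2,2,1)` (Sing₂), `(2,1,0)` (class 𝒞) -/
def isDeepW (w : W3) : Bool := w.ge 3 2 1
def isSingW (w : W3) : Bool := w.ge 2 2 1
def isCW (w : W3) : Bool := w.ge 2 1 0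

/-- the TRIVIAL PARTNER: all class weights `0`, no cubic weight — the node of `K` with `triv` is an interior good point of `K` -/
def triv : Curve := ⟨⟨some 0, some 0, some 0⟩, 0, true⟩

theorem W3.add_triv (w : W3) : W3.add w triv.w = w := by
  rcases w with ⟨_ | a, _ | b, _ | c⟩ <;> rfl

/-- the node order datum `min_b (b + o_b) ⊓ (3 + o₃)` over the present classes -/
def nodeOrd (K N : Curve) : Wt :=
  wmin (tord 0 0 (wadd K.w.w0 N.w.w0)) (wmin (tord 1 0 (wadd K.w.w1 N.w.w1)) (wmin (tord 2 0 (wadd K.w.w2 N.w.w2))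
    (some (3 + K.w3 + N.w3))))

/-! ### sanity (`decide`) -/
/-- the top node of the seed `K = (3,2,1; 0)`, `N = 0`: multiplicity datum `3` -/
theorem nodeOrd_top : nodeOrd ⟨⟨some 3, some 2, some 1⟩, 0, true⟩ triv = some 3 := by decide
/-- a light curve `(2,1,0)` generically: `2` -/
theorem nodeOrd_light : nodeOrd ⟨⟨some 2, some 1, some 0⟩, 0, true⟩ triv = some 2 := by decide
/-- two light curves meeting: `o = (4,2,0)`, node datum `min (4, 3, 2, 3) = 2` (not a top point: `o₂ = 0`) -/
theorem nodeOrd_two_light : nodeOrd ⟨⟨some 2, some 1, some 0⟩, 0, true⟩ ⟨⟨some 2, some 1, some 0⟩, 0, true⟩ = some 2 := by decide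
/-- absent classes do not constrain: `K = (none, none, 1)`, cubic weight `1`: datum `min (2+1, 3+1) = 3` -/
theorem nodeOrd_absent : nodeOrd ⟨⟨none, none, some 1⟩, 1, true⟩ triv = some 3 := by decide

/-- the five optional exponents of the class form: classes `b ↦ (0, b, m_b, n_b)`, the cubic split as `z³ ↦ (3, 0, m₃, n₃)`, `y³ ↦ (0, 3, m₃, n₃)` -/
def nodeExp (K N : Curve) : Fin 5 → Option (Fin 4 →₀ ℕ)
  | 0 => clsUp 0 K.w.w0 N.w.w0
  | 1 => clsUp 1 K.w.w1 N.w.w1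
  | 2 => clsUp 2 K.w.w2 N.w.w2
  | 3 => some (ev 3 0 K.w3 N.w3)
  | 4 => some (ev 0 3 K.w3 N.w3)

/-- the tags `d 1 + 2·d 0` of the five terms: `0, 1, 2, 6, 3` — pairwise distinct -/
def nodeTag : Fin 5 → ℕ := ![0, 1, 2, 6, 3]

theorem nodeTag_injective : Function.Injective nodeTag := by decide

@[simp] theorem ev_apply_one (n₀ n₁ n₂ n₃ : ℕ) : ev n₀ n₁ n₂ n₃ 1 = n₁ := by simp [ev]

theorem clsUp_tag {b : ℕ} {w e : Wt} {d : Fin 4 →₀ ℕ} (h : clsUp b w e = some d) : d 1 + 2 * d 0 = b := by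
  rcases w with _ | m <;> rcases e with _ | n
  · exact absurd h (by simp [clsUp])
  · exact absurd h (by simp [clsUp])
  · exact absurd h (by simp [clsUp])
  · have hd : d = ev 0 b m n := by simpa [clsUp] using h.symm
    subst hd
    simp

theorem nodeExp_tag (K N : Curve) (i : Fin 5) (d : Fin 4 →₀ ℕ) (h : nodeExp K N i = some d) : d 1 + 2 * d 0 = nodeTag i := by
  fin_cases i
  · simpa [nodeTag] using clsUp_tag h
  · simpa [nodeTag] using clsUp_tag h
  · simpa [nodeTag] using clsUp_tag h
  · have hd : d = ev 3 0 K.w3 N.w3 := (Option.some.inj h).symm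
    subst hd; simp [nodeTag]
  · have hd : d = ev 0 3 K.w3 N.w3 := (Option.some.inj h).symm
    subst hd; simp [nodeTag]

theorem nodeExp_inj (K N : Curve) :
    ∀ i ∈ (Finset.univ : Finset (Fin 5)), ∀ j ∈ (Finset.univ : Finset (Fin 5)), ∀ d, nodeExp K N i = some d → nodeExp K N j = some d →
      i = j := by
  intro i _ j _ d hi hj
  exact nodeTag_injective ((nodeExp_tag K N i d hi).symm.trans (nodeExp_tag K N j d hj))

theorem inf_univ_fin5 (f : Fin 5 → ℕ∞) : (Finset.univ : Finset (Fin 5)).inf f = f 0 ⊓ (f 1 ⊓ (f 2 ⊓ (f 3 ⊓ f 4))) := by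
  have : (Finset.univ : Finset (Fin 5)) = {0, 1, 2, 3, 4} := by decide
  rw [this]
  simp only [Finset.inf_insert, Finset.inf_singleton]

/-- degree of a present class-`b` exponent at the node: `b + o_b` -/
theorem odeg_clsUp (b : ℕ) (w e : Wt) : odeg (clsUp b w e) = toE (tord b 0 (wadd w e)) := by
  rcases w with _ | m <;> rcases e with _ | n
  · rfl
  · rfl
  · rfl
  · simp only [clsUp, odeg_some, degree_ev, wadd, tord, Option.map_some, toE_some, Nat.cast_inj]
    omega

section NodeOrder
variable {R : Type*} [CommRing R]

/-- the unit coefficients of the five terms -/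
def nodeCoef (c₀ c₁ c₂ U : MvPowerSeries (Fin 4) R) : Fin 5 → MvPowerSeries (Fin 4) R := ![c₀, c₁, c₂, U, U]

theorem classForm_eq_sum (K N : Curve) (c₀ c₁ c₂ U : MvPowerSeries (Fin 4) R) :
    classForm K N c₀ c₁ c₂ U = ∑ i, oterm (nodeExp K N i) (nodeCoef c₀ c₁ c₂ U i) := by
  rw [Fin.sum_univ_five]
  simp only [nodeExp, nodeCoef, classForm, oterm_some, monomial_ev]
  simp only [Matrix.cons_val_zero, Matrix.cons_val_one, Matrix.cons_val]
  ring

/-- ★★ THE MULTIPLICITY AT THE NODE, ALL UNIT VALUES: `ord (classForm K N c U) = min_b (b + o_b) ⊓ (3 + o₃)` (present classes). -/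
theorem order_classForm (K N : Curve) (c₀ c₁ c₂ U : MvPowerSeries (Fin 4) R) (h₀ : constantCoeff c₀ ≠ 0) (h₁ : constantCoeff c₁ ≠ 0)
    (h₂ : constantCoeff c₂ ≠ 0) (hU : constantCoeff U ≠ 0) : (classForm K N c₀ c₁ c₂ U).order = toE (nodeOrd K N) := by
  have hu : ∀ i ∈ (Finset.univ : Finset (Fin 5)), ∀ d, nodeExp K N i = some d → constantCoeff (nodeCoef c₀ c₁ c₂ U i) ≠ 0 := by
    intro i _ _ _
    fin_cases i <;> simpa [nodeCoef] using by first | exact h₀ | exact h₁ | exact h₂ | exact hU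
  rw [classForm_eq_sum, order_sum_oterm _ _ _ (nodeExp_inj K N) hu, inf_univ_fin5]
  simp only [nodeExp, nodeOrd, toE_wmin, odeg_clsUp, odeg_some, degree_ev, toE_some, add_zero, zero_add]
  simp only [inf_idem]

theorem le_toE_tord_iff (t k : ℕ) (d : Wt) : (t : ℕ∞) ≤ toE (tord k 0 d) ↔ ∀ m, d = some m → t ≤ k + m := by
  rcases d with _ | m
  · simp [tord]
  · simp only [tord, Option.map_some, toE_some, Nat.cast_le, Option.some.injEq, forall_eq']
    omega

theorem wge_iff (d : Wt) (t : ℕ) : wge d t = true ↔ ∀ m, d = some m → t ≤ m := by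
  rcases d with _ | m
  · simp [wge]
  · simp only [wge, Option.some.injEq, forall_eq']
    exact ⟨fun h => Nat.le_of_ble_eq_true h, fun h => Nat.ble_eq_true_of_le h⟩

theorem three_le_toE_nodeOrd_iff (K N : Curve) : (3 : ℕ∞) ≤ toE (nodeOrd K N) ↔ isDeepW (W3.add K.w N.w) = true := by
  simp only [nodeOrd, toE_wmin, le_inf_iff, isDeepW, W3.ge, W3.add, Bool.and_eq_true]
  rw [show (3 : ℕ∞) = ((3 : ℕ) : ℕ∞) from rfl, le_toE_tord_iff, le_toE_tord_iff, le_toE_tord_iff, wge_iff, wge_iff, wge_iff, toE_some,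
    Nat.cast_le]
  constructor
  · rintro ⟨h0, h1, h2, -⟩
    exact ⟨⟨fun m hm => by have := h0 m hm; omega, fun m hm => by have := h1 m hm; omega⟩, fun m hm => by have := h2 m hm; omega⟩
  · rintro ⟨⟨h0, h1⟩, h2⟩
    exact ⟨fun m hm => by have := h0 m hm; omega, fun m hm => by have := h1 m hm; omega, fun m hm => by have := h2 m hm; omega,
      by omega⟩

theorem two_le_toE_nodeOrd_iff (K N : Curve) : (2 : ℕ∞) ≤ toE (nodeOrd K N) ↔ (W3.add K.w N.w).ge 2 1 0 = true := by
  simp only [nodeOrd, toE_wmin, le_inf_iff, W3.ge, W3.add, Bool.and_eq_true]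
  rw [show (2 : ℕ∞) = ((2 : ℕ) : ℕ∞) from rfl, le_toE_tord_iff, le_toE_tord_iff, le_toE_tord_iff, wge_iff, wge_iff, wge_iff, toE_some,
    Nat.cast_le]
  constructor
  · rintro ⟨h0, h1, h2, -⟩
    exact ⟨⟨fun m hm => by have := h0 m hm; omega, fun m hm => by have := h1 m hm; omega⟩, fun m hm => by have := h2 m hm; omega⟩
  · rintro ⟨⟨h0, h1⟩, h2⟩
    exact ⟨fun m hm => by have := h0 m hm; omega, fun m hm => by have := h1 m hm; omega, fun m hm => by have := h2 m hm; omega,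
      by omega⟩

/-- the Bennett row: multiplicity `≥ 4` at the node ⟺ `o ≥ (4,3,2)` and `o₃ ≥ 1` -/
theorem four_le_toE_nodeOrd_iff (K N : Curve) :
    (4 : ℕ∞) ≤ toE (nodeOrd K N) ↔ (W3.add K.w N.w).ge 4 3 2 = true ∧ 1 ≤ K.w3 + N.w3 := by
  simp only [nodeOrd, toE_wmin, le_inf_iff, W3.ge, W3.add, Bool.and_eq_true]
  rw [show (4 : ℕ∞) = ((4 : ℕ) : ℕ∞) from rfl, le_toE_tord_iff, le_toE_tord_iff, le_toE_tord_iff, wge_iff, wge_iff, wge_iff, toE_some,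
    Nat.cast_le]
  constructor
  · rintro ⟨h0, h1, h2, h3⟩
    exact ⟨⟨⟨fun m hm => by have := h0 m hm; omega, fun m hm => by have := h1 m hm; omega⟩, fun m hm => by have := h2 m hm; omega⟩,
      by omega⟩
  · rintro ⟨⟨⟨h0, h1⟩, h2⟩, h3⟩
    exact ⟨fun m hm => by have := h0 m hm; omega, fun m hm => by have := h1 m hm; omega, fun m hm => by have := h2 m hm; omega,
      by omega⟩

/-- ★★ TOP ⟺ `o ≥ (3,2,1)`: the class form has multiplicity `≥ 3` (hence `= 3`, the cubic term having order `3 + o₃ ≥ 3`… it has order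
EXACTLY `≤ 3 + o₃`; `= 3` when `o₃ = 0`) at the node iff `isDeepW (K.w.add N.w)` — the `𝒟`-node case of the game's `topN`, for all units. -/
theorem three_le_order_classForm_iff (K N : Curve) (c₀ c₁ c₂ U : MvPowerSeries (Fin 4) R) (h₀ : constantCoeff c₀ ≠ 0)
    (h₁ : constantCoeff c₁ ≠ 0) (h₂ : constantCoeff c₂ ≠ 0) (hU : constantCoeff U ≠ 0) :
    (3 : ℕ∞) ≤ (classForm K N c₀ c₁ c₂ U).order ↔ isDeepW (W3.add K.w N.w) = true := by
  rw [order_classForm K N c₀ c₁ c₂ U h₀ h₁ h₂ hU, three_le_toE_nodeOrd_iff]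

/-- ★★ multiplicity `≥ 2` at the node ⟺ `o ≥ (2,1,0)`, for all units. -/
theorem two_le_order_classForm_iff (K N : Curve) (c₀ c₁ c₂ U : MvPowerSeries (Fin 4) R) (h₀ : constantCoeff c₀ ≠ 0)
    (h₁ : constantCoeff c₁ ≠ 0) (h₂ : constantCoeff c₂ ≠ 0) (hU : constantCoeff U ≠ 0) :
    (2 : ℕ∞) ≤ (classForm K N c₀ c₁ c₂ U).order ↔ (W3.add K.w N.w).ge 2 1 0 = true := by
  rw [order_classForm K N c₀ c₁ c₂ U h₀ h₁ h₂ hU, two_le_toE_nodeOrd_iff]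

/-- ★★ the Bennett row of the dictionary: multiplicity `≥ 4` at the node ⟺ `o ≥ (4,3,2) ∧ o₃ ≥ 1`, for all units (the game's `stateFlags`
last entry counts exactly these nodes; CENSUS 0). -/
theorem four_le_order_classForm_iff (K N : Curve) (c₀ c₁ c₂ U : MvPowerSeries (Fin 4) R) (h₀ : constantCoeff c₀ ≠ 0)
    (h₁ : constantCoeff c₁ ≠ 0) (h₂ : constantCoeff c₂ ≠ 0) (hU : constantCoeff U ≠ 0) :
    (4 : ℕ∞) ≤ (classForm K N c₀ c₁ c₂ U).order ↔ (W3.add K.w N.w).ge 4 3 2 = true ∧ 1 ≤ K.w3 + N.w3 := by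
  rw [order_classForm K N c₀ c₁ c₂ U h₀ h₁ h₂ hU, four_le_toE_nodeOrd_iff]

/-- ★★ along the curve (interior good point = node with the trivial partner): DEEP ⟺ `isDeepW K.w` … -/
theorem three_le_order_interior_iff (K : Curve) (c₀ c₁ c₂ U : MvPowerSeries (Fin 4) R) (h₀ : constantCoeff c₀ ≠ 0)
    (h₁ : constantCoeff c₁ ≠ 0) (h₂ : constantCoeff c₂ ≠ 0) (hU : constantCoeff U ≠ 0) :
    (3 : ℕ∞) ≤ (classForm K triv c₀ c₁ c₂ U).order ↔ isDeepW K.w = true := by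
  rw [three_le_order_classForm_iff K triv c₀ c₁ c₂ U h₀ h₁ h₂ hU, W3.add_triv]

/-- … and class `𝒞` (multiplicity `2` along `K`, given not deep) ⟺ `isCW K.w`. -/
theorem two_le_order_interior_iff (K : Curve) (c₀ c₁ c₂ U : MvPowerSeries (Fin 4) R) (h₀ : constantCoeff c₀ ≠ 0)
    (h₁ : constantCoeff c₁ ≠ 0) (h₂ : constantCoeff c₂ ≠ 0) (hU : constantCoeff U ≠ 0) :
    (2 : ℕ∞) ≤ (classForm K triv c₀ c₁ c₂ U).order ↔ isCW K.w = true := by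
  rw [two_le_order_classForm_iff K triv c₀ c₁ c₂ U h₀ h₁ h₂ hU, W3.add_triv, isCW]

/-- the interior form is literally the class form without `v`: `Σ_b c_b y^b u^{m_b} + U u^{m₃}(z³ + y³)` -/
theorem classForm_triv (K : Curve) (c₀ c₁ c₂ U : MvPowerSeries (Fin 4) R) :
    classForm K triv c₀ c₁ c₂ U =
      oterm (K.w.w0.map fun m => ev 0 0 m 0) c₀ + oterm (K.w.w1.map fun m => ev 0 1 m 0) c₁ + oterm (K.w.w2.map fun m => ev 0 2 m 0) c₂ +
        monomial (ev 0 0 K.w3 0) 1 * (U * (X 0 ^ 3 + X 1 ^ 3)) := by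
  rcases K with ⟨⟨_ | m0, _ | m1, _ | m2⟩, w3, bd⟩ <;> simp [classForm, triv, clsUp]

end NodeOrder

end


/-! ## §9  NEAR POINTS OFF S′ — the cube dichotomy (rev 5)

Where can a point of multiplicity 3 of the strict transform lie on the exceptional divisor of a move?
The centre `D` of a legal move through top points is permissible (a deep curve is equimultiple of
multiplicity 3 — no node has multiplicity 4, by `top_noCubic_*` and the Bennett row
`four_le_order_classForm_iff` —, a top node is a point), so by the theorem of Hironaka–Mizutani
(Cossart–Jannsen–Saito, *Desingularization: Invariants and Strategy*, LNM 2270 (2020), Thm 2.14;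
`char k(x) = 0` or `≥ dim X / 2 + 1`, i.e. `p ≥ 3` for our threefold hypersurface germs; for a
hypersurface the statement is elementary) every point `x′` over `x ∈ D` NEAR to `x` (multiplicity 3
again) lies in `ℙ(Dir_x X / T_x D)`: its direction `w = (a, b, c, d)` in the coordinates `(z, y, u, v)`
is a TRANSLATION DIRECTION of the initial form `in_x f`, which at a top point of the class form is the
cubic `cubeF` below (tight classes with their unit constants, plus `U(0)(z³ + y³)` since top points
carry no cubic weight). This section decides, for ALL weights and ALL constants, which cubics of that
shape have a translation direction off S′ (`(a, b) ≠ (0, 0)`): exactly the single-branch tight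
cubes `U(0)(z³ + (y + λu)³)` (resp. `λv`), i.e. the node `(3,2,1) + (0,0,0)` with the CUBE RELATION
`3U(0)c₁(0) = c₂(0)²`, `27U(0)²c₀(0) = c₂(0)³` — the exception recorded in S6 (i) for the deep
accept of `w = (3,2,1)`, now for every move. Consequently, under the standing generic hypothesis
(C³) on the four constants of `f` (preserved by every chart, `constantCoeff_subst_*`), no point of
multiplicity 3 of any transform in a legal play lies off S′ (char `∉ {2, 3}`); `cubeF_char2_mixed`
shows that characteristic 2 is genuinely different. Labelled: de-risking scaffolding, counted 0. -/


section NearPoints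

variable {k : Type*} [Field k]

/-- The degree-3 INITIAL FORM of the class form at a top point, as a polynomial function of
`(z, y, u, v)`: `Υ (z³ + y³) + γ₂ y² M₂ + γ₁ y M₁ + γ₀ M₀` with `M_b = u ^ i_b * v ^ j_b`,
`i_b + j_b = 3 - b` (the TIGHT classes, `b + o_b = 3`, carry `γ_b = c_b(0)`; a class that is not
tight is encoded by `γ_b = 0`; `Υ = U(0)`, present because top points carry no cubic weight). -/
def cubeF (Υ γ₀ γ₁ γ₂ : k) (i₀ j₀ i₁ j₁ i₂ j₂ : ℕ) (z y u v : k) : k :=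
  Υ * (z ^ 3 + y ^ 3) + γ₂ * y ^ 2 * (u ^ i₂ * v ^ j₂) + γ₁ * y * (u ^ i₁ * v ^ j₁)
    + γ₀ * (u ^ i₀ * v ^ j₀)

theorem cubeF_swap (Υ γ₀ γ₁ γ₂ : k) (i₀ j₀ i₁ j₁ i₂ j₂ : ℕ) (z y u v : k) :
    cubeF Υ γ₀ γ₁ γ₂ j₀ i₀ j₁ i₁ j₂ i₂ z y u v = cubeF Υ γ₀ γ₁ γ₂ i₀ j₀ i₁ j₁ i₂ j₂ z y v u := by
  unfold cubeF; ring

/-- The CUBE RELATION along the branch whose coordinate is shifted by `c`: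
`F = Υ (z³ + (y + λ·branch)³)` with `λ = -b/c`, written without division. -/
def CubeRel (Υ γ₀ γ₁ γ₂ b c : k) : Prop :=
  c ≠ 0 ∧ γ₂ * c = -(3 * Υ * b) ∧ γ₁ * c ^ 2 = 3 * Υ * b ^ 2 ∧ γ₀ * c ^ 3 = -(Υ * b ^ 3)

private theorem zpm {i j : ℕ} (h : 0 < i + j) : (0 : k) ^ i * 0 ^ j = 0 := by
  rcases i with _ | i
  · have hj : j ≠ 0 := by omega
    simp [zero_pow hj]
  · simp

/-- Step A: a translation direction of the initial form has no `z`-component. -/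
theorem cubeF_dir_z (hk2 : (2 : k) ≠ 0) (hk3 : (3 : k) ≠ 0) {Υ : k} (hΥ : Υ ≠ 0)
    (γ₀ γ₁ γ₂ : k) (i₀ j₀ i₁ j₁ i₂ j₂ : ℕ) {a b c d : k}
    (H : ∀ z y u v : k, cubeF Υ γ₀ γ₁ γ₂ i₀ j₀ i₁ j₁ i₂ j₂ (z + a) (y + b) (u + c) (v + d)
        = cubeF Υ γ₀ γ₁ γ₂ i₀ j₀ i₁ j₁ i₂ j₂ z y u v) : a = 0 := by
  have e1 := H 0 0 0 0
  have e2 := H a 0 0 0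
  simp only [cubeF] at e1 e2
  have h6 : (6 * Υ) * a ^ 3 = 0 := by linear_combination e2 - e1
  have hk6 : (6 : k) ≠ 0 := by
    rw [show (6 : k) = 2 * 3 by norm_num]; exact mul_ne_zero hk2 hk3
  rcases mul_eq_zero.1 h6 with h | h
  · exact absurd h (mul_ne_zero hk6 hΥ)
  · exact pow_eq_zero_iff (by norm_num) |>.1 h

/-- Step B, the half `M₂ = u` (`i₂ = 1, j₂ = 0`): a translation direction with `a = 0` and
`b ≠ 0` forces the single-branch tight pattern `M₁ = u², M₀ = u³` and the cube relation. -/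
theorem cubeF_dir_aux (hk2 : (2 : k) ≠ 0) (hk3 : (3 : k) ≠ 0) {Υ : k} (hΥ : Υ ≠ 0)
    (γ₀ γ₁ γ₂ : k) {i₀ j₀ i₁ j₁ : ℕ} (h0 : i₀ + j₀ = 3) (h1 : i₁ + j₁ = 2) {b c d : k}
    (hb : b ≠ 0)
    (H : ∀ z y u v : k, cubeF Υ γ₀ γ₁ γ₂ i₀ j₀ i₁ j₁ 1 0 (z + 0) (y + b) (u + c) (v + d)
        = cubeF Υ γ₀ γ₁ γ₂ i₀ j₀ i₁ j₁ 1 0 z y u v) :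
    j₁ = 0 ∧ j₀ = 0 ∧ CubeRel Υ γ₀ γ₁ γ₂ b c := by
  have h3Υ : 3 * Υ ≠ 0 := mul_ne_zero hk3 hΥ
  have Z0 : (0 : k) ^ i₀ * 0 ^ j₀ = 0 := zpm (by omega)
  have Z1 : (0 : k) ^ i₁ * 0 ^ j₁ = 0 := zpm (by omega)
  -- the three scalar relations (R) from the points y ∈ {0, 1, -1}, z = u = v = 0
  have e0 := H 0 0 0 0
  have ep := H 0 1 0 0
  have em := H 0 (-1) 0 0
  simp only [cubeF, Z0, Z1] at e0 ep em
  have r2' : 2 * (γ₂ * c + 3 * Υ * b) = 0 := by linear_combination ep + em - 2 * e0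
  have r2 : γ₂ * c = -(3 * Υ * b) := by
    have := (mul_eq_zero.1 r2').resolve_left hk2
    linear_combination this
  have r1' : 2 * (γ₁ * (c ^ i₁ * d ^ j₁) - 3 * Υ * b ^ 2) = 0 := by
    linear_combination ep - em - 4 * b * r2
  have r1 : γ₁ * (c ^ i₁ * d ^ j₁) = 3 * Υ * b ^ 2 := by
    have := (mul_eq_zero.1 r1').resolve_left hk2
    linear_combination this
  have r0 : γ₀ * (c ^ i₀ * d ^ j₀) = -(Υ * b ^ 3) := by
    linear_combination e0 - b ^ 2 * r2 - b * r1
  -- non-vanishing consequences of b ≠ 0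
  have hγ₂ : γ₂ ≠ 0 := by
    rintro rfl
    have : 3 * Υ * b = 0 := by linear_combination r2
    exact (mul_ne_zero h3Υ hb) this
  have hc : c ≠ 0 := by
    rintro rfl
    have : 3 * Υ * b = 0 := by linear_combination r2
    exact (mul_ne_zero h3Υ hb) this
  have hγ₁ : γ₁ ≠ 0 := by
    rintro rfl
    have : 3 * Υ * b ^ 2 = 0 := by linear_combination -r1
    exact (mul_ne_zero h3Υ (pow_ne_zero 2 hb)) this
  have hγ₀ : γ₀ ≠ 0 := by
    rintro rfl
    have : Υ * b ^ 3 = 0 := by linear_combination r0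
    exact (mul_ne_zero hΥ (pow_ne_zero 3 hb)) this
  -- pattern: case analysis on the class-1 and class-0 monomials
  have hi1 : i₁ ≤ 2 := by omega
  interval_cases i₁
  · -- M₁ = v² : the yu-coefficient 2bγ₂ must vanish
    obtain rfl : j₁ = 2 := by omega
    have q11 := H 0 1 1 0
    have q10 := H 0 1 0 0
    have q01 := H 0 0 1 0
    have q00 := H 0 0 0 0
    simp only [cubeF] at q11 q10 q01 q00
    have : 2 * b * γ₂ = 0 := by linear_combination q11 - q10 - q01 + q00
    exact absurd this (mul_ne_zero (mul_ne_zero hk2 hb) hγ₂)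
  · -- M₁ = uv : the yv-coefficient cγ₁ must vanish
    obtain rfl : j₁ = 1 := by omega
    have q11 := H 0 1 0 1
    have q10 := H 0 1 0 0
    have q01 := H 0 0 0 1
    have q00 := H 0 0 0 0
    simp only [cubeF] at q11 q10 q01 q00
    have : c * γ₁ = 0 := by linear_combination q11 - q10 - q01 + q00
    exact absurd this (mul_ne_zero hc hγ₁)
  · -- M₁ = u² : now the class-0 monomial
    obtain rfl : j₁ = 0 := by omega
    have hi0 : i₀ ≤ 3 := by omega
    interval_cases i₀
    · -- M₀ = v³ : the u²-coefficient bγ₁ must vanish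
      obtain rfl : j₀ = 3 := by omega
      have p2 := H 0 0 2 0
      have p1 := H 0 0 1 0
      have p0 := H 0 0 0 0
      simp only [cubeF] at p2 p1 p0
      have : 2 * b * γ₁ = 0 := by linear_combination p2 - 2 * p1 + p0
      exact absurd this (mul_ne_zero (mul_ne_zero hk2 hb) hγ₁)
    · -- M₀ = uv² : the u²-coefficient bγ₁ must vanish
      obtain rfl : j₀ = 2 := by omega
      have p2 := H 0 0 2 0
      have p1 := H 0 0 1 0
      have p0 := H 0 0 0 0
      simp only [cubeF] at p2 p1 p0
      have : 2 * b * γ₁ = 0 := by linear_combination p2 - 2 * p1 + p0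
      exact absurd this (mul_ne_zero (mul_ne_zero hk2 hb) hγ₁)
    · -- M₀ = u²v : the uv-coefficient 2cγ₀ must vanish
      obtain rfl : j₀ = 1 := by omega
      have q11 := H 0 0 1 1
      have q10 := H 0 0 1 0
      have q01 := H 0 0 0 1
      have q00 := H 0 0 0 0
      simp only [cubeF] at q11 q10 q01 q00
      have : 2 * c * γ₀ = 0 := by linear_combination q11 - q10 - q01 + q00
      exact absurd this (mul_ne_zero (mul_ne_zero hk2 hc) hγ₀)
    · -- M₀ = u³ : the cube
      obtain rfl : j₀ = 0 := by omega
      refine ⟨rfl, rfl, hc, r2, ?_, ?_⟩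
      · simpa using r1
      · simpa using r0

/-- NEAR POINTS OFF S′ — THE CUBE DICHOTOMY (char `k ∉ {2, 3}`). If the degree-3 initial form of
the class form at a top point is invariant under the translation by `w = (a, b, c, d)` (i.e. `w`
lies in the DIRECTRIX of the tangent cone; by Hironaka–Mizutani, CJS 2020 Thm 2.14, every point of
the blow-up NEAR to the centre — same multiplicity 3 — lies in `ℙ(Dir / T(centre))`), then
`a = 0`, and either `b = 0` (the direction lies on S′) or all three classes are tight ON ONE
BRANCH (`M₂, M₁, M₀ = u, u², u³`, resp. `v, v², v³`) and the unit constants satisfy the CUBE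
RELATION, i.e. the initial form is `Υ (z³ + (y + λu)³)` (resp. with `v`). -/
theorem cubeF_dir (hk2 : (2 : k) ≠ 0) (hk3 : (3 : k) ≠ 0) {Υ : k} (hΥ : Υ ≠ 0)
    (γ₀ γ₁ γ₂ : k) {i₀ j₀ i₁ j₁ i₂ j₂ : ℕ} (h0 : i₀ + j₀ = 3) (h1 : i₁ + j₁ = 2)
    (h2 : i₂ + j₂ = 1) {a b c d : k}
    (H : ∀ z y u v : k, cubeF Υ γ₀ γ₁ γ₂ i₀ j₀ i₁ j₁ i₂ j₂ (z + a) (y + b) (u + c) (v + d)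
        = cubeF Υ γ₀ γ₁ γ₂ i₀ j₀ i₁ j₁ i₂ j₂ z y u v) :
    a = 0 ∧ (b = 0 ∨ (j₂ = 0 ∧ j₁ = 0 ∧ j₀ = 0 ∧ CubeRel Υ γ₀ γ₁ γ₂ b c)
                 ∨ (i₂ = 0 ∧ i₁ = 0 ∧ i₀ = 0 ∧ CubeRel Υ γ₀ γ₁ γ₂ b d)) := by
  obtain rfl : a = 0 := cubeF_dir_z hk2 hk3 hΥ γ₀ γ₁ γ₂ i₀ j₀ i₁ j₁ i₂ j₂ H
  refine ⟨rfl, ?_⟩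
  by_cases hb : b = 0
  · exact Or.inl hb
  right
  have hi2 : i₂ ≤ 1 := by omega
  interval_cases i₂
  · -- M₂ = v : swap the two branches and use the `M₂ = u` half
    obtain rfl : j₂ = 1 := by omega
    right
    have H' : ∀ z y u v : k, cubeF Υ γ₀ γ₁ γ₂ j₀ i₀ j₁ i₁ 1 0 (z + 0) (y + b) (u + d) (v + c)
        = cubeF Υ γ₀ γ₁ γ₂ j₀ i₀ j₁ i₁ 1 0 z y u v := by
      intro z y u v
      rw [cubeF_swap Υ γ₀ γ₁ γ₂ i₀ j₀ i₁ j₁ 0 1 (z + 0) (y + b) (u + d) (v + c),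
        cubeF_swap Υ γ₀ γ₁ γ₂ i₀ j₀ i₁ j₁ 0 1 z y u v]
      exact H z y v u
    obtain ⟨h1', h0', hrel⟩ :=
      cubeF_dir_aux hk2 hk3 hΥ γ₀ γ₁ γ₂ (by omega) (by omega) hb H'
    exact ⟨rfl, h1', h0', hrel⟩
  · obtain rfl : j₂ = 0 := by omega
    left
    obtain ⟨h1', h0', hrel⟩ := cubeF_dir_aux hk2 hk3 hΥ γ₀ γ₁ γ₂ h0 h1 hb H
    exact ⟨rfl, h1', h0', hrel⟩

/-- Off-S′ form: a directrix direction off S′ (`(a, b) ≠ (0, 0)`) exists only in the cube case. -/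
theorem cubeF_dir_offS (hk2 : (2 : k) ≠ 0) (hk3 : (3 : k) ≠ 0) {Υ : k} (hΥ : Υ ≠ 0)
    (γ₀ γ₁ γ₂ : k) {i₀ j₀ i₁ j₁ i₂ j₂ : ℕ} (h0 : i₀ + j₀ = 3) (h1 : i₁ + j₁ = 2)
    (h2 : i₂ + j₂ = 1) {a b c d : k} (hoff : a ≠ 0 ∨ b ≠ 0)
    (H : ∀ z y u v : k, cubeF Υ γ₀ γ₁ γ₂ i₀ j₀ i₁ j₁ i₂ j₂ (z + a) (y + b) (u + c) (v + d)
        = cubeF Υ γ₀ γ₁ γ₂ i₀ j₀ i₁ j₁ i₂ j₂ z y u v) :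
    a = 0 ∧ b ≠ 0 ∧ ((j₂ = 0 ∧ j₁ = 0 ∧ j₀ = 0 ∧ CubeRel Υ γ₀ γ₁ γ₂ b c)
                 ∨ (i₂ = 0 ∧ i₁ = 0 ∧ i₀ = 0 ∧ CubeRel Υ γ₀ γ₁ γ₂ b d)) := by
  obtain ⟨ha, h⟩ := cubeF_dir hk2 hk3 hΥ γ₀ γ₁ γ₂ h0 h1 h2 H
  have hb : b ≠ 0 := by
    rcases hoff with ha' | hb'
    · exact absurd ha ha'
    · exact hb'
  exact ⟨ha, hb, h.resolve_left hb⟩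

/-- The cube relation pins the unit constants to the closed condition
`3 Υ γ₁ = γ₂²` and `27 Υ² γ₀ = γ₂³` — independent of the direction. Its negation is the standing
hypothesis (C³) on the constants `(c₀(0), c₁(0), c₂(0), U(0))` of `f`, preserved by every chart. -/
theorem CubeRel.constants {Υ γ₀ γ₁ γ₂ b c : k} (h : CubeRel Υ γ₀ γ₁ γ₂ b c) :
    3 * Υ * γ₁ = γ₂ ^ 2 ∧ 27 * Υ ^ 2 * γ₀ = γ₂ ^ 3 := by
  obtain ⟨hc, h2, h1, h0⟩ := h
  have hc2 : c ^ 2 ≠ 0 := pow_ne_zero 2 hc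
  have hc3 : c ^ 3 ≠ 0 := pow_ne_zero 3 hc
  constructor
  · have e : (3 * Υ * γ₁) * c ^ 2 = γ₂ ^ 2 * c ^ 2 := by
      linear_combination 3 * Υ * h1 - (γ₂ * c - 3 * Υ * b) * h2
    exact mul_right_cancel₀ hc2 e
  · have e : (27 * Υ ^ 2 * γ₀) * c ^ 3 = γ₂ ^ 3 * c ^ 3 := by
      linear_combination 27 * Υ ^ 2 * h0
        - (γ₂ ^ 2 * c ^ 2 - 3 * Υ * b * γ₂ * c + 9 * Υ ^ 2 * b ^ 2) * h2
    exact mul_right_cancel₀ hc3 e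

/-- (C³): the generic standing hypothesis on the constants. Under it no directrix direction of any
initial class form lies off S′, whatever the weights. -/
def C3 (Υ γ₀ γ₁ γ₂ : k) : Prop := ¬ (3 * Υ * γ₁ = γ₂ ^ 2 ∧ 27 * Υ ^ 2 * γ₀ = γ₂ ^ 3)

theorem cubeF_dir_onS_of_C3 (hk2 : (2 : k) ≠ 0) (hk3 : (3 : k) ≠ 0) {Υ : k} (hΥ : Υ ≠ 0)
    {γ₀ γ₁ γ₂ : k} (hC : C3 Υ γ₀ γ₁ γ₂) {i₀ j₀ i₁ j₁ i₂ j₂ : ℕ} (h0 : i₀ + j₀ = 3)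
    (h1 : i₁ + j₁ = 2) (h2 : i₂ + j₂ = 1) {a b c d : k}
    (H : ∀ z y u v : k, cubeF Υ γ₀ γ₁ γ₂ i₀ j₀ i₁ j₁ i₂ j₂ (z + a) (y + b) (u + c) (v + d)
        = cubeF Υ γ₀ γ₁ γ₂ i₀ j₀ i₁ j₁ i₂ j₂ z y u v) :
    a = 0 ∧ b = 0 := by
  obtain ⟨ha, h⟩ := cubeF_dir hk2 hk3 hΥ γ₀ γ₁ γ₂ h0 h1 h2 H
  refine ⟨ha, ?_⟩
  rcases h with hb | ⟨-, -, -, hrel⟩ | ⟨-, -, -, hrel⟩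
  · exact hb
  · exact absurd hrel.constants hC
  · exact absurd hrel.constants hC

/-- Sharpness: in the cube case `Υ (z³ + (y + λ u)³)` the off-S′ direction `(0, λ, -1, d)` IS a
translation direction (the affine off-S′ near point `(z′, y′) = (0, -λ)` of the `u`-chart). -/
theorem cubeF_cube_invariant (Υ l d : k) (z y u v : k) :
    cubeF Υ (Υ * l ^ 3) (3 * Υ * l ^ 2) (3 * Υ * l) 3 0 2 0 1 0 (z + 0) (y + l) (u + -1) (v + d)
      = cubeF Υ (Υ * l ^ 3) (3 * Υ * l ^ 2) (3 * Υ * l) 3 0 2 0 1 0 z y u v := by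
  unfold cubeF; ring

theorem cubeF_cube_eq (Υ l z y u v : k) :
    cubeF Υ (Υ * l ^ 3) (3 * Υ * l ^ 2) (3 * Υ * l) 3 0 2 0 1 0 z y u v
      = Υ * (z ^ 3 + (y + l * u) ^ 3) := by
  unfold cubeF; ring


/-! ### §9b  The dichotomy at a NODE of the game (weights `K.w`, `N.w`, cubic weight 0) -/

/-- exponent of the `u`-branch in the initial cubic: the weight `m_b` of a TIGHT class
(`m_b + n_b + b = 3`, both branches carrying the class), a dummy `3 - b` otherwise -/
def tExpU (b : ℕ) : Wt → Wt → ℕ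
  | some m, some n => if m + n + b = 3 then m else 3 - b
  | _, _ => 3 - b

/-- exponent of the `v`-branch in the initial cubic (dummy `0` for a class that is not tight) -/
def tExpV (b : ℕ) : Wt → Wt → ℕ
  | some m, some n => if m + n + b = 3 then n else 0
  | _, _ => 0

/-- coefficient of class `b` in the initial cubic: the unit constant `κ_b = c_b(0)` if the class is
tight at the node, `0` otherwise (the class term then has degree ≥ 4 or is absent) -/
def tCoef (b : ℕ) : Wt → Wt → k → k
  | some m, some n, κ => if m + n + b = 3 then κ else 0
  | _, _, _ => 0

theorem tExp_sum (b : ℕ) (hb : b ≤ 3) (m n : Wt) : tExpU b m n + tExpV b m n = 3 - b := by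
  rcases m with _ | m <;> rcases n with _ | n <;> simp only [tExpU, tExpV] <;> try omega
  split_ifs <;> omega

theorem tCoef_ne_zero {b : ℕ} {m n : Wt} {κ : k} (h : tCoef b m n κ ≠ 0) :
    ∃ m' n' : ℕ, m = some m' ∧ n = some n' ∧ m' + n' + b = 3 ∧
      tExpU b m n = m' ∧ tExpV b m n = n' ∧ tCoef b m n κ = κ := by
  rcases m with _ | m' <;> rcases n with _ | n'
  · simp [tCoef] at h
  · simp [tCoef] at h
  · simp [tCoef] at h
  · by_cases ht : m' + n' + b = 3
    · exact ⟨m', n', rfl, rfl, ht, by simp [tExpU, ht], by simp [tExpV, ht], by simp [tCoef, ht]⟩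
    · simp [tCoef, ht] at h

/-- THE INITIAL CUBIC AT THE NODE `(K, N)` with unit constants `κ_b = c_b(0)`, `υ = U(0)` (both
branches have cubic weight 0 at a top point: `top_noCubic_*`, `monic_centres_*`), as a polynomial
function of the fibre/tangent coordinates `(z, y, u, v)`. An interior point of `K` is the node with the
trivial partner `triv`. -/
def nodeCubic (K N : Curve) (κ₀ κ₁ κ₂ υ : k) : k → k → k → k → k :=
  cubeF υ (tCoef 0 K.w.w0 N.w.w0 κ₀) (tCoef 1 K.w.w1 N.w.w1 κ₁) (tCoef 2 K.w.w2 N.w.w2 κ₂)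
    (tExpU 0 K.w.w0 N.w.w0) (tExpV 0 K.w.w0 N.w.w0) (tExpU 1 K.w.w1 N.w.w1) (tExpV 1 K.w.w1 N.w.w1)
    (tExpU 2 K.w.w2 N.w.w2) (tExpV 2 K.w.w2 N.w.w2)

theorem CubeRel.ne_zero (hk3 : (3 : k) ≠ 0) {Υ γ₀ γ₁ γ₂ b c : k} (hΥ : Υ ≠ 0) (hb : b ≠ 0)
    (h : CubeRel Υ γ₀ γ₁ γ₂ b c) : γ₀ ≠ 0 ∧ γ₁ ≠ 0 ∧ γ₂ ≠ 0 := by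
  obtain ⟨hc, h2, h1, h0⟩ := h
  refine ⟨?_, ?_, ?_⟩
  · rintro rfl
    have : Υ * b ^ 3 = 0 := by linear_combination h0
    exact (mul_ne_zero hΥ (pow_ne_zero 3 hb)) this
  · rintro rfl
    have : 3 * Υ * b ^ 2 = 0 := by linear_combination -h1
    exact (mul_ne_zero (mul_ne_zero hk3 hΥ) (pow_ne_zero 2 hb)) this
  · rintro rfl
    have : 3 * Υ * b = 0 := by linear_combination h2
    exact (mul_ne_zero (mul_ne_zero hk3 hΥ) hb) this

/-- NEAR POINTS OFF S′ AT A NODE OF THE GAME (char `k ∉ {2, 3}`): a translation direction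
`w = (a, b, c, d)` of the initial cubic at the node `(K, N)` has `a = 0`; if moreover `b ≠ 0`
(the direction is OFF S′) then ALL THREE classes are present and tight on ONE branch —
`K.w = (3, 2, 1)` and `N.w = (0, 0, 0)`, or the other way round — and the unit constants satisfy the
cube relation (hence violate (C³), `CubeRel.constants`). Every other node — in particular every node
with a class of slack ≥ 1, every node whose tight classes are spread over both branches, every
interior point of a deep curve other than `(3, 2, 1)` — has all its directrix directions on S′. -/
theorem nodeCubic_dir (hk2 : (2 : k) ≠ 0) (hk3 : (3 : k) ≠ 0) (K N : Curve) {κ₀ κ₁ κ₂ υ : k}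
    (hυ : υ ≠ 0) {a b c d : k}
    (H : ∀ z y u v : k, nodeCubic K N κ₀ κ₁ κ₂ υ (z + a) (y + b) (u + c) (v + d)
        = nodeCubic K N κ₀ κ₁ κ₂ υ z y u v) :
    a = 0 ∧ (b = 0 ∨
      (K.w.w0 = some 3 ∧ K.w.w1 = some 2 ∧ K.w.w2 = some 1 ∧
        N.w.w0 = some 0 ∧ N.w.w1 = some 0 ∧ N.w.w2 = some 0 ∧ CubeRel υ κ₀ κ₁ κ₂ b c) ∨
      (N.w.w0 = some 3 ∧ N.w.w1 = some 2 ∧ N.w.w2 = some 1 ∧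
        K.w.w0 = some 0 ∧ K.w.w1 = some 0 ∧ K.w.w2 = some 0 ∧ CubeRel υ κ₀ κ₁ κ₂ b d)) := by
  unfold nodeCubic at H
  obtain ⟨ha, h⟩ := cubeF_dir hk2 hk3 hυ _ _ _ (tExp_sum 0 (by norm_num) _ _)
    (tExp_sum 1 (by norm_num) _ _) (tExp_sum 2 (by norm_num) _ _) H
  refine ⟨ha, ?_⟩
  rcases h with hb | ⟨hj2, hj1, hj0, hrel⟩ | ⟨hi2, hi1, hi0, hrel⟩
  · exact Or.inl hb
  · by_cases hb : b = 0
    · exact Or.inl hb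
    right; left
    obtain ⟨hγ₀, hγ₁, hγ₂⟩ := hrel.ne_zero hk3 hυ hb
    obtain ⟨m₀, n₀, hK0, hN0, ht0, hU0, hV0, hc0⟩ := tCoef_ne_zero hγ₀
    obtain ⟨m₁, n₁, hK1, hN1, ht1, hU1, hV1, hc1⟩ := tCoef_ne_zero hγ₁
    obtain ⟨m₂, n₂, hK2, hN2, ht2, hU2, hV2, hc2⟩ := tCoef_ne_zero hγ₂
    rw [hc0, hc1, hc2] at hrel
    rw [hV0] at hj0; rw [hV1] at hj1; rw [hV2] at hj2
    subst hj0 hj1 hj2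
    refine ⟨?_, ?_, ?_, hN0, hN1, hN2, hrel⟩
    · have e : m₀ = 3 := by omega
      rw [hK0, e]
    · have e : m₁ = 2 := by omega
      rw [hK1, e]
    · have e : m₂ = 1 := by omega
      rw [hK2, e]
  · by_cases hb : b = 0
    · exact Or.inl hb
    right; right
    obtain ⟨hγ₀, hγ₁, hγ₂⟩ := hrel.ne_zero hk3 hυ hb
    obtain ⟨m₀, n₀, hK0, hN0, ht0, hU0, hV0, hc0⟩ := tCoef_ne_zero hγ₀
    obtain ⟨m₁, n₁, hK1, hN1, ht1, hU1, hV1, hc1⟩ := tCoef_ne_zero hγ₁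
    obtain ⟨m₂, n₂, hK2, hN2, ht2, hU2, hV2, hc2⟩ := tCoef_ne_zero hγ₂
    rw [hc0, hc1, hc2] at hrel
    rw [hU0] at hi0; rw [hU1] at hi1; rw [hU2] at hi2
    subst hi0 hi1 hi2
    refine ⟨?_, ?_, ?_, hK0, hK1, hK2, hrel⟩
    · have e : n₀ = 3 := by omega
      rw [hN0, e]
    · have e : n₁ = 2 := by omega
      rw [hN1, e]
    · have e : n₂ = 1 := by omega
      rw [hN2, e]

/-- Under (C³) every directrix direction of every node cubic lies on S′ (`a = b = 0`):
maximal contact of `S` persists for the multiplicity-3 locus, for ALL weights. -/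
theorem nodeCubic_dir_onS_of_C3 (hk2 : (2 : k) ≠ 0) (hk3 : (3 : k) ≠ 0) (K N : Curve)
    {κ₀ κ₁ κ₂ υ : k} (hυ : υ ≠ 0) (hC : C3 υ κ₀ κ₁ κ₂) {a b c d : k}
    (H : ∀ z y u v : k, nodeCubic K N κ₀ κ₁ κ₂ υ (z + a) (y + b) (u + c) (v + d)
        = nodeCubic K N κ₀ κ₁ κ₂ υ z y u v) : a = 0 ∧ b = 0 := by
  obtain ⟨ha, h⟩ := nodeCubic_dir hk2 hk3 K N hυ H
  refine ⟨ha, ?_⟩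
  rcases h with hb | ⟨-, -, -, -, -, -, hrel⟩ | ⟨-, -, -, -, -, -, hrel⟩
  · exact hb
  · exact absurd hrel.constants hC
  · exact absurd hrel.constants hC

/-- sanity: the seed node of the sheet, `K = (3,2,1; 0)` deep against the trivial partner —
its initial cubic is the full tight cubic `υ(z³+y³) + κ₂ y²u + κ₁ yu² + κ₀ u³`. -/
example (κ₀ κ₁ κ₂ υ z y u v : k) :
    nodeCubic ⟨⟨some 3, some 2, some 1⟩, 0, true⟩ triv κ₀ κ₁ κ₂ υ z y u v
      = υ * (z ^ 3 + y ^ 3) + κ₂ * y ^ 2 * u + κ₁ * y * u ^ 2 + κ₀ * u ^ 3 := by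
  simp [nodeCubic, cubeF, tCoef, tExpU, tExpV, triv]

/-- sanity: a TOP node with tight classes spread over both branches, `K = (2,2,0)`, `N = (1,0,1)`
(`o = (3,2,1)`): initial cubic `υ(z³+y³) + κ₂ y²v + κ₁ yu² + κ₀ u²v` — by `nodeCubic_dir` all its
directrix directions lie on S′ whatever the constants (char ≠ 2, 3). -/
example (κ₀ κ₁ κ₂ υ z y u v : k) :
    nodeCubic ⟨⟨some 2, some 2, some 0⟩, 0, true⟩ ⟨⟨some 1, some 0, some 1⟩, 0, true⟩ κ₀ κ₁ κ₂ υ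
        z y u v
      = υ * (z ^ 3 + y ^ 3) + κ₂ * y ^ 2 * v + κ₁ * y * u ^ 2 + κ₀ * (u ^ 2 * v) := by
  simp [nodeCubic, cubeF, tCoef, tExpU, tExpV]


/-! ### §9c  The BRIDGE: the degree-3 coefficients of the class form at a top point ARE the node cubic
(rev 5.1). At a node `(K, N)` with `o = K.w + N.w ≥ (3,2,1)` (TOP, `isDeepW`) and no cubic weight, the class
form has order 3 (§8) and its degree-3 Taylor coefficients are given by the table `cubicCoeff` below — the
coefficient table of the polynomial `nodeCubic K N (c₀(0)) (c₁(0)) (c₂(0)) (U(0))` of §9b (`nodeCubic_eq`: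
the same five monomials with the same coefficients). So `in_x f = nodeCubic`, for all unit values. -/

/-- the coefficient TABLE of the node cubic on exponent vectors `(e_z, e_y, e_u, e_v)` -/
noncomputable def cubicCoeff (K N : Curve) (κ₀ κ₁ κ₂ υ : k) (e : Fin 4 →₀ ℕ) : k :=
  (if e = ev 0 0 (tExpU 0 K.w.w0 N.w.w0) (tExpV 0 K.w.w0 N.w.w0) then tCoef 0 K.w.w0 N.w.w0 κ₀ else 0) +
  (if e = ev 0 1 (tExpU 1 K.w.w1 N.w.w1) (tExpV 1 K.w.w1 N.w.w1) then tCoef 1 K.w.w1 N.w.w1 κ₁ else 0) +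
  (if e = ev 0 2 (tExpU 2 K.w.w2 N.w.w2) (tExpV 2 K.w.w2 N.w.w2) then tCoef 2 K.w.w2 N.w.w2 κ₂ else 0) +
  ((if e = ev 3 0 0 0 then υ else 0) + (if e = ev 0 3 0 0 then υ else 0))

/-- `nodeCubic` displayed: the five monomials of the table `cubicCoeff` -/
theorem nodeCubic_eq (K N : Curve) (κ₀ κ₁ κ₂ υ z y u v : k) :
    nodeCubic K N κ₀ κ₁ κ₂ υ z y u v =
      υ * (z ^ 3 + y ^ 3) +
      tCoef 2 K.w.w2 N.w.w2 κ₂ * y ^ 2 * (u ^ tExpU 2 K.w.w2 N.w.w2 * v ^ tExpV 2 K.w.w2 N.w.w2) +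
      tCoef 1 K.w.w1 N.w.w1 κ₁ * y * (u ^ tExpU 1 K.w.w1 N.w.w1 * v ^ tExpV 1 K.w.w1 N.w.w1) +
      tCoef 0 K.w.w0 N.w.w0 κ₀ * (u ^ tExpU 0 K.w.w0 N.w.w0 * v ^ tExpV 0 K.w.w0 N.w.w0) := rfl

/-- degree-3 coefficients of one class term `c_b · y^b u^m v^n` at a top point (`b + m + n ≥ 3`):
the unit constant on the tight exponent, nothing otherwise -/
theorem coeff_oterm_clsUp_deg3 (b : ℕ) (w e' : Wt) (c : MvPowerSeries (Fin 4) k)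
    (htop : ∀ m n : ℕ, w = some m → e' = some n → 3 ≤ b + m + n) (d : Fin 4 →₀ ℕ) (hd : d.degree = 3) :
    coeff d (oterm (clsUp b w e') c) =
      if d = ev 0 b (tExpU b w e') (tExpV b w e') then tCoef b w e' (constantCoeff c) else 0 := by
  rcases w with _ | m <;> rcases e' with _ | n
  · simp [clsUp, tCoef]
  · simp [clsUp, tCoef]
  · simp [clsUp, tCoef]
  · simp only [clsUp, oterm_some, coeff_monomial_one_mul, tExpU, tExpV, tCoef]
    by_cases ht : m + n + b = 3
    · simp only [ht, if_true]
      by_cases hle : ev 0 b m n ≤ d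
      · have heq : ev 0 b m n = d := eq_of_le_of_degree_le hle (by rw [hd, degree_ev]; omega)
        subst heq
        simp
      · have hne : ¬ d = ev 0 b m n := fun h => hle (h ▸ le_refl _)
        simp [hle, hne]
    · simp only [ht, if_false, ite_self]
      have hle : ¬ ev 0 b m n ≤ d := fun h => by
        have h1 := degree_le_of_le h
        have h2 := htop m n rfl rfl
        rw [degree_ev, hd] at h1
        omega
      simp [hle]

/-- degree-3 coefficients of `U · X_i³`: the unit constant on `3e_i`, nothing otherwise -/
theorem coeff_mul_X_pow_three_deg3 (U : MvPowerSeries (Fin 4) k) (i : Fin 4) (d : Fin 4 →₀ ℕ)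
    (hd : d.degree = 3) :
    coeff d (U * X i ^ 3) = if d = Finsupp.single i 3 then constantCoeff U else 0 := by
  rw [X_pow_eq, coeff_mul_monomial, mul_one]
  by_cases hle : Finsupp.single i 3 ≤ d
  · have heq : Finsupp.single i 3 = d :=
      eq_of_le_of_degree_le hle (by rw [hd, Finsupp.degree_single])
    subst heq
    simp
  · have hne : ¬ d = Finsupp.single i 3 := fun h => hle (h ▸ le_refl _)
    simp [hle, hne]

theorem ev_three_zero : ev 3 0 0 0 = Finsupp.single 0 3 := by simp [ev]
theorem ev_zero_three : ev 0 3 0 0 = Finsupp.single 1 3 := by simp [ev]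
theorem ev_zero : ev 0 0 0 0 = 0 := by simp [ev]

/-- ★★ THE BRIDGE. At a TOP node without cubic weight the degree-3 coefficients of the class form are the
table `cubicCoeff` of the node cubic with the unit CONSTANTS — for all unit values (indeed for all
coefficient series: the hypothesis that `c_b, U` are units is not even needed for the identity). -/
theorem coeff_classForm_deg3 (K N : Curve) (c₀ c₁ c₂ U : MvPowerSeries (Fin 4) k)
    (htop : isDeepW (W3.add K.w N.w) = true) (h3K : K.w3 = 0) (h3N : N.w3 = 0)
    (d : Fin 4 →₀ ℕ) (hd : d.degree = 3) :
    coeff d (classForm K N c₀ c₁ c₂ U) =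
      cubicCoeff K N (constantCoeff c₀) (constantCoeff c₁) (constantCoeff c₂) (constantCoeff U) d := by
  have ht := htop
  simp only [isDeepW, W3.ge, W3.add, Bool.and_eq_true, wge_iff] at ht
  obtain ⟨⟨ht0, ht1⟩, ht2⟩ := ht
  have hw : ∀ (w e' : Wt) (t : ℕ), (∀ s, wadd w e' = some s → t ≤ s) →
      ∀ m n : ℕ, w = some m → e' = some n → t ≤ m + n := by
    intro w e' t h m n hm hn
    subst hm hn
    exact h (m + n) rfl
  have e0 := coeff_oterm_clsUp_deg3 0 K.w.w0 N.w.w0 c₀ (fun m n hm hn => by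
    have := hw _ _ _ ht0 m n hm hn; omega) d hd
  have e1 := coeff_oterm_clsUp_deg3 1 K.w.w1 N.w.w1 c₁ (fun m n hm hn => by
    have := hw _ _ _ ht1 m n hm hn; omega) d hd
  have e2 := coeff_oterm_clsUp_deg3 2 K.w.w2 N.w.w2 c₂ (fun m n hm hn => by
    have := hw _ _ _ ht2 m n hm hn; omega) d hd
  have e3 : coeff d (monomial (ev 0 0 K.w3 N.w3) (1 : k) * (U * (X 0 ^ 3 + X 1 ^ 3))) =
      (if d = ev 3 0 0 0 then constantCoeff U else 0) + (if d = ev 0 3 0 0 then constantCoeff U else 0) := by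
    rw [h3K, h3N, ev_zero, monomial_zero_one, one_mul, mul_add, map_add,
      coeff_mul_X_pow_three_deg3 U 0 d hd, coeff_mul_X_pow_three_deg3 U 1 d hd, ev_three_zero, ev_zero_three]
  simp only [classForm, map_add, cubicCoeff]
  rw [e0, e1, e2, e3]

/-- sanity (the seed node of the sheet, `K = (3,2,1; 0)` deep against `triv`): the table is the full tight
cubic — `κ₀` on `u³`, `κ₁` on `yu²`, `κ₂` on `y²u`, `υ` on `z³` and on `y³`. -/
example (κ₀ κ₁ κ₂ υ : k) :
    cubicCoeff ⟨⟨some 3, some 2, some 1⟩, 0, true⟩ triv κ₀ κ₁ κ₂ υ (ev 0 1 2 0) = κ₁ := by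
  have h1 : ev 0 1 2 0 ≠ ev 0 0 3 0 := fun h => by simpa using congrArg (fun f => f 1) h
  have h2 : ev 0 1 2 0 ≠ ev 0 2 1 0 := fun h => by simpa using congrArg (fun f => f 1) h
  have h3 : ev 0 1 2 0 ≠ ev 3 0 0 0 := fun h => by simpa using congrArg (fun f => f 0) h
  have h4 : ev 0 1 2 0 ≠ ev 0 3 0 0 := fun h => by simpa using congrArg (fun f => f 1) h
  simp [cubicCoeff, tExpU, tExpV, tCoef, triv, h1, h2, h3, h4]


/-! ### §9d  The S′-part of the directrix (rev 5.2): which directions `(0, 0, c, d)` ALONG S′ are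
translation directions of the node cubic? Exactly those with `c = 0` if some tight class has a positive
`u`-exponent and `d = 0` if some tight class has a positive `v`-exponent (`cubeF_dir_S`, converse
`cubeF_S_invariant`). With §9 this describes `Dir_x` at every node under (C³) completely, i.e. the
invariant `e(x) = dim Dir_x ∈ {0, 1, 2}` of Cossart–Jannsen–Saito in terms of the weights: `e = 2` iff no
class is tight (all classes slack — e.g. interior points of deep curves of weight `≥ (4,3,2)`… precisely
`b + m_b + n_b ≥ 4` for every present class), and by Thm 2.14 near points over `x` can only lie in
`ℙ(Dir_x / T_x D)` — for an interior point of a deep curve `K` with a tight class, NOWHERE (the curve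
`K′ = S′ ∩ exc` over it is not deep: consistent with `accD`, since `K.w − (3,2,1)` is deep iff
`K.w ≥ (6,4,2)`, which excludes tight classes). -/

theorem shift_pow_eq_zero {i : ℕ} (hi : 1 ≤ i) {c d : k} {j : ℕ} {γ : k} (hγ : γ ≠ 0)
    (H : ∀ u v : k, γ * ((u + c) ^ i * (v + d) ^ j) = γ * (u ^ i * v ^ j)) : c = 0 := by
  have h := H (-c) 1
  have hi0 : i ≠ 0 := by omega
  simp only [neg_add_cancel, one_pow, mul_one, zero_pow hi0, zero_mul, mul_zero] at h
  -- h : 0 = γ * (-c) ^ i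
  have : (-c) ^ i = 0 := by
    rcases mul_eq_zero.mp h.symm with h' | h'
    · exact absurd h' hγ
    · exact h'
  exact neg_eq_zero.mp (pow_eq_zero_iff hi0 |>.mp this)

theorem shift_pow_eq_zero' {j : ℕ} (hj : 1 ≤ j) {c d : k} {i : ℕ} {γ : k} (hγ : γ ≠ 0)
    (H : ∀ u v : k, γ * ((u + c) ^ i * (v + d) ^ j) = γ * (u ^ i * v ^ j)) : d = 0 := by
  refine shift_pow_eq_zero (i := j) (j := i) (d := c) hj hγ fun v u => ?_
  have := H u v
  rw [mul_comm ((u + c) ^ i), mul_comm (u ^ i)] at this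
  exact this

/-- ★ the S′-part: a translation direction `(0, 0, c, d)` of the node cubic has `c = 0` as soon as some
class with non-zero coefficient has a positive `u`-exponent, `d = 0` as soon as one has a positive
`v`-exponent (char `≠ 2`; no condition from `Υ`). -/
theorem cubeF_dir_S (hk2 : (2 : k) ≠ 0) (Υ γ₀ γ₁ γ₂ : k) (i₀ j₀ i₁ j₁ i₂ j₂ : ℕ) {c d : k}
    (H : ∀ z y u v : k, cubeF Υ γ₀ γ₁ γ₂ i₀ j₀ i₁ j₁ i₂ j₂ (z + 0) (y + 0) (u + c) (v + d)
        = cubeF Υ γ₀ γ₁ γ₂ i₀ j₀ i₁ j₁ i₂ j₂ z y u v) :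
    (γ₀ ≠ 0 → (1 ≤ i₀ → c = 0) ∧ (1 ≤ j₀ → d = 0)) ∧
    (γ₁ ≠ 0 → (1 ≤ i₁ → c = 0) ∧ (1 ≤ j₁ → d = 0)) ∧
    (γ₂ ≠ 0 → (1 ≤ i₂ → c = 0) ∧ (1 ≤ j₂ → d = 0)) := by
  have E0 : ∀ u v : k, γ₀ * ((u + c) ^ i₀ * (v + d) ^ j₀) = γ₀ * (u ^ i₀ * v ^ j₀) := by
    intro u v
    have h0 := H 0 0 u v
    simp only [cubeF, add_zero] at h0
    linear_combination h0
  have E1 : ∀ u v : k, γ₁ * ((u + c) ^ i₁ * (v + d) ^ j₁) = γ₁ * (u ^ i₁ * v ^ j₁) := by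
    intro u v
    have h1 := H 0 1 u v
    have hm := H 0 (-1) u v
    simp only [cubeF, add_zero] at h1 hm
    refine mul_left_cancel₀ hk2 ?_
    linear_combination h1 - hm
  have E2 : ∀ u v : k, γ₂ * ((u + c) ^ i₂ * (v + d) ^ j₂) = γ₂ * (u ^ i₂ * v ^ j₂) := by
    intro u v
    have h0 := H 0 0 u v
    have h1 := H 0 1 u v
    have hm := H 0 (-1) u v
    simp only [cubeF, add_zero] at h0 h1 hm
    refine mul_left_cancel₀ hk2 ?_
    linear_combination h1 + hm - 2 * h0
  exact ⟨fun hγ => ⟨fun hi => shift_pow_eq_zero hi hγ E0, fun hj => shift_pow_eq_zero' hj hγ E0⟩,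
    fun hγ => ⟨fun hi => shift_pow_eq_zero hi hγ E1, fun hj => shift_pow_eq_zero' hj hγ E1⟩,
    fun hγ => ⟨fun hi => shift_pow_eq_zero hi hγ E2, fun hj => shift_pow_eq_zero' hj hγ E2⟩⟩

theorem shift_pow_eq {i : ℕ} {c : k} (h : 1 ≤ i → c = 0) (u : k) : (u + c) ^ i = u ^ i := by
  rcases Nat.eq_zero_or_pos i with rfl | hi
  · simp
  · rw [h hi, add_zero]

/-- converse: these conditions make `(0, 0, c, d)` a translation direction — so under (C³) the directrix
of the node cubic is EXACTLY `{a = b = 0} ∩ {c = 0 if a tight class has m_b ≥ 1} ∩ {d = 0 if a tight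
class has n_b ≥ 1}`. -/
theorem cubeF_S_invariant (Υ γ₀ γ₁ γ₂ : k) (i₀ j₀ i₁ j₁ i₂ j₂ : ℕ) {c d : k}
    (h0 : γ₀ = 0 ∨ ((1 ≤ i₀ → c = 0) ∧ (1 ≤ j₀ → d = 0)))
    (h1 : γ₁ = 0 ∨ ((1 ≤ i₁ → c = 0) ∧ (1 ≤ j₁ → d = 0)))
    (h2 : γ₂ = 0 ∨ ((1 ≤ i₂ → c = 0) ∧ (1 ≤ j₂ → d = 0))) (z y u v : k) :
    cubeF Υ γ₀ γ₁ γ₂ i₀ j₀ i₁ j₁ i₂ j₂ (z + 0) (y + 0) (u + c) (v + d)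
      = cubeF Υ γ₀ γ₁ γ₂ i₀ j₀ i₁ j₁ i₂ j₂ z y u v := by
  have M0 : γ₀ * ((u + c) ^ i₀ * (v + d) ^ j₀) = γ₀ * (u ^ i₀ * v ^ j₀) := by
    rcases h0 with h | ⟨hc, hd⟩
    · simp [h]
    · rw [shift_pow_eq hc, shift_pow_eq hd]
  have M1 : γ₁ * ((u + c) ^ i₁ * (v + d) ^ j₁) = γ₁ * (u ^ i₁ * v ^ j₁) := by
    rcases h1 with h | ⟨hc, hd⟩
    · simp [h]
    · rw [shift_pow_eq hc, shift_pow_eq hd]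
  have M2 : γ₂ * ((u + c) ^ i₂ * (v + d) ^ j₂) = γ₂ * (u ^ i₂ * v ^ j₂) := by
    rcases h2 with h | ⟨hc, hd⟩
    · simp [h]
    · rw [shift_pow_eq hc, shift_pow_eq hd]
  simp only [cubeF, add_zero]
  linear_combination y ^ 2 * M2 + y * M1 + M0

/-- ★ game level: at a node `(K, N)` with UNIT constants, a translation direction `(0, 0, c, d)` of the
node cubic has `c = 0` if some TIGHT class has `m_b ≥ 1` and `d = 0` if some tight class has `n_b ≥ 1`. -/
theorem nodeCubic_dir_S (hk2 : (2 : k) ≠ 0) (K N : Curve) {κ₀ κ₁ κ₂ υ : k}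
    (hκ₀ : κ₀ ≠ 0) (hκ₁ : κ₁ ≠ 0) (hκ₂ : κ₂ ≠ 0) {c d : k}
    (H : ∀ z y u v : k, nodeCubic K N κ₀ κ₁ κ₂ υ (z + 0) (y + 0) (u + c) (v + d)
        = nodeCubic K N κ₀ κ₁ κ₂ υ z y u v) :
    (∀ m n : ℕ, K.w.w0 = some m → N.w.w0 = some n → m + n + 0 = 3 → (1 ≤ m → c = 0) ∧ (1 ≤ n → d = 0)) ∧
    (∀ m n : ℕ, K.w.w1 = some m → N.w.w1 = some n → m + n + 1 = 3 → (1 ≤ m → c = 0) ∧ (1 ≤ n → d = 0)) ∧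
    (∀ m n : ℕ, K.w.w2 = some m → N.w.w2 = some n → m + n + 2 = 3 → (1 ≤ m → c = 0) ∧ (1 ≤ n → d = 0)) := by
  unfold nodeCubic at H
  obtain ⟨d0, d1, d2⟩ := cubeF_dir_S hk2 _ _ _ _ _ _ _ _ _ _ H
  refine ⟨?_, ?_, ?_⟩
  · intro m n hm hn ht
    have := d0 (by rw [hm, hn]; simp [tCoef, ht, hκ₀])
    rw [hm, hn] at this; simpa [tExpU, tExpV, ht] using this
  · intro m n hm hn ht
    have := d1 (by rw [hm, hn]; simp [tCoef, ht, hκ₁])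
    rw [hm, hn] at this; simpa [tExpU, tExpV, ht] using this
  · intro m n hm hn ht
    have := d2 (by rw [hm, hn]; simp [tCoef, ht, hκ₂])
    rw [hm, hn] at this; simpa [tExpU, tExpV, ht] using this

/-- sanity: at an interior point of the deep curve `K = (4,2,1)` (class 1 tight with `m₁ = 2 ≥ 1`) every
translation direction along S′ has `c = 0`: `Dir = T_K = ⟨∂_v⟩`, no near point over interior points of
`K` after its blow-up (Thm 2.14) — and indeed `accD` gives the non-deep weight `(1,0,0)`. -/
example (hk2 : (2 : k) ≠ 0) {κ₀ κ₁ κ₂ υ c d : k} (hκ₀ : κ₀ ≠ 0) (hκ₁ : κ₁ ≠ 0) (hκ₂ : κ₂ ≠ 0)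
    (H : ∀ z y u v : k,
      nodeCubic ⟨⟨some 4, some 2, some 1⟩, 0, true⟩ triv κ₀ κ₁ κ₂ υ (z + 0) (y + 0) (u + c) (v + d)
        = nodeCubic ⟨⟨some 4, some 2, some 1⟩, 0, true⟩ triv κ₀ κ₁ κ₂ υ z y u v) : c = 0 :=
  ((nodeCubic_dir_S hk2 _ _ hκ₀ hκ₁ hκ₂ H).2.1 2 0 rfl rfl rfl).1 (by norm_num)

end NearPoints

/-! ### §9e (rev 5.3) — INTERIOR POINTS OF EXCEPTIONAL CURVES: TWISTED LOCAL CONSTANTS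
(kernel support for the ERRATUM of dictionary rev 1.4.3 §7). At the interior point `u′ = t ≠ 0` of an exceptional
curve born at a node, the partner monomial `u′ ^ m_b` is a unit with constant term `t ^ m_b`, so the node cubic
there carries the TWISTED constants `γ_b · t ^ m_b` (`Υ` untwisted, `o₃ = 0`); the hypothesis of «tracking» is the
cube condition for these LOCAL constants. Kernel content: (1) the twist of a constant term (polynomial units;
re-centring at `u′ = t` is not a formal power-series substitution); (2) the cube relations are invariant under the
torus rescalings of `(z, y)` and of `u`, so the two affine charts of the interior agree; (3) in the balanced case
`m₁ = 2 m₂ ∧ m₀ = 3 m₂` the twisted relations at any `t ≠ 0` are `¬ C3` itself; (4) ELIMINATION: if both twisted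
relations hold at some `t ≠ 0`, the constants satisfy a `t`-free monomial relation — for `(a, b) ≠ (0, 0)` with
`a e₁ = b e₂` resp. `a e₁ + b e₂ = 0` (`e₁ = m₁ - 2m₂`, `e₂ = m₀ - 3m₂` as integers) a proper closed condition on
`(Υ, γ₀, γ₁, γ₂)`; so, per (3,2,1)-accept event of the play, the bad constants form a proper closed set and the
condition (C³)⁺ of the dictionary is generic. -/
section Twists

variable {k : Type*} [Field k]

/-- (1) the constant term of `c · (t + x_i) ^ m` is `c(0) · t ^ m` (polynomial units). -/
theorem constantCoeff_twist {R : Type*} [CommRing R] (c : MvPolynomial (Fin 4) R) (t : R) (i : Fin 4)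
    (m : ℕ) : MvPolynomial.constantCoeff (c * (MvPolynomial.C t + MvPolynomial.X i) ^ m)
      = MvPolynomial.constantCoeff c * t ^ m := by
  simp [map_add, MvPolynomial.constantCoeff_C, MvPolynomial.constantCoeff_X]

private theorem eq_iff_of_sub_eq_mul {a b c d m : k} (hm : m ≠ 0) (e : a - b = m * (c - d)) :
    a = b ↔ c = d := by
  rw [← sub_eq_zero, e, mul_eq_zero, sub_eq_zero, or_iff_right hm]

/-- (2) torus invariance: rescaling `(z, y) ↦ μ • (z, y)`, `u ↦ ν • u` sends the constants of a single-branch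
tight `(3,2,1)` node cubic to `(Υ μ³, γ₀ ν³, γ₁ μ ν², γ₂ μ² ν)`; the cube condition is unchanged. -/
theorem C3_rescale {Υ γ₀ γ₁ γ₂ μ ν : k} (hμ : μ ≠ 0) (hν : ν ≠ 0) :
    C3 (Υ * μ ^ 3) (γ₀ * ν ^ 3) (γ₁ * μ * ν ^ 2) (γ₂ * μ ^ 2 * ν) ↔ C3 Υ γ₀ γ₁ γ₂ := by
  unfold C3
  refine not_congr (and_congr ?_ ?_)
  · exact eq_iff_of_sub_eq_mul (m := μ ^ 4 * ν ^ 2) (by positivity) (by ring)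
  · exact eq_iff_of_sub_eq_mul (m := μ ^ 6 * ν ^ 3) (by positivity) (by ring)

/-- (3) balanced exponents: the twisted relations at any `t ≠ 0` are the untwisted ones. -/
theorem twisted_iff_of_balanced {Υ γ₀ γ₁ γ₂ t : k} (ht : t ≠ 0) {m₀ m₁ m₂ : ℕ} (h1 : m₁ = 2 * m₂)
    (h0 : m₀ = 3 * m₂) :
    (3 * Υ * γ₁ * t ^ m₁ = γ₂ ^ 2 * t ^ (2 * m₂) ∧ 27 * Υ ^ 2 * γ₀ * t ^ m₀ = γ₂ ^ 3 * t ^ (3 * m₂))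
      ↔ ¬ C3 Υ γ₀ γ₁ γ₂ := by
  subst h1 h0
  unfold C3
  rw [not_not, mul_left_inj' (pow_ne_zero _ ht), mul_left_inj' (pow_ne_zero _ ht)]

/-- (4a) elimination of `t`, exponents of the same sign (`a e₁ = b e₂`, written without subtraction). -/
theorem twist_elim_same {A B A' B' t : k} (ht : t ≠ 0) {m₀ m₁ m₂ a b : ℕ}
    (h1 : A * t ^ m₁ = B * t ^ (2 * m₂)) (h2 : A' * t ^ m₀ = B' * t ^ (3 * m₂))
    (hab : a * m₁ + 3 * b * m₂ = 2 * a * m₂ + b * m₀) : A ^ a * B' ^ b = B ^ a * A' ^ b := by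
  have e1 : (A * t ^ m₁) ^ a * (B' * t ^ (3 * m₂)) ^ b = (B * t ^ (2 * m₂)) ^ a * (A' * t ^ m₀) ^ b := by
    rw [h1, h2]
  have e2 : A ^ a * B' ^ b * t ^ (a * m₁ + 3 * b * m₂) = B ^ a * A' ^ b * t ^ (2 * a * m₂ + b * m₀) := by
    calc A ^ a * B' ^ b * t ^ (a * m₁ + 3 * b * m₂) = (A * t ^ m₁) ^ a * (B' * t ^ (3 * m₂)) ^ b := by ring
      _ = (B * t ^ (2 * m₂)) ^ a * (A' * t ^ m₀) ^ b := e1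
      _ = B ^ a * A' ^ b * t ^ (2 * a * m₂ + b * m₀) := by ring
  rw [hab] at e2
  exact mul_right_cancel₀ (pow_ne_zero _ ht) e2

/-- (4b) elimination of `t`, exponents of opposite signs (`a e₁ + b e₂ = 0`). -/
theorem twist_elim_opp {A B A' B' t : k} (ht : t ≠ 0) {m₀ m₁ m₂ a b : ℕ}
    (h1 : A * t ^ m₁ = B * t ^ (2 * m₂)) (h2 : A' * t ^ m₀ = B' * t ^ (3 * m₂))
    (hab : a * m₁ + b * m₀ = 2 * a * m₂ + 3 * b * m₂) : A ^ a * A' ^ b = B ^ a * B' ^ b := by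
  have e1 : (A * t ^ m₁) ^ a * (A' * t ^ m₀) ^ b = (B * t ^ (2 * m₂)) ^ a * (B' * t ^ (3 * m₂)) ^ b := by
    rw [h1, h2]
  have e2 : A ^ a * A' ^ b * t ^ (a * m₁ + b * m₀) = B ^ a * B' ^ b * t ^ (2 * a * m₂ + 3 * b * m₂) := by
    calc A ^ a * A' ^ b * t ^ (a * m₁ + b * m₀) = (A * t ^ m₁) ^ a * (A' * t ^ m₀) ^ b := by ring
      _ = (B * t ^ (2 * m₂)) ^ a * (B' * t ^ (3 * m₂)) ^ b := e1
      _ = B ^ a * B' ^ b * t ^ (2 * a * m₂ + 3 * b * m₂) := by ring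
  rw [hab] at e2
  exact mul_right_cancel₀ (pow_ne_zero _ ht) e2

/-- The ILLUSTRATION of the dictionary (node `(4,3,0)+(2,1,2)`, `Γ` born `(3,2,1)`, `m = (4,3,0)`, `e = (3,4)`):
with `(a, b) = (4, 3)` the twisted relations at some `t ≠ 0` force `(3Υγ₁)⁴ (γ₂³)³ = (γ₂²)⁴ (27Υ²γ₀)³`. -/
example {Υ γ₀ γ₁ γ₂ t : k} (ht : t ≠ 0) (h1 : 3 * Υ * γ₁ * t ^ 3 = γ₂ ^ 2 * t ^ (2 * 0))
    (h2 : 27 * Υ ^ 2 * γ₀ * t ^ 4 = γ₂ ^ 3 * t ^ (3 * 0)) :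
    (3 * Υ * γ₁) ^ 4 * (γ₂ ^ 3) ^ 3 = (γ₂ ^ 2) ^ 4 * (27 * Υ ^ 2 * γ₀) ^ 3 :=
  twist_elim_same ht h1 h2 (by norm_num)

end Twists

/-- Characteristic 2 is genuinely different (CJS Thm 2.14 needs `p ≥ dim X / 2 + 1`): over
`ZMod 2` the MIXED pattern `z³ + y³ + y²v + yu² + u²v = z³ + (u + y)²(v + y)` is invariant under
the off-S′ translation `(0, 1, 1, 1)`, and it is not a cube. -/
theorem cubeF_char2_mixed : ∀ z y u v : ZMod 2,
    cubeF (1 : ZMod 2) 1 1 1 2 1 2 0 0 1 (z + 0) (y + 1) (u + 1) (v + 1)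
      = cubeF (1 : ZMod 2) 1 1 1 2 1 2 0 0 1 z y u v := by
  decide

end Summit.ResolutionOfSingularities.ResolutionOfSingularities.Cruxes.DescentPerfectToAll.GiraudWeakNormalForm.ToricSGame.Charts
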